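import Mathlib.NumberTheory.LSeries.DirichletContinuation
import Mathlib.Analysis.SpecialFunctions.Trigonometric.Bounds
import Mathlib.Analysis.SpecialFunctions.Complex.Circle
import Mathlib.Analysis.SpecialFunctions.Pow.Real
import Mathlib.Analysis.Complex.ExponentialBounds
import Mathlib.Analysis.PSeries
import Mathlib.Algebra.Order.Field.GeomSum
import Mathlib.Algebra.Ring.GeomSum
import Mathlib.Algebra.BigOperators.Intervals
import Mathlib.Topology.Order.IntermediateValue
import Literature.NumberTheory.Sieve.RamanujanSum
import Literature.NumberTheory.Sieve.GranvilleGoldbach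
import Literature.NumberTheory.LFunctions.VonKochConverse
import HarnessLib

/-!
# Barrier catalogue `Parity`: power savings in the averaged Goldbach asymptotic are zero-free
# regions — `∑_{n ≤ x} G(n) = x²/2 + O(x^{2−δ})` forces a quasi-Riemann hypothesis
# (Bhowmik–Ruzsa 2018; Granville 2007), and in progressions the exceptional zero enters the
# main term (Bhowmik–Halupczok–Matsumoto–Suzuki 2019)

Catalogue entry (D-0021) for the summit `Parity`, sub-problem `GeneralizedHardyLittlewood`
(`Literature.NumberTheory.Sieve.GeneralizedHardyLittlewood`, Green–Tao 2010, Conj. 1.2, uniform over systems of size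
`‖Ψ‖_N ≤ L`; its binary Goldbach systems `n ↦ (n, N' − n)`, `N' ≤ LN`, predict
`G(N') = J(N') + o(N')` with `G = Literature.goldbachLambdaCount`, `J = Literature.goldbachHLMain`). Seed:
"Siegel-zero / exceptional-character obstructions", here in the form printed for the Goldbach
system: every POWER SAVING in the average `S(x) = ∑_{n ≤ x} G(n)` is a statement about the real
parts of zeros of `ζ(s)` (and, in progressions, of Dirichlet `L`-functions, the Landau–Siegel zero
included), so that the power-saving strengthening of the averaged Goldbach asymptotic is exactly as
hard as a zero-free half-plane. The catalogued declaration is `GoldbachAverageZeros` (docstring =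
BARRIER block) — Bhowmik–Ruzsa's Theorem 2.1 as printed; it is PROVED here
(`GoldbachAverageZeros_holds`): the power-series/kernel step of the printed proof
(`S(x) = x²/2 + O(x^{2−δ}) ⟹ ψ(N) − N ≪ N^{1−δ/6}(log N)^{1/2}`, the named fact
`BhowmikRuzsa2018_psiBound`) is proved in the section `BhowmikRuzsa` below
(`BhowmikRuzsa2018_psiBound_holds`, a discretised circle method), and the passage from `ψ` to
the zeros is the tree's PROVED converse of von Koch's theorem
(`Literature.NumberTheory.LFunctions.VonKochConverse.quasiRiemannHypothesis_of_isBigO`: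
`ψ(x) − x = O(x^{σ₀}) ⟹ Literature.QuasiRiemannHypothesis σ₀`). Granville's Theorem 1A (RH ⟺
`∑_{2N ≤ x}(G(2N) − J(2N)) ≪ x^{3/2+o(1)}`) is the tree's `Literature.NumberTheory.Sieve.granville_thm1A`
(`Literature/NumberTheory/Sieve/GranvilleGoldbach.lean`), imported, not restated. The
arithmetic-progression version (Bhowmik–Halupczok–Matsumoto–Suzuki, Theorem 1) is vendored as the
named facts `BHMS2019_thm1_i`, `BHMS2019_thm1_ii` — both since PROVED in the sibling files
`GoldbachAverageZerosBHMSProofs.lean` (`BHMS2019_thm1_i_holds`) and `GoldbachAverageZerosProofs.lean`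
(`BHMS2019_thm1_ii_holds`, by Laplace transforms on the real axis). BARRIER AUDIT (2026-08-16,
D-0021): the entry is CONFIRMED and SHARPENED — the case `q = 1`, `a = b` of `BHMS2019_thm1_ii`
is the record with the SHARP exponent `δ' = δ` (`Re ρ ≤ 1 − δ` for `0 < δ ≤ 1/2`, RH for
`δ ≥ 1/2`), recorded and PROVED as the sibling entry `GoldbachAverageZerosNarrow`
(`GoldbachAverageZerosNarrow.lean`), where the post-2019 literature (Billington–Cheng–Schettler–Suriajaya
2025: sub-power savings versus zero-free regions) is quoted; and the technique-class parameter is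
shown to be EMPTY for `δ > 1` at the end of this file (`not_powerSavingGoldbachAverage_of_one_lt`).

* `goldbachLambdaSum x = S(x) = ∑_{n ≤ x} G(n)`;
* `PowerSavingGoldbachAverage δ` — the technique-class parameter `S(x) = x²/2 + O(x^{2−δ})`;
* `BhowmikRuzsa2018_psiBound` — named fact (proof of Thm. 2.1): for `0 < δ ≤ 1`,
  `PowerSavingGoldbachAverage δ ⟹ ψ(N) − N = O(N^{1−δ/6} (log N)^{1/2})`; PROVED
  (`BhowmikRuzsa2018_psiBound_holds`, section `BhowmikRuzsa`: `BhowmikRuzsa.abs_psi_sub_le` is the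
  explicit bound `|ψ(N) − N| ≤ (1 + 9√(40κC_ms)) N^{1−δ/6}(log N)^{1/2}` for large `N`);
* `GoldbachAverageZeros` — the record (Thm. 2.1), `goldbachAverageZeros_of_psiBound` (PROVED
  reduction), `GoldbachAverageZeros_holds` (PROVED), `GoldbachAverageZeros.quasiRiemannHypothesis`,
  `.no_powerSaving_of_zeros_near_one`;
* `goldbachLambdaCountMod`, `goldbachLambdaSumMod` (`G(n; q, a, b)`, `S(x; q, a, b)`),
  `DistinctZeroConjecture q` (DZC), `ZerosRealPartLE q d` (`B_q ≤ d`), `BHMS2019_thm1_i/ii`;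
* `not_powerSavingGoldbachAverage_of_one_lt` — `PowerSavingGoldbachAverage δ` fails for every
  `δ > 1` (PROVED: `G(n) ≤ 4 log³n + 2 log²n` at odd `n`, section `PowerSavingVacuity`).

## What the sources print (verified on the page; arXiv versions for the two papers of 2018/2019)

* G. Bhowmik, I. Z. Ruzsa, *Average Goldbach and the quasi-Riemann hypothesis*, Anal. Math. 44
  (2018) 51–56 (arXiv:1711.06442) [cite: BhowmikRuzsa2018, Abstract, §1, Theorem 2.1 and its proof, Remarks 1–2].
  Abstract: "We prove that a good average order on the Goldbach generating function implies that
  the real parts of the non-trivial zeros of the Riemann zeta function are strictly less than 1.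
  This together with existing results establishes an equivalence between such asymptotics and the
  Riemann Hypothesis." §1: `G(n) = ∑_{k₁+k₂=n} Λ(k₁)Λ(k₂)`; "Fujii [Fuj91] and Granville … showed
  that under the Riemann Hypothesis … `S(x) = ∑_{n ≤ x} G(n) = x²/2 + O(x^{3/2})`. The error term
  was eventually improved to its conjectured value `O(x^{1+ε})` [B_SP]"; "This completes the proof
  of Theorem 1A in [Gra07] i.e. a good asymptotic order of the Goldbach function is indeed
  equivalent to the Riemann Hypothesis." Theorem 2.1: "If the asymptotic relation
  `S(x) = x²/2 + O(x^{2−δ})`, `δ > 0` holds, then there exists `0 < δ' < 1` such that for the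
  non-trivial zeros `ρ` of the Riemann zeta function `Re ρ < 1 − δ'`." Proof: `F(z) = ∑ Λ(n)zⁿ`,
  `F(z)² = ∑ G(n)zⁿ = (1 − z)∑ S(n)zⁿ`; on `|z| = R = 1 − 1/N`,
  `F(z)² = 1/(1−z)² + O(|1−z|N^{3−δ})`, and for `|1−z| < N^{δ/3−1}` "we take the complex square
  root" `F(z) = 1/(1−z) + O(|1−z|²N^{3−δ})`; kernel `K(z) = z^{−N−1}(1−z^N)/(1−z)`,
  `ψ(N) = (1/2πi)∫_{|z|=R} F(z)K(z)dz = N + (1/2πi)∫(F(z) − 1/(1−z))K(z)dz`; major arc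
  `O(N^{1−δ/3})`; minor arc by Cauchy–Schwarz with `∫|F − 1/(1−z)|²|dz| = 2π∑(Λ(n)−1)²(1−1/N)^{2n} = O(N log N)`
  and `∫|K|² ≪ N^{1−δ/3}`; "The major and minor arcs together give
  `ψ(N) − N ≪ N^{1−δ/6}(log N)^{1/2}`, which proves the theorem with `δ' = δ/6`." Remark 1: "Using a
  better kernel … `δ' = δ/3`. … the methods of [1,2,4] give `δ' = δ` as soon as we have `δ' < 1`,
  through an explicit expression of `S(x)` using roots of the zeta-function." Remark 2: "In general
  we are yet unable to establish an equivalence between average orders of restricted Goldbach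
  functions and appropriate quasi Riemann Hypotheses for `L`-functions of [Gra07] or [BHMS] though
  a particular case is handled in [1] using the method of this note."
* A. Granville, *Refinements of Goldbach's conjecture, and the generalized Riemann hypothesis*,
  Funct. Approx. Comment. Math. 37 (2007) 159–173 [cite: Granville2007, Theorems 1A–1C, (1.3), §5 (5.1)–(5.2)].
  Theorem 1A (= tree `Literature.NumberTheory.Sieve.granville_thm1A`): "The Riemann Hypothesis is equivalent to the estimate
  `∑_{2N ≤ x}(G(2N) − J(2N)) ≪ x^{3/2+o(1)}`." §5: "it is not hard to show that
  `∑_{p+q ≤ x} log p log q = x²/2 − 2∑_{|Im ρ| ≤ x} x^{1+ρ}/(ρ(1+ρ)) + O(x^{2B+o(1)})` (5.1) so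
  that, by Littlewood's method, `max_{y ≤ x} |∑_{2N ≤ y} G(2N) − y²/2| = x^{1+B+o(1)}`", where
  `B = sup{Re ρ : ζ(ρ) = 0}`, "(note that `1 ≥ B ≥ 1/2`)"; "Therefore the Riemann Hypothesis
  (`B = 1/2`) is equivalent to the conjectured estimate `∑_{2N ≤ x} G(2N) = x²/2 + O(x^{3/2+o(1)})`
  (5.2)"; `∑_{2n ≤ x} J(2n) = x²/2 + O(x log x)`. Theorem 1C: GRH for all `χ (mod q)` is
  equivalent to `∑_{2N ≤ x, q ∣ 2N} G(2N) = (1/φ(q))∑_{2N ≤ x} G(2N) + O(x^{1+o(1)})`, "However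
  notice here that … the error term involves an amazing saving …, which is unsatisfying." (The
  2008 corrigendum is cited through the tree file `GranvilleGoldbach.lean` and through
  Bhowmik–Ruzsa; it was not re-read for this entry.)
* G. Bhowmik, K. Halupczok, K. Matsumoto, Y. Suzuki, *Goldbach representations in arithmetic
  progressions and zeros of Dirichlet L-functions*, Mathematika 65 (2019) 57–97 (arXiv:1704.06103)
  [cite: BhowmikHalupczokMatsumotoSuzuki2019, §1: Theorems 1–4, Remarks 1–2, (1.5); §2 (definitions)].
  §1: "the current state of knowledge on the zeros of the Riemann zeta function `ζ(s)` is not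
  enough to obtain "good" error terms unconditionally and the Riemann Hypothesis is always
  assumed in such studies. In fact obtaining sufficiently sharp error terms for average orders of
  the mean value of `G(n)` is expected to solve other conjectures like the Riemann Hypothesis".
  `G(n;q,a,b) = ∑_{ℓ+m=n, ℓ≡a, m≡b (mod q)} Λ(ℓ)Λ(m)`, `S(x;q,a,b) = ∑_{n ≤ x} G(n;q,a,b)`;
  `B_χ = sup{Re ρ_χ}`, `B_q = sup{B_χ | χ (mod q)}`, "Hence `1/2 ≤ B_q ≤ 1`"; §2: "We say a zero of
  `L(s,χ)` is non-trivial, if it is contained in the strip `0 < σ < 1`." DZC: "For any `q ≥ 1`, any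
  two distinct Dirichlet `L`-functions associated with characters of modulus `q` do not have a
  common non-trivial zero, except for a possible multiple zero at `s = 1/2`." Theorem 1: "Let `a,b`
  be integers with `(ab,q) = 1`. (1) For `x ≥ 2`, we have `S(x;q,a,b) = x²/(2φ(q)²) + O(x^{1+B_q})`,
  where the implicit constant is absolute. (2) Let DZC be true, let `χ(a)+χ(b) ≠ 0` for all
  characters `χ (mod q)` and let `1/2 ≤ d < 1`. If the asymptotic formula
  `S(x;q,a,b) = x²/(2φ(q)²) + O_q(x^{1+d+ε})` holds for any `ε > 0`, then `B_q ≤ d` or `B_q = 1`.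
  Further if [it] holds with `a = b`, then `B_q ≤ d`." Remark 1: "Our result thus falls short of an
  equivalence with the Generalized Riemann Hypothesis (GRH) for `L`-functions modulo `q` since we
  have an additional possibility of `B_q = 1`. … Thus the proof of the equivalence between the RH
  and (1.1) [Granville's Theorem 1A] is now complete (see also [BRu]). All other equivalences for
  primes in arithmetic progressions are still partial. In particular if `B_q = 1`, then the error
  term of Theorem 2 becomes so large that it hides the information on non-trivial zeros."
  Theorem 2: `S(x;q,a,b) = x²/(2φ(q)²) − (1/φ(q)²)∑_{χ (mod q)}(χ̄(a)+χ̄(b))∑_{ρ_χ} x^{ρ_χ+1}/(ρ_χ(ρ_χ+1)) + O(x^{2B_q*}(log qx)⁵)`,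
  `B_q* = min(B_q, 1 − η)`; §2 writes `β₁` for "the Landau–Siegel zero of (mod `q`)" and `δ₁(χ) = 1`
  "if `χ` is the exceptional character". (1.5) (reporting Granville):
  `∑_{n ≤ x} G(n) = x²/2 − 2∑_{|Im ρ| ≤ x} x^{ρ+1}/(ρ(ρ+1)) + O(x^{(2+4B)/3}(log x)²)`. Theorem 3:
  for `(2,q) ∣ c`, `∑_{n ≤ x, n ≡ c (mod q)}(G(n) − J(n)) ≪ x^{1+B_q}` (absolute constant), with a
  converse under hypotheses (1)–(3) on an isolated extreme zero `ρ₀` ("The conditions on `ρ₀`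
  might resemble those of the Landau–Siegel zero").
* H. L. Montgomery, R. C. Vaughan, *Multiplicative Number Theory I*, CUP 2007, §15.1 (von Koch's
  converse; tree `Literature/NumberTheory/LFunctions/VonKochConverse.lean`, PROVED there)
  [cite: MontgomeryVaughan2007, §15.1 (with Thm. 1.3)].
-/

noncomputable section

open Filter Finset Asymptotics
open scoped ArithmeticFunction.vonMangoldt Chebyshev FourierTransform

namespace Literature.Barriers.Parity

/-! ### The averaged Goldbach count and the technique-class parameter -/

/-- `S(x) = ∑_{n ≤ x} G(n)` with `G(n) = ∑_{k₁+k₂=n} Λ(k₁)Λ(k₂) = Literature.goldbachLambdaCount n`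
(ordered pairs, prime powers included). [cite: BhowmikRuzsa2018, §1] -/
def goldbachLambdaSum (x : ℕ) : ℝ :=
  ∑ n ∈ range (x + 1), Literature.NumberTheory.Sieve.goldbachLambdaCount n

/-- **Technique-class parameter: a power saving in the averaged Goldbach asymptotic**,
`S(x) = x²/2 + O(x^{2−δ})` (Bhowmik–Ruzsa's hypothesis (2.1)), along the integers.
[cite: BhowmikRuzsa2018, Theorem 2.1 (2.1)] -/
def PowerSavingGoldbachAverage (δ : ℝ) : Prop :=
  (fun x : ℕ ↦ goldbachLambdaSum x - (x : ℝ) ^ 2 / 2) =O[atTop] fun x : ℕ ↦ (x : ℝ) ^ (2 - δ)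

/-- The class is monotone: a saving `x^{2−δ}` is a saving `x^{2−δ'}` for `δ' ≤ δ`. [folklore] -/
theorem PowerSavingGoldbachAverage.mono {δ δ' : ℝ} (h : PowerSavingGoldbachAverage δ)
    (hle : δ' ≤ δ) : PowerSavingGoldbachAverage δ' := by
  refine h.trans (IsBigO.of_bound' ?_)
  filter_upwards [eventually_ge_atTop 1] with x hx
  rw [Real.norm_of_nonneg (by positivity), Real.norm_of_nonneg (by positivity)]
  exact Real.rpow_le_rpow_of_exponent_le (by exact_mod_cast hx) (by linarith)

/-! ### The printed proof's analytic step, as a named fact -/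

/-- **Bhowmik–Ruzsa, proof of Theorem 2.1 (the power-series/kernel step).** If
`S(x) = x²/2 + O(x^{2−δ})` with `0 < δ ≤ 1`, then `ψ(N) − N ≪ N^{1−δ/6}(log N)^{1/2}`:
`F(z)² = ∑ G(n)zⁿ = (1−z)∑ S(n)zⁿ` gives `F(z) = 1/(1−z) + O(|1−z|²N^{3−δ})` on the major arc
`|1 − z| < N^{δ/3−1}` of the circle `|z| = 1 − 1/N`, and `ψ(N) = (1/2πi)∫ F K` with the kernel
`K(z) = z^{−N−1}(1−z^N)/(1−z)`; the minor arc is handled by Cauchy–Schwarz with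
`∑(Λ(n)−1)²(1−1/N)^{2n} = O(N log N)` and `∫|K|² ≪ N^{1−δ/3}`. (The restriction `δ ≤ 1` is
implicit in the printed error bookkeeping — the terms `−3/(2(1−z)²) + 1/(2(1−z))` of `∑(n²/2)zⁿ`
are absorbed into `O((1−|z|)^{δ−3})` — and is harmless by `PowerSavingGoldbachAverage.mono`.)
Named fact; PROVED below (`BhowmikRuzsa2018_psiBound_holds`, section `BhowmikRuzsa`).
[cite: BhowmikRuzsa2018, proof of Theorem 2.1 (final display)] -/
def BhowmikRuzsa2018_psiBound : Prop :=
  ∀ δ : ℝ, 0 < δ → δ ≤ 1 → PowerSavingGoldbachAverage δ →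
    (fun N : ℕ ↦ ψ (N : ℝ) - N) =O[atTop]
      fun N : ℕ ↦ (N : ℝ) ^ (1 - δ / 6) * Real.sqrt (Real.log N)

/-! ### The record: Bhowmik–Ruzsa's Theorem 2.1 -/

/-- **Barrier: a power saving in the averaged Goldbach asymptotic is a quasi-Riemann hypothesis
(Bhowmik–Ruzsa 2018, Theorem 2.1, as printed).** "If the asymptotic relation
`S(x) = x²/2 + O(x^{2−δ})`, `δ > 0` holds, then there exists `0 < δ' < 1` such that for the
non-trivial zeros `ρ` of the Riemann zeta function `Re ρ < 1 − δ'`." Non-trivial zeros are the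
zeros in the open strip `0 < Re s < 1` (none has `Re s ≥ 1`, Mathlib
`riemannZeta_ne_zero_of_one_le_re`). PROVED below: `GoldbachAverageZeros_holds`
(= `goldbachAverageZeros_of_psiBound BhowmikRuzsa2018_psiBound_holds`; the kernel step is proved
in the section `BhowmikRuzsa`, the passage from `ψ` to the zeros is the tree's proved von Koch
converse). [cite: BhowmikRuzsa2018, Theorem 2.1]

BARRIER (D-0021; one line per key):
technique_class: zero-free-region-blind power-saving averaged-goldbach circle-method explicit-formula — any argument whose conclusion is, or implies, `PowerSavingGoldbachAverage δ` for some `δ > 0` (the class is monotone in `δ`, `PowerSavingGoldbachAverage.mono`), in particular any proof of a power-saving binary Goldbach asymptotic `G(2N) = J(2N) + O(N^{1−δ})` for all `N` (summing, with `∑_{2n ≤ x} J(2n) = x²/2 + O(x log x)` [cite: Granville2007, §5 (display after (5.2))]), which does not at the same time produce a zero-free half-plane `Re s > 1 − δ'` for `ζ(s)` [cite: BhowmikRuzsa2018, Theorem 2.1]; in progressions `S(x; q, a, b)`, the same for the Dirichlet `L`-functions mod `q` (`BHMS2019_thm1_ii`) [cite: BhowmikHalupczokMatsumotoSuzuki2019,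 Theorem 1 (2)].
blocks: the POWER-SAVING strengthening, on average over the target `N' ≤ x`, of the binary Goldbach case `n ↦ (n, N' − n)` of `GeneralizedHardyLittlewood` = `Literature.NumberTheory.Sieve.GeneralizedHardyLittlewood` (which asks `G(N') − J(N') = o(N')`, `G = Literature.goldbachLambdaCount`, `J = Literature.goldbachHLMain`, uniformly for `N' ≤ LN`): `S(x) = x²/2 + O(x^{2−δ})` for some `δ > 0` implies that all non-trivial zeros of `ζ` have `Re ρ < 1 − δ'` for some `δ' ∈ (0, 1)` (`GoldbachAverageZeros`, with `δ' = δ/6` from the printed proof, "`δ' = δ` as soon as we have `δ' < 1`" via the explicit formula) [cite: BhowmikRuzsa2018, Theorem 2.1 and Remark 1] — SHARP FORM (audit 2026-08-16): `δ' = δ`, i.e. `Re ρ ≤ 1 − δ` for `0 < δ ≤ 1/2` and the Riemann hypothesis for `δ ≥ 1/2`, which is the case `q = 1`, `a = b` of `BHMS2019_thm1_ii` and is PROVED in the sibling entry `GoldbachAverageZerosNarrow` (`GoldbachAverageZerosNarrow_holds`, `PowerSavingGoldbachAverage.riemannHypothesis`) [cite: BhowmikHalupczokMatsumotoSuzuki2019,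 Theorem 1 (2) and Remark 1] [cite: BillingtonEtAl2023, §1 (paragraph after Theorem 2)] — a quasi-Riemann hypothesis `Literature.QuasiRiemannHypothesis (1 − δ')` (`GoldbachAverageZeros.quasiRiemannHypothesis`), whereas "the current state of knowledge on the zeros of the Riemann zeta function `ζ(s)` is not enough to obtain "good" error terms unconditionally and the Riemann Hypothesis is always assumed in such studies" [cite: BhowmikHalupczokMatsumotoSuzuki2019, §1]; at the exponent `3/2 + o(1)` the averaged statement IS the Riemann hypothesis (tree `Literature.NumberTheory.Sieve.granville_thm1A`) [cite: Granville2007, Theorem 1A], and for `∑_{q ∣ 2N} G(2N)` versus `(1/φ(q))∑ G(2N)` at `x^{1+o(1)}` it is GRH mod `q` [cite: Granville2007, Theorem 1C]; for `S(x; q, a, a)` a saving `O_q(x^{1+d+ε})` forces `B_q ≤ d` under DZC [cite: BhowmikHalupczokMatsumotoSuzuki2019, Theorem 1 (2)].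
because: `F(z) = ∑ Λ(n)zⁿ` has `F(z)² = ∑ G(n)zⁿ = (1 − z)∑ S(n)zⁿ`, so a power saving in `S` determines `F²`, hence `F = 1/(1−z) + O(|1−z|²N^{3−δ})` near `z = 1` on `|z| = 1 − 1/N`, and the kernel `K(z) = z^{−N−1}(1−z^N)/(1−z)` extracts `ψ(N) = N + O(N^{1−δ/6}(log N)^{1/2})` (major arc pointwise, minor arc by Cauchy–Schwarz and Parseval) [cite: BhowmikRuzsa2018, proof of Theorem 2.1] (`BhowmikRuzsa2018_psiBound`, PROVED: `BhowmikRuzsa2018_psiBound_holds`); then `ψ(x) − x = O(x^{σ₀})` makes `−ζ'/ζ(s) − ζ(s) = s∫(ψ(x) − ⌊x⌋)x^{−s−1}dx` holomorphic on `Re s > σ₀`, excluding zeros there (tree, PROVED: `Literature.NumberTheory.LFunctions.VonKochConverse.quasiRiemannHypothesis_of_isBigO`) [cite: MontgomeryVaughan2007, §15.1 (with Thm. 1.3)]; conversely every zero is visible in the average: `∑_{n ≤ x} G(n) = x²/2 − 2∑_{|Im ρ| ≤ x} x^{ρ+1}/(ρ(ρ+1)) + O(x^{(2+4B)/3}(log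 x)²)` [cite: BhowmikHalupczokMatsumotoSuzuki2019, (1.5)] [cite: Granville2007, (5.1)], "by Littlewood's method, `max_{y ≤ x} |∑_{2N ≤ y} G(2N) − y²/2| = x^{1+B+o(1)}`" [cite: Granville2007, §5]; in progressions the zeros of all `L(s, χ)`, `χ (mod q)`, enter with the weights `χ̄(a) + χ̄(b)`: `S(x;q,a,b) = x²/(2φ(q)²) − φ(q)⁻²∑_χ(χ̄(a)+χ̄(b))∑_{ρ_χ} x^{ρ_χ+1}/(ρ_χ(ρ_χ+1)) + O(x^{2B_q*}(log qx)⁵)` — the Landau–Siegel zero `β₁` of the exceptional character contributing a real secondary term `x^{β₁+1}` of nearly the order of the main term — and "if `B_q = 1`, then the error term of Theorem 2 becomes so large that it hides the information on non-trivial zeros" [cite: BhowmikHalupczokMatsumotoSuzuki2019, Theorem 2, §2 and Remark 1].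
evasions_known: none unconditional for power savings; the unconditional savings in print are those delivered by zero-free regions — a region `σ > 1 − η(|t|)` gives `S(x) = x²/2 + O(x² exp(−Cω(x)))`, with the Vinogradov–Korobov region `O(x² exp(−c'(log x)^{3/5}(log log x)^{−1/5}))` (quoted in `GoldbachAverageZerosNarrow.lean`) [cite: BillingtonEtAl2023, §1 (Theorem 1, Corollary 1)]; CONDITIONALLY the savings hold — under RH `S(x) = x²/2 + O(x^{3/2})` (Fujii, Granville), improved to `O(x^{1+ε})` (Bhowmik–Schlage-Puchta) [cite: BhowmikRuzsa2018, §1], in progressions `S(x;q,a,b) = x²/(2φ(q)²) + O(x^{1+B_q})` and `∑_{n ≤ x, n ≡ c (q)}(G(n) − J(n)) ≪ x^{1+B_q}` with absolute constants, `≪ x^{3/2}` under GRH mod `q` [cite: BhowmikHalupczokMatsumotoSuzuki2019, Theorem 1 (1), Theorem 3 (1), (1.9)]; without a power saving nothing here applies (the qualitative `o`-statements of `GeneralizedHardyLittlewood` are untouched, `scope_caveats` (a)).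
scope_caveats: (a) only savings of POWER type `x^{2−δ}`, `δ > 0`, in the `Λ`-weighted average over ALL `n ≤ x` are shown to force zero-free half-planes [cite: BhowmikRuzsa2018, Theorem 2.1]; savings by powers of `log x`, and the un-averaged `o(N')` asymptotic of `GeneralizedHardyLittlewood` itself, are not addressed by the sources — UPDATE (audit 2026-08-16): savings of intermediate strength `O(x² exp(−Cϖ(x)))` ARE tied to zero-free regions `σ > 1 − η(log|t|)` by the later literature, quoted in the sibling entry `GoldbachAverageZerosNarrow` [cite: BillingtonEtAl2023, §1 (Theorem 2)], and the class `PowerSavingGoldbachAverage δ` is EMPTY for `δ > 1` (`not_powerSavingGoldbachAverage_of_one_lt`, PROVED at the end of this file: `G(n) ≤ 4 log³n + 2 log²n` at odd `n`), so the record carries content exactly on `0 < δ ≤ 1`; (b) the printed proof gives `δ' = δ/6` ("`δ/3`" with a better kernel), and `δ' = δ` only "through an explicit expression of `S(x)` using roots of the zeta-function" in the cited works [cite: BhowmikRuzsa2018, Remark 1] — UPDATE (audit 2026-08-16): `δ' = δ` (`Re ρ ≤ 1 − δ`, `0 < δ ≤ 1/2`; RH for `δ ≥ 1/2`) is the case `q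 = 1`, `a = b` of `BHMS2019_thm1_ii` and is PROVED in the tree WITHOUT the explicit formula (`GoldbachAverageZerosNarrow_holds`, from `BHMS2019_thm1_ii_holds`: real-axis Laplace transform, real square root, Mellin transform) [cite: BhowmikHalupczokMatsumotoSuzuki2019, Theorem 1 (2) and §8]; the method "works equally for any function `f` satisfying `|f(n)| = O(n^ε)`", the authors doubting that `δ' = δ` follows in that generality [cite: BhowmikRuzsa2018, Remark 1]; (c) Granville's Theorem 1A concerns the prime-only weights `∑_{p+q=2N} log p log q` over even `2N ≤ x` against `J(2N)` (tree `Literature.NumberTheory.Sieve.goldbachLogCount`, `Literature.NumberTheory.Sieve.granville_thm1A`), Bhowmik–Ruzsa's Theorem 2.1 the `Λ`-weights over all `n` against `x²/2`; the translation between the two (prime powers, odd `n`, `∑ J`) is elementary but is not part of either printed theorem [cite: Granville2007, Theorem 1A and §5] [cite: BhowmikRuzsa2018, §1]; Granville's 2008 corrigendum was not re-read for this entry; (d) in arithmetic progressions the converse direction is CONDITIONAL on DZC and on `χ(a) + χ(b) ≠ 0` for all `χ`, leaves the alternative `B_q = 1` open unless `a = b`, and "All other equivalences for primes in arithmetic progressions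 are still partial" [cite: BhowmikHalupczokMatsumotoSuzuki2019, Theorem 1 (2) and Remark 1]; "we are yet unable to establish an equivalence between average orders of restricted Goldbach functions and appropriate quasi Riemann Hypotheses for `L`-functions" [cite: BhowmikRuzsa2018, Remark 2]; Theorem 3 (2) (sums over `n ≡ c (mod q)` of `G − J`) needs an isolated extreme zero `ρ₀` belonging to a unique character of squarefree conductor coprime to `c`, conditions that "might resemble those of the Landau–Siegel zero although (2) above is not actually applicable to a Landau–Siegel zero if there are some complex zeros of `L`-function of the same modulus which are very close to the vertical line `σ = 1`" [cite: BhowmikHalupczokMatsumotoSuzuki2019, Theorem 3 and the following paragraph] — Theorems 2–4 are quoted above, not vendored; (e) Lean rendering: the hypothesis is taken along integer `x` (`S` is a step function; for `δ ≤ 1` this is the printed hypothesis), `O(·)` as `=O[atTop]`; the analytic step is proved in DISCRETISED form — `F` truncated at `M = N²`, the circle `|z| = 1 − 1/N` sampled at `L = N² + 1` points so that Cauchy's coefficient formula and Parseval's identity become exact orthogonality over `ℤ/Lℤ`, the square-root branch fixed by the intermediate value theorem — with the printed exponent `1 − δ/6` [cite: BhowmikRuzsa2018, proof of Theorem 2.1];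 the explicit value of `δ'` delivered by the Lean proof of the record is `min(δ, 1)/24` (printed: `δ/6`), the record itself being existential in `δ'` as printed; the sharp value `δ' = δ` is the sibling entry `GoldbachAverageZerosNarrow` (caveat (b)).
status: established — PROVED here (`GoldbachAverageZeros_holds`; axioms `propext`, `Classical.choice`, `Quot.sound`) [cite: BhowmikRuzsa2018, Theorem 2.1]; the companion equivalences are the tree's `Literature.NumberTheory.Sieve.granville_thm1A` [cite: Granville2007, Theorem 1A] and the named facts `BHMS2019_thm1_i/ii`, PROVED in `GoldbachAverageZerosBHMSProofs.lean` (`BHMS2019_thm1_i_holds`) and `GoldbachAverageZerosProofs.lean` (`BHMS2019_thm1_ii_holds`) [cite: BhowmikHalupczokMatsumotoSuzuki2019, Theorem 1]; sharp form PROVED in `GoldbachAverageZerosNarrow.lean` (`GoldbachAverageZerosNarrow_holds`) [cite: BhowmikHalupczokMatsumotoSuzuki2019, Theorem 1 (2)] -/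
def GoldbachAverageZeros : Prop :=
  ∀ δ : ℝ, 0 < δ → PowerSavingGoldbachAverage δ →
    ∃ δ' : ℝ, 0 < δ' ∧ δ' < 1 ∧
      ∀ s : ℂ, riemannZeta s = 0 → 0 < s.re → s.re < 1 → s.re < 1 - δ'

/-! ### Proof of the record from the named fact and the tree's von Koch converse -/

/-- From `ψ(N) − N = O(N^{1−δ/6}(log N)^{1/2})` along the integers to `ψ(x) − x = O(x^{1−δ/12})`
along the reals (`ψ(x) = ψ(⌊x⌋)`, `|x − ⌊x⌋| ≤ 1`, `(log N)^{1/2} ≤ 1 + log N ≤ (1 + 24/δ)N^{δ/24}`).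
[folklore] -/
theorem chebyshevPsi_isBigO_rpow_of_nat {δ : ℝ} (hδ : 0 < δ) (hδ1 : δ ≤ 1)
    (h : (fun N : ℕ ↦ ψ (N : ℝ) - N) =O[atTop]
      fun N : ℕ ↦ (N : ℝ) ^ (1 - δ / 6) * Real.sqrt (Real.log N)) :
    (fun x : ℝ ↦ ψ x - x) =O[atTop] fun x : ℝ ↦ x ^ (1 - δ / 12) := by
  obtain ⟨C, hC, hCb⟩ := h.exists_pos
  rw [IsBigOWith_def, eventually_atTop] at hCb
  obtain ⟨N₀, hN₀⟩ := hCb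
  set σ₀ : ℝ := 1 - δ / 12 with hσ₀
  have hσ₀pos : 0 < σ₀ := by rw [hσ₀]; linarith
  -- pointwise bound at an integer `N ≥ max N₀ 1`
  have key : ∀ N : ℕ, N₀ ≤ N → 1 ≤ N →
      |ψ (N : ℝ) - N| ≤ C * (1 + 24 / δ) * (N : ℝ) ^ σ₀ := by
    intro N hN hN1
    have hN1' : (1 : ℝ) ≤ N := by exact_mod_cast hN1
    have hb := hN₀ N hN
    rw [Real.norm_eq_abs, Real.norm_of_nonneg (by positivity)] at hb
    refine hb.trans ?_
    -- `sqrt (log N) ≤ 1 + log N ≤ (1 + 24/δ) N^{δ/24}`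
    have hlog0 : 0 ≤ Real.log N := Real.log_nonneg hN1'
    have hsqrt : Real.sqrt (Real.log N) ≤ 1 + Real.log N := by
      rw [Real.sqrt_le_left (by positivity)]
      nlinarith
    have hlogle : Real.log N ≤ (N : ℝ) ^ (δ / 24) / (δ / 24) :=
      Real.log_le_rpow_div (by positivity) (by positivity)
    have hpow1 : (1 : ℝ) ≤ (N : ℝ) ^ (δ / 24) := Real.one_le_rpow hN1' (by positivity)
    have hsq2 : Real.sqrt (Real.log N) ≤ (1 + 24 / δ) * (N : ℝ) ^ (δ / 24) := by
      calc Real.sqrt (Real.log N) ≤ 1 + Real.log N := hsqrt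
        _ ≤ (N : ℝ) ^ (δ / 24) + (N : ℝ) ^ (δ / 24) / (δ / 24) := by linarith
        _ = (1 + 24 / δ) * (N : ℝ) ^ (δ / 24) := by field_simp
    have hexp : (N : ℝ) ^ (1 - δ / 6) * (N : ℝ) ^ (δ / 24) ≤ (N : ℝ) ^ σ₀ := by
      rw [← Real.rpow_add (by positivity)]
      exact Real.rpow_le_rpow_of_exponent_le hN1' (by rw [hσ₀]; linarith)
    calc C * ((N : ℝ) ^ (1 - δ / 6) * Real.sqrt (Real.log N))
        ≤ C * ((N : ℝ) ^ (1 - δ / 6) * ((1 + 24 / δ) * (N : ℝ) ^ (δ / 24))) := by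
          gcongr
      _ = C * (1 + 24 / δ) * ((N : ℝ) ^ (1 - δ / 6) * (N : ℝ) ^ (δ / 24)) := by ring
      _ ≤ C * (1 + 24 / δ) * (N : ℝ) ^ σ₀ := by gcongr
  -- pass to real `x` through `⌊x⌋`
  refine IsBigO.of_bound (C * (1 + 24 / δ) + 1) ?_
  rw [eventually_atTop]
  refine ⟨max (N₀ : ℝ) 1, fun x hx ↦ ?_⟩
  have hx1 : (1 : ℝ) ≤ x := le_of_max_le_right hx
  have hx0 : (0 : ℝ) ≤ x := by linarith
  have hfl1 : 1 ≤ ⌊x⌋₊ := Nat.le_floor (by simpa using hx1)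
  have hflN : N₀ ≤ ⌊x⌋₊ := Nat.le_floor (le_of_max_le_left hx)
  have hfloor_le : ((⌊x⌋₊ : ℕ) : ℝ) ≤ x := Nat.floor_le hx0
  have hfloor_gt : x - 1 < ((⌊x⌋₊ : ℕ) : ℝ) := by
    have := Nat.lt_floor_add_one x; linarith
  have hk := key ⌊x⌋₊ hflN hfl1
  have hpow_le : ((⌊x⌋₊ : ℕ) : ℝ) ^ σ₀ ≤ x ^ σ₀ :=
    Real.rpow_le_rpow (by positivity) hfloor_le hσ₀pos.le
  have hone : (1 : ℝ) ≤ x ^ σ₀ := Real.one_le_rpow hx1 hσ₀pos.le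
  rw [Real.norm_eq_abs, Real.norm_of_nonneg (by positivity), Chebyshev.psi_eq_psi_coe_floor x]
  have hsplit : |ψ ((⌊x⌋₊ : ℕ) : ℝ) - x| ≤ |ψ ((⌊x⌋₊ : ℕ) : ℝ) - ⌊x⌋₊| + 1 := by
    calc |ψ ((⌊x⌋₊ : ℕ) : ℝ) - x|
        = |(ψ ((⌊x⌋₊ : ℕ) : ℝ) - ⌊x⌋₊) + ((⌊x⌋₊ : ℝ) - x)| := by ring_nf
      _ ≤ |ψ ((⌊x⌋₊ : ℕ) : ℝ) - ⌊x⌋₊| + |(⌊x⌋₊ : ℝ) - x| := abs_add_le _ _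
      _ ≤ |ψ ((⌊x⌋₊ : ℕ) : ℝ) - ⌊x⌋₊| + 1 := by
          gcongr
          rw [abs_le]; constructor <;> linarith
  calc |ψ ((⌊x⌋₊ : ℕ) : ℝ) - x| ≤ |ψ ((⌊x⌋₊ : ℕ) : ℝ) - ⌊x⌋₊| + 1 := hsplit
    _ ≤ C * (1 + 24 / δ) * ((⌊x⌋₊ : ℕ) : ℝ) ^ σ₀ + 1 := by gcongr
    _ ≤ C * (1 + 24 / δ) * x ^ σ₀ + x ^ σ₀ := by gcongr
    _ = (C * (1 + 24 / δ) + 1) * x ^ σ₀ := by ring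

/-- **The record, PROVED from the named fact `BhowmikRuzsa2018_psiBound` and the tree's proved
von Koch converse.** Given `δ > 0`, pass to `δ₁ = min(δ, 1)`, obtain
`ψ(x) − x = O(x^{1−δ₁/12})`, hence `Literature.QuasiRiemannHypothesis (1 − δ₁/12)`
(`Literature.NumberTheory.LFunctions.VonKochConverse.quasiRiemannHypothesis_of_isBigO`), and take `δ' = δ₁/24`.
[cite: BhowmikRuzsa2018, Theorem 2.1] [cite: MontgomeryVaughan2007, §15.1] -/
theorem goldbachAverageZeros_of_psiBound (h : BhowmikRuzsa2018_psiBound) :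
    GoldbachAverageZeros := by
  intro δ hδ hS
  set δ₁ : ℝ := min δ 1 with hδ₁
  have hδ₁pos : 0 < δ₁ := lt_min hδ one_pos
  have hδ₁le : δ₁ ≤ 1 := min_le_right _ _
  have hS₁ : PowerSavingGoldbachAverage δ₁ := hS.mono (min_le_left _ _)
  have hψ := chebyshevPsi_isBigO_rpow_of_nat hδ₁pos hδ₁le (h δ₁ hδ₁pos hδ₁le hS₁)
  have hσ₀ : 0 < 1 - δ₁ / 12 := by linarith
  have hQ := Literature.NumberTheory.LFunctions.VonKochConverse.quasiRiemannHypothesis_of_isBigO hσ₀ hψ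
  refine ⟨δ₁ / 24, by positivity, by linarith, fun s hs h0 h1 ↦ ?_⟩
  by_contra hge
  push Not at hge
  exact hQ s hs (by linarith) h1

/-- The record in the tree's notation: a power saving `x^{2−δ}` yields
`Literature.QuasiRiemannHypothesis (1 − δ')` for some `δ' ∈ (0, 1)`. [cite: BhowmikRuzsa2018, Theorem 2.1] -/
theorem GoldbachAverageZeros.quasiRiemannHypothesis (h : GoldbachAverageZeros) {δ : ℝ}
    (hδ : 0 < δ) (hS : PowerSavingGoldbachAverage δ) :
    ∃ δ' : ℝ, 0 < δ' ∧ δ' < 1 ∧ Literature.NumberTheory.LFunctions.QuasiRiemannHypothesis (1 - δ') := by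
  obtain ⟨δ', h0, h1, hz⟩ := h δ hδ hS
  exact ⟨δ', h0, h1, fun s hs hlo hhi ↦ by have := hz s hs (by linarith) hhi; linarith⟩

/-- The barrier read contrapositively: if `ζ` has non-trivial zeros with real parts arbitrarily
close to `1` (Granville's `B = 1`), then NO power saving `S(x) = x²/2 + O(x^{2−δ})`, `δ > 0`,
can be proved by any means. [cite: BhowmikRuzsa2018, Theorem 2.1] [cite: Granville2007, §5] -/
theorem GoldbachAverageZeros.no_powerSaving_of_zeros_near_one (h : GoldbachAverageZeros)
    (hB : ∀ σ : ℝ, σ < 1 → ∃ s : ℂ, riemannZeta s = 0 ∧ σ < s.re ∧ s.re < 1) {δ : ℝ}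
    (hδ : 0 < δ) : ¬ PowerSavingGoldbachAverage δ := by
  intro hS
  obtain ⟨δ', h0, _, hz⟩ := h δ hδ hS
  obtain ⟨s, hs, hlo, hhi⟩ := hB (1 - δ') (by linarith)
  have := hz s hs (by linarith) hhi
  linarith

/-! ### Arithmetic progressions: Bhowmik–Halupczok–Matsumoto–Suzuki, Theorem 1 -/

/-- `G(n; q, a, b) = ∑_{ℓ + m = n, ℓ ≡ a, m ≡ b (mod q)} Λ(ℓ)Λ(m)`.
[cite: BhowmikHalupczokMatsumotoSuzuki2019, §1] -/
def goldbachLambdaCountMod (q a b n : ℕ) : ℝ :=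
  ∑ lm ∈ antidiagonal n with (lm.1 ≡ a [MOD q] ∧ lm.2 ≡ b [MOD q]), Λ lm.1 * Λ lm.2

/-- `S(x; q, a, b) = ∑_{n ≤ x} G(n; q, a, b)`. [cite: BhowmikHalupczokMatsumotoSuzuki2019, §1] -/
def goldbachLambdaSumMod (q a b x : ℕ) : ℝ :=
  ∑ n ∈ range (x + 1), goldbachLambdaCountMod q a b n

/-- With the trivial modulus the restricted count is `G(n)`. [folklore] -/
theorem goldbachLambdaCountMod_one (a b n : ℕ) :
    goldbachLambdaCountMod 1 a b n = Literature.NumberTheory.Sieve.goldbachLambdaCount n := by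
  unfold goldbachLambdaCountMod Literature.NumberTheory.Sieve.goldbachLambdaCount
  rw [filter_true_of_mem fun lm _ ↦ ⟨Nat.modEq_one, Nat.modEq_one⟩]

/-- **The Distinct Zero Conjecture (DZC).** "For any `q ≥ 1`, any two distinct Dirichlet
`L`-functions associated with characters of modulus `q` do not have a common non-trivial zero,
except for a possible multiple zero at `s = 1/2`" (non-trivial zero: in the strip `0 < σ < 1`).
[cite: BhowmikHalupczokMatsumotoSuzuki2019, §1 (DZC) and §2] -/
def DistinctZeroConjecture (q : ℕ) [NeZero q] : Prop :=
  ∀ χ₁ χ₂ : DirichletCharacter ℂ q, χ₁ ≠ χ₂ →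
    ∀ s : ℂ, 0 < s.re → s.re < 1 → s ≠ 1 / 2 → ¬ (χ₁.LFunction s = 0 ∧ χ₂.LFunction s = 0)

/-- `B_q ≤ d`: every non-trivial zero of every `L(s, χ)`, `χ (mod q)`, has real part `≤ d`
(`B_χ = sup{Re ρ_χ}`, `B_q = sup_χ B_χ`). [cite: BhowmikHalupczokMatsumotoSuzuki2019, §1] -/
def ZerosRealPartLE (q : ℕ) [NeZero q] (d : ℝ) : Prop :=
  ∀ χ : DirichletCharacter ℂ q, ∀ s : ℂ, χ.LFunction s = 0 → 0 < s.re → s.re < 1 → s.re ≤ d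

/-- `B_q = 1`: there are non-trivial zeros of `∏_χ L(s, χ)` with real parts arbitrarily close to
`1`. [cite: BhowmikHalupczokMatsumotoSuzuki2019, §1 and Remark 1] -/
def ZerosRealPartSupOne (q : ℕ) [NeZero q] : Prop :=
  ∀ σ : ℝ, σ < 1 → ∃ χ : DirichletCharacter ℂ q, ∃ s : ℂ,
    χ.LFunction s = 0 ∧ σ < s.re ∧ s.re < 1

/-- **Bhowmik–Halupczok–Matsumoto–Suzuki 2019, Theorem 1 (1)** (the explicit-formula direction,
unconditional): for `(ab, q) = 1` and `x ≥ 2`, `S(x; q, a, b) = x²/(2φ(q)²) + O(x^{1+B_q})`,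
"where the implicit constant is absolute". Rendered with any `σ₁ ≥ 1/2` bounding the real parts
of the non-trivial zeros mod `q` in place of their supremum `B_q` (`1/2 ≤ B_q ≤ 1` is printed).
Named fact; PROVED in the sibling file `Literature/Barriers/Parity/GoldbachAverageZerosBHMSProofs.lean`
(`BHMS2019_thm1_i_holds`, a mean-square argument in place of the printed explicit formula).
[cite: BhowmikHalupczokMatsumotoSuzuki2019, Theorem 1 (1)] -/
def BHMS2019_thm1_i : Prop :=
  ∃ C : ℝ, ∀ (q : ℕ) [NeZero q] (a b : ℕ), a.Coprime q → b.Coprime q →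
    ∀ σ₁ : ℝ, 1 / 2 ≤ σ₁ → ZerosRealPartLE q σ₁ →
      ∀ x : ℕ, 2 ≤ x →
        |goldbachLambdaSumMod q a b x - (x : ℝ) ^ 2 / (2 * (Nat.totient q : ℝ) ^ 2)| ≤
          C * (x : ℝ) ^ (1 + σ₁)

/-- **Bhowmik–Halupczok–Matsumoto–Suzuki 2019, Theorem 1 (2)** (the barrier direction in
progressions, conditional): "Let DZC be true, let `χ(a) + χ(b) ≠ 0` for all characters
`χ (mod q)` and let `1/2 ≤ d < 1`. If the asymptotic formula
`S(x;q,a,b) = x²/(2φ(q)²) + O_q(x^{1+d+ε})` holds for any `ε > 0`, then `B_q ≤ d` or `B_q = 1`.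
Further if [it] holds with `a = b`, then `B_q ≤ d`." Named fact; PROVED in the sibling file
`Literature/Barriers/Parity/GoldbachAverageZerosProofs.lean` (`BHMS2019_thm1_ii_holds`, Laplace
transforms on the real axis; its `a = b` branch gives `B_q ≤ d` directly, and at `q = 1` it is the
sharp record `GoldbachAverageZerosNarrow`).
[cite: BhowmikHalupczokMatsumotoSuzuki2019, Theorem 1 (2) and Remark 1] -/
def BHMS2019_thm1_ii : Prop :=
  ∀ (q : ℕ) [NeZero q] (a b : ℕ), a.Coprime q → b.Coprime q → DistinctZeroConjecture q →
    (∀ χ : DirichletCharacter ℂ q, χ (a : ZMod q) + χ (b : ZMod q) ≠ 0) →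
    ∀ d : ℝ, 1 / 2 ≤ d → d < 1 →
      (∀ ε : ℝ, 0 < ε →
        (fun x : ℕ ↦ goldbachLambdaSumMod q a b x - (x : ℝ) ^ 2 / (2 * (Nat.totient q : ℝ) ^ 2))
          =O[atTop] fun x : ℕ ↦ (x : ℝ) ^ (1 + d + ε)) →
      (ZerosRealPartLE q d ∨ ZerosRealPartSupOne q) ∧ (a = b → ZerosRealPartLE q d)

/-! ## Proof of the named fact `BhowmikRuzsa2018_psiBound` (Bhowmik–Ruzsa's kernel argument)

The printed proof works with the power series `F(z) = ∑ Λ(n)zⁿ` on the circle `|z| = R = 1 − 1/N`.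
We discretise it: `F` is truncated at `M = N²` (the tail is `O(e^{−N})`), the circle is sampled
at the `L = N² + 1` points `z_j = R e(j/L)`, and Cauchy's coefficient formula and Parseval's
identity become EXACT finite identities (orthogonality of the characters of `ℤ/Lℤ`, tree
`Literature.NumberTheory.Sieve.RamanujanSum.sum_range_fourierChar_div`); the "complex square root" on the major arc is
taken by the intermediate value theorem applied to `t ↦ Re((1 − z(t))F(z(t)))`, which cannot
vanish on the arc and is positive at `t = 0` because `F(R) ≥ 0`. Everything else is as printed:
`F² = (1 − z)∑ S(n)zⁿ`, the hypothesis `S(n) = n²/2 + O(n^{2−δ})`, the kernel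
`K = ∑_{m ≤ N} z^{−m}` with `K ≪ |1 − z|⁻¹`, the major arc `|1 − z| ≤ η ≍ N^{δ/3−1}`, and
Cauchy–Schwarz on the minor arc with `∑(Λ(n) − 1)²R^{2n} = O(N log N)` (Chebyshev's bound
`ψ(x) ≤ (log 4 + 4)x`, Mathlib) and `∑_{minor}|K|² ≪ N^{1−δ/3}` (Jordan's inequality).
[cite: BhowmikRuzsa2018, proof of Theorem 2.1]
-/

namespace BhowmikRuzsa


/-! ### The characters `e(x)` and discrete orthogonality -/

/-- `e(x) = exp(2πix)` as a complex number (Mathlib's `Real.fourierChar`, coerced). [folklore] -/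
def e (x : ℝ) : ℂ := (𝐞 x : ℂ)

/-- `e(x + y) = e(x)e(y)`. [folklore] -/
theorem e_add (x y : ℝ) : e (x + y) = e x * e y := by
  unfold e; rw [AddChar.map_add_eq_mul, Circle.coe_mul]

/-- `e(0) = 1`. [folklore] -/
theorem e_zero : e 0 = 1 := by unfold e; rw [AddChar.map_zero_eq_one, Circle.coe_one]

/-- `|e(x)| = 1`. [folklore] -/
theorem norm_e (x : ℝ) : ‖e x‖ = 1 := by unfold e; exact Circle.norm_coe _

/-- `e(−x)` is the complex conjugate of `e(x)`. [folklore] -/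
theorem e_neg (x : ℝ) : e (-x) = (starRingEnd ℂ) (e x) := by
  unfold e; rw [AddChar.map_neg_eq_inv, Circle.coe_inv_eq_conj]

/-- `e(nx) = e(x)ⁿ`. [folklore] -/
theorem e_nat_mul (n : ℕ) (x : ℝ) : e (n * x) = e x ^ n := by
  unfold e; rw [← Circle.coe_pow, ← AddChar.map_nsmul_eq_pow, nsmul_eq_mul]

/-- `e(x) = exp(2πix)`. [folklore] -/
theorem e_apply (x : ℝ) : e x = Complex.exp (2 * Real.pi * Complex.I * x) := by
  unfold e; rw [Real.fourierChar_apply]; congr 1; push_cast; ring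

/-- `e(x) ≠ 0`. [folklore] -/
theorem e_ne_zero (x : ℝ) : e x ≠ 0 := by
  rw [e_apply]; exact Complex.exp_ne_zero _

/-- Orthogonality of the additive characters of `ℤ/Lℤ` (tree: `Literature.NumberTheory.Sieve.RamanujanSum.sum_range_fourierChar_div`).
[folklore] -/
theorem sum_e_mul_div {L : ℕ} (hL : L ≠ 0) (h : ℤ) :
    ∑ j ∈ range L, e ((j : ℝ) * h / L) = if (L : ℤ) ∣ h then (L : ℂ) else 0 := by
  unfold e; exact Literature.NumberTheory.Sieve.RamanujanSum.sum_range_fourierChar_div hL h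

/-- **Bilinear orthogonality.** If no two distinct indices `n ∈ A`, `m ∈ B` are congruent mod `L`,
then `∑_{j<L} (∑_{n∈A} aₙ e(nj/L)) (∑_{m∈B} b_m e(−mj/L)) = L ∑_{n ∈ A ∩ B} aₙ bₙ`. [folklore] -/
theorem sum_bilinear_e {L : ℕ} (hL : L ≠ 0) (A B : Finset ℕ) (a b : ℕ → ℂ)
    (hAB : ∀ n ∈ A, ∀ m ∈ B, n ≠ m → ¬ ((L : ℤ) ∣ ((n : ℤ) - m))) :
    ∑ j ∈ range L, (∑ n ∈ A, a n * e ((n : ℝ) * j / L)) * (∑ m ∈ B, b m * e (-((m : ℝ) * j / L))) =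
      (L : ℂ) * ∑ n ∈ A ∩ B, a n * b n := by
  -- expand and swap sums
  have hexp : ∀ j : ℕ, (∑ n ∈ A, a n * e ((n : ℝ) * j / L)) * (∑ m ∈ B, b m * e (-((m : ℝ) * j / L)))
      = ∑ n ∈ A, ∑ m ∈ B, a n * b m * e ((j : ℝ) * ((n : ℤ) - m : ℤ) / L) := by
    intro j
    rw [sum_mul_sum]
    refine sum_congr rfl fun n _ => sum_congr rfl fun m _ => ?_
    have : e ((n : ℝ) * j / L) * e (-((m : ℝ) * j / L)) = e ((j : ℝ) * ((n : ℤ) - m : ℤ) / L) := by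
      rw [← e_add]; congr 1; push_cast; ring
    rw [← this]; ring
  simp_rw [hexp]
  rw [sum_comm]
  simp_rw [sum_comm (s := range L), ← mul_sum, sum_e_mul_div hL]
  -- only the diagonal survives
  have hdiag : ∀ n ∈ A, ∑ m ∈ B, a n * b m * (if (L : ℤ) ∣ ((n : ℤ) - m : ℤ) then (L : ℂ) else 0)
      = if n ∈ B then (L : ℂ) * (a n * b n) else 0 := by
    intro n hn
    have : ∀ m ∈ B, a n * b m * (if (L : ℤ) ∣ ((n : ℤ) - m : ℤ) then (L : ℂ) else 0)
        = if n = m then (L : ℂ) * (a n * b n) else 0 := by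
      intro m hm
      by_cases hnm : n = m
      · subst hnm; simp [mul_comm]
      · rw [if_neg (hAB n hn m hm hnm), if_neg hnm, mul_zero]
    rw [sum_congr rfl this, sum_ite_eq]
  rw [sum_congr rfl hdiag, ← sum_filter, mul_sum]
  congr 1

/-! ### Sample points on the circle `|z| = R` -/

/-- The sample point `z_j = R e(j/L)`. [folklore] -/
def zpt (R : ℝ) (L j : ℕ) : ℂ := (R : ℂ) * e ((j : ℝ) / L)

/-- `z_jⁿ = Rⁿ e(nj/L)`. [folklore] -/
theorem zpt_pow (R : ℝ) (L j n : ℕ) : zpt R L j ^ n = (R : ℂ) ^ n * e ((n : ℝ) * j / L) := by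
  unfold zpt; rw [mul_pow, ← e_nat_mul]; congr 1; congr 1; ring

/-- `|z_j| = R`. [folklore] -/
theorem norm_zpt {R : ℝ} (hR : 0 ≤ R) (L j : ℕ) : ‖zpt R L j‖ = R := by
  unfold zpt; rw [norm_mul, norm_e, mul_one, Complex.norm_real, Real.norm_of_nonneg hR]

/-- A polynomial `∑_{n ≤ M} cₙ zⁿ` evaluated at a sample point is a character sum. [folklore] -/
theorem poly_zpt (c : ℕ → ℂ) (R : ℝ) (L j M : ℕ) :
    ∑ n ∈ range (M + 1), c n * zpt R L j ^ n =
      ∑ n ∈ range (M + 1), (c n * (R : ℂ) ^ n) * e ((n : ℝ) * j / L) := by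
  refine sum_congr rfl fun n _ => ?_
  rw [zpt_pow]; ring

/-- Conjugate of a real-coefficient polynomial at a sample point. [folklore] -/
theorem conj_poly_zpt (c : ℕ → ℝ) (R : ℝ) (L j M : ℕ) :
    (starRingEnd ℂ) (∑ n ∈ range (M + 1), (c n : ℂ) * zpt R L j ^ n) =
      ∑ n ∈ range (M + 1), ((c n : ℂ) * (R : ℂ) ^ n) * e (-((n : ℝ) * j / L)) := by
  rw [poly_zpt, map_sum]
  refine sum_congr rfl fun n _ => ?_
  rw [map_mul, map_mul, map_pow, Complex.conj_ofReal, Complex.conj_ofReal, ← e_neg]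

/-- **Discrete Parseval** for a real-coefficient polynomial of degree `≤ M < L` on the circle
`|z| = R`: `∑_{j<L} |P(z_j)|² = L ∑ₙ cₙ² R^{2n}`. [folklore] -/
theorem parseval_zpt (c : ℕ → ℝ) (R : ℝ) {L M : ℕ} (hML : M < L) :
    ∑ j ∈ range L, ‖∑ n ∈ range (M + 1), (c n : ℂ) * zpt R L j ^ n‖ ^ 2 =
      L * ∑ n ∈ range (M + 1), c n ^ 2 * R ^ (2 * n) := by
  have hL : L ≠ 0 := by omega
  have key := sum_bilinear_e hL (range (M + 1)) (range (M + 1))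
    (fun n => (c n : ℂ) * (R : ℂ) ^ n) (fun n => (c n : ℂ) * (R : ℂ) ^ n) (by
      intro n hn m hm hnm hdvd
      rw [mem_range] at hn hm
      have h1 : |((n : ℤ) - m)| < L := by rw [abs_lt]; constructor <;> omega
      have h2 : ((n : ℤ) - m) ≠ 0 := by omega
      exact h2 (Int.eq_zero_of_abs_lt_dvd hdvd h1))
  rw [inter_self] at key
  have : ∀ j ∈ range L, (‖∑ n ∈ range (M + 1), (c n : ℂ) * zpt R L j ^ n‖ ^ 2 : ℂ) =
      (∑ n ∈ range (M + 1), ((c n : ℂ) * (R : ℂ) ^ n) * e ((n : ℝ) * j / L)) *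
        (∑ m ∈ range (M + 1), ((c m : ℂ) * (R : ℂ) ^ m) * e (-((m : ℝ) * j / L))) := by
    intro j _
    rw [← poly_zpt, ← conj_poly_zpt, Complex.mul_conj, Complex.normSq_eq_norm_sq]; push_cast; rfl
  have hC : ((∑ j ∈ range L, ‖∑ n ∈ range (M + 1), (c n : ℂ) * zpt R L j ^ n‖ ^ 2 : ℝ) : ℂ) =
      ((L * ∑ n ∈ range (M + 1), c n ^ 2 * R ^ (2 * n) : ℝ) : ℂ) := by
    push_cast
    rw [sum_congr rfl this, key]
    congr 1
    refine sum_congr rfl fun n _ => ?_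
    ring
  exact_mod_cast hC

/-- **Coefficient extraction** by the kernel `K_j = ∑_{1 ≤ m ≤ N} R^{-m} e(−mj/L)`: for a
polynomial of degree `≤ M < L` with `N ≤ M`, `∑_{j<L} P(z_j) K_j = L ∑_{1 ≤ n ≤ N} cₙ`. [folklore] -/
theorem extraction_zpt (c : ℕ → ℂ) {R : ℝ} (hR : R ≠ 0) {L M N : ℕ} (hML : M < L) (hNM : N ≤ M) :
    ∑ j ∈ range L, (∑ n ∈ range (M + 1), c n * zpt R L j ^ n) *
        (∑ m ∈ Icc 1 N, ((R : ℂ)⁻¹) ^ m * e (-((m : ℝ) * j / L))) =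
      L * ∑ n ∈ Icc 1 N, c n := by
  have hL : L ≠ 0 := by omega
  have key := sum_bilinear_e hL (range (M + 1)) (Icc 1 N)
    (fun n => c n * (R : ℂ) ^ n) (fun m => ((R : ℂ)⁻¹) ^ m) (by
      intro n hn m hm hnm hdvd
      rw [mem_range] at hn; rw [mem_Icc] at hm
      have h1 : |((n : ℤ) - m)| < L := by rw [abs_lt]; constructor <;> omega
      have h2 : ((n : ℤ) - m) ≠ 0 := by omega
      exact h2 (Int.eq_zero_of_abs_lt_dvd hdvd h1))
  simp_rw [poly_zpt]
  rw [key]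
  have hinter : range (M + 1) ∩ Icc 1 N = Icc 1 N := by
    ext n; simp only [mem_inter, mem_range, mem_Icc]; omega
  rw [hinter]
  congr 1
  refine sum_congr rfl fun n _ => ?_
  have hRc : (R : ℂ) ≠ 0 := Complex.ofReal_ne_zero.mpr hR
  rw [inv_pow, mul_assoc, mul_inv_cancel₀ (pow_ne_zero _ hRc), mul_one]


/-- `e(x) = exp((2πx) i)` with a real argument. [folklore] -/
theorem e_apply' (x : ℝ) : e x = Complex.exp (((2 * Real.pi * x : ℝ) : ℂ) * Complex.I) := by
  rw [e_apply]; congr 1; push_cast; ring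

/-- `e` is continuous. [folklore] -/
theorem continuous_e : Continuous e := by
  have : e = fun x : ℝ => Complex.exp (2 * Real.pi * Complex.I * x) := funext e_apply
  rw [this]; fun_prop

/-- `Re e(x) = cos(2πx)`. [folklore] -/
theorem e_re (x : ℝ) : (e x).re = Real.cos (2 * Real.pi * x) := by
  rw [e_apply', Complex.exp_ofReal_mul_I_re]

/-- `Im e(x) = sin(2πx)`. [folklore] -/
theorem e_im (x : ℝ) : (e x).im = Real.sin (2 * Real.pi * x) := by
  rw [e_apply', Complex.exp_ofReal_mul_I_im]


/-- `e(−x)e(x) = 1`. [folklore] -/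
theorem e_neg_mul_e (x : ℝ) : e (-x) * e x = 1 := by rw [← e_add, neg_add_cancel, e_zero]


/-! ### Weighted geometric sums: `n^a ρⁿ ≤ 3 T^a` for `ρ ≤ e^{-1/T}`, `0 ≤ a ≤ 2` -/

/-- `x^a e^{-x} ≤ 3` for `x ≥ 0`, `0 ≤ a ≤ 2` (indeed `x^a ≤ 1 + x²` and `x² ≤ 2eˣ`). [folklore] -/
theorem rpow_mul_exp_neg_le {a x : ℝ} (ha0 : 0 ≤ a) (ha2 : a ≤ 2) (hx : 0 ≤ x) :
    x ^ a * Real.exp (-x) ≤ 3 := by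
  have h1 : x ^ a ≤ 1 + x ^ 2 := by
    rcases le_or_gt x 1 with hx1 | hx1
    · have : x ^ a ≤ 1 := Real.rpow_le_one hx hx1 ha0
      nlinarith [sq_nonneg x]
    · have : x ^ a ≤ x ^ (2 : ℝ) := Real.rpow_le_rpow_of_exponent_le hx1.le ha2
      rw [Real.rpow_two] at this
      linarith
  have h2 : x ^ 2 / 2 ≤ Real.exp x := by
    have := Real.pow_div_factorial_le_exp (x := x) hx 2
    simpa [Nat.factorial] using this
  have hexp : 0 < Real.exp x := Real.exp_pos x
  have h3 : Real.exp (-x) = (Real.exp x)⁻¹ := Real.exp_neg x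
  rw [h3]
  have h4 : 1 ≤ Real.exp x := by simpa using Real.add_one_le_exp x |>.trans' (by linarith : (1:ℝ) ≤ x + 1)
  calc x ^ a * (Real.exp x)⁻¹ ≤ (1 + x ^ 2) * (Real.exp x)⁻¹ := by
        gcongr
    _ = (1 + x ^ 2) / Real.exp x := by rw [div_eq_mul_inv]
    _ ≤ 3 := by
        rw [div_le_iff₀ hexp]
        nlinarith

/-- `n^a ρⁿ ≤ 3 T^a` whenever `0 ≤ ρ ≤ e^{-1/T}`, `T > 0`, `0 ≤ a ≤ 2`. [folklore] -/
theorem rpow_mul_pow_le {a T ρ : ℝ} (ha0 : 0 ≤ a) (ha2 : a ≤ 2) (hT : 0 < T) (hρ0 : 0 ≤ ρ)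
    (hρ : ρ ≤ Real.exp (-1 / T)) (n : ℕ) : (n : ℝ) ^ a * ρ ^ n ≤ 3 * T ^ a := by
  have hx : 0 ≤ (n : ℝ) / T := by positivity
  have hpow : ρ ^ n ≤ Real.exp (-((n : ℝ) / T)) := by
    calc ρ ^ n ≤ (Real.exp (-1 / T)) ^ n := pow_le_pow_left₀ hρ0 hρ n
      _ = Real.exp (-((n : ℝ) / T)) := by rw [← Real.exp_nat_mul]; congr 1; ring
  have hn : (n : ℝ) = T * ((n : ℝ) / T) := by field_simp
  have hna : (n : ℝ) ^ a = T ^ a * ((n : ℝ) / T) ^ a := by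
    rw [hn, Real.mul_rpow hT.le hx, ← hn]
  rw [hna, mul_assoc]
  have hTa : 0 ≤ T ^ a := Real.rpow_nonneg hT.le a
  have hinner : ((n : ℝ) / T) ^ a * ρ ^ n ≤ 3 :=
    calc ((n : ℝ) / T) ^ a * ρ ^ n ≤ ((n : ℝ) / T) ^ a * Real.exp (-((n : ℝ) / T)) := by
          gcongr
      _ ≤ 3 := rpow_mul_exp_neg_le ha0 ha2 hx
  calc T ^ a * (((n : ℝ) / T) ^ a * ρ ^ n) ≤ T ^ a * 3 := by gcongr
    _ = 3 * T ^ a := by ring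

/-- `∑_{n<K} n^a ρ^{2n} ≤ 3T^a/(1 − ρ)` for `0 ≤ ρ < 1`, `ρ ≤ e^{-1/T}`. [folklore] -/
theorem sum_rpow_mul_pow_two_mul_le {a T ρ : ℝ} (ha0 : 0 ≤ a) (ha2 : a ≤ 2) (hT : 0 < T)
    (hρ0 : 0 ≤ ρ) (hρ1 : ρ < 1) (hρ : ρ ≤ Real.exp (-1 / T)) (K : ℕ) :
    ∑ n ∈ range K, (n : ℝ) ^ a * ρ ^ (2 * n) ≤ 3 * T ^ a / (1 - ρ) := by
  calc ∑ n ∈ range K, (n : ℝ) ^ a * ρ ^ (2 * n)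
      = ∑ n ∈ range K, ((n : ℝ) ^ a * ρ ^ n) * ρ ^ n := by
        refine sum_congr rfl fun n _ => ?_; rw [pow_mul, sq, mul_pow]; ring_nf
    _ ≤ ∑ n ∈ range K, (3 * T ^ a) * ρ ^ n := by
        refine sum_le_sum fun n _ => ?_
        exact mul_le_mul_of_nonneg_right (rpow_mul_pow_le ha0 ha2 hT hρ0 hρ n) (pow_nonneg hρ0 n)
    _ = (3 * T ^ a) * ∑ n ∈ range K, ρ ^ n := by rw [mul_sum]
    _ ≤ (3 * T ^ a) * (1 / (1 - ρ)) := by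
        refine mul_le_mul_of_nonneg_left ?_ (by positivity)
        have := geom_sum_Ico_le_of_lt_one hρ0 hρ1 (m := 0) (n := K)
        rw [← range_eq_Ico, pow_zero] at this
        exact this
    _ = 3 * T ^ a / (1 - ρ) := by ring

/-! ### The radius `R = 1 − 1/N` -/

/-- The radius of the circle. [folklore] -/
def radius (N : ℕ) : ℝ := 1 - 1 / N

/-- `R > 0` for `N ≥ 2`. [folklore] -/
theorem radius_pos {N : ℕ} (hN : 2 ≤ N) : 0 < radius N := by
  unfold radius
  have : (2 : ℝ) ≤ N := by exact_mod_cast hN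
  have : 1 / (N : ℝ) ≤ 1 / 2 := by gcongr
  linarith

/-- `R < 1`. [folklore] -/
theorem radius_lt_one {N : ℕ} (hN : 2 ≤ N) : radius N < 1 := by
  unfold radius
  have : (0 : ℝ) < N := by exact_mod_cast (show 0 < N by omega)
  have : 0 < 1 / (N : ℝ) := by positivity
  linarith

/-- `1 − R = 1/N`. [folklore] -/
theorem one_sub_radius {N : ℕ} : 1 - radius N = 1 / N := by unfold radius; ring

/-- `R ≤ e^{−1/N}`. [folklore] -/
theorem radius_le_exp (N : ℕ) : radius N ≤ Real.exp (-1 / N) := by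
  unfold radius
  have := Real.add_one_le_exp (-1 / (N : ℝ))
  have h : (-1 : ℝ) / N = -(1 / N) := by ring
  linarith

/-- `√R ≤ 1 − 1/(2N) ≤ e^{-1/(2N)}`. [folklore] -/
theorem sqrt_radius_le {N : ℕ} (hN : 2 ≤ N) : Real.sqrt (radius N) ≤ 1 - 1 / (2 * N) := by
  have hNpos : (0 : ℝ) < N := by exact_mod_cast (show 0 < N by omega)
  have h2 : (2 : ℝ) ≤ N := by exact_mod_cast hN
  rw [Real.sqrt_le_left (by
    have : 1 / (2 * (N : ℝ)) ≤ 1 / 4 := by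
      rw [div_le_div_iff₀ (by positivity) (by positivity)]; linarith
    linarith)]
  unfold radius
  have : (1 - 1 / (2 * (N : ℝ))) ^ 2 = 1 - 1 / N + 1 / (4 * N ^ 2) := by
    field_simp; ring
  rw [this]
  have : 0 < 1 / (4 * (N : ℝ) ^ 2) := by positivity
  linarith

/-- `√R ≤ e^{−1/(2N)}`. [folklore] -/
theorem sqrt_radius_le_exp {N : ℕ} (hN : 2 ≤ N) :
    Real.sqrt (radius N) ≤ Real.exp (-1 / (2 * N)) := by
  refine (sqrt_radius_le hN).trans ?_
  have := Real.add_one_le_exp (-1 / (2 * (N : ℝ)))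
  have h : (-1 : ℝ) / (2 * N) = -(1 / (2 * N)) := by ring
  linarith

/-- `1 − √R ≥ 1/(2N)`. [folklore] -/
theorem one_sub_sqrt_radius {N : ℕ} (hN : 2 ≤ N) : 1 / (2 * N) ≤ 1 - Real.sqrt (radius N) := by
  have := sqrt_radius_le hN; linarith

/-- `∑_{n<K} n^a Rⁿ ≤ 24 N^{a+1}` (`R = 1 − 1/N`, `0 ≤ a ≤ 2`). [folklore] -/
theorem sum_rpow_mul_radius_pow_le {N : ℕ} (hN : 2 ≤ N) {a : ℝ} (ha0 : 0 ≤ a) (ha2 : a ≤ 2)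
    (K : ℕ) : ∑ n ∈ range K, (n : ℝ) ^ a * radius N ^ n ≤ 24 * (N : ℝ) ^ (a + 1) := by
  have hNpos : (0 : ℝ) < N := by exact_mod_cast (show 0 < N by omega)
  set ρ := Real.sqrt (radius N) with hρ
  have hρ0 : 0 ≤ ρ := Real.sqrt_nonneg _
  have hρ1 : ρ < 1 := by
    have := sqrt_radius_le hN
    have : 0 < 1 / (2 * (N : ℝ)) := by positivity
    linarith
  have hρexp : ρ ≤ Real.exp (-1 / (2 * N)) := sqrt_radius_le_exp hN
  have hR : ∀ n : ℕ, radius N ^ n = ρ ^ (2 * n) := by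
    intro n; rw [pow_mul, hρ, Real.sq_sqrt (radius_pos hN).le]
  simp_rw [hR]
  have h := sum_rpow_mul_pow_two_mul_le ha0 ha2 (by positivity : (0 : ℝ) < 2 * N) hρ0 hρ1 hρexp K
  refine h.trans ?_
  have hden : 1 / (2 * N) ≤ 1 - ρ := one_sub_sqrt_radius hN
  have h2Na : (2 * (N : ℝ)) ^ a ≤ 4 * (N : ℝ) ^ a := by
    rw [Real.mul_rpow (by norm_num) hNpos.le]
    gcongr
    calc (2 : ℝ) ^ a ≤ 2 ^ (2 : ℝ) := Real.rpow_le_rpow_of_exponent_le (by norm_num) ha2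
      _ = 4 := by norm_num
  have hpos : 0 < 1 - ρ := by linarith
  calc 3 * (2 * (N : ℝ)) ^ a / (1 - ρ) ≤ 3 * (4 * (N : ℝ) ^ a) / (1 - ρ) := by
        gcongr
    _ ≤ 3 * (4 * (N : ℝ) ^ a) / (1 / (2 * N)) :=
        div_le_div_of_nonneg_left (by positivity) (by positivity) hden
    _ = 24 * ((N : ℝ) ^ a * N) := by field_simp; ring
    _ = 24 * (N : ℝ) ^ (a + 1) := by rw [Real.rpow_add hNpos, Real.rpow_one]

/-- `∑_{n<K} n^a R^{2n} ≤ 3 N^{a+1}`. [folklore] -/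
theorem sum_rpow_mul_radius_pow_two_mul_le {N : ℕ} (hN : 2 ≤ N) {a : ℝ} (ha0 : 0 ≤ a)
    (ha2 : a ≤ 2) (K : ℕ) :
    ∑ n ∈ range K, (n : ℝ) ^ a * radius N ^ (2 * n) ≤ 3 * (N : ℝ) ^ (a + 1) := by
  have hNpos : (0 : ℝ) < N := by exact_mod_cast (show 0 < N by omega)
  have h := sum_rpow_mul_pow_two_mul_le ha0 ha2 hNpos (radius_pos hN).le (radius_lt_one hN)
    (radius_le_exp N) K
  refine h.trans (le_of_eq ?_)
  rw [one_sub_radius, Real.rpow_add hNpos, Real.rpow_one]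
  field_simp

/-- `R^N ≤ e^{-1}` and hence `R^{N²} ≤ e^{-N}`. [folklore] -/
theorem radius_pow_le_exp_neg_one {N : ℕ} (hN : 2 ≤ N) : radius N ^ N ≤ Real.exp (-1) := by
  unfold radius
  have := Real.one_sub_div_pow_le_exp_neg (n := N) (t := 1) (by exact_mod_cast (show 1 ≤ N by omega))
  simpa using this

/-- `R^{N²} ≤ e^{−N}`. [folklore] -/
theorem radius_pow_sq_le {N : ℕ} (hN : 2 ≤ N) : radius N ^ (N ^ 2) ≤ Real.exp (-(N : ℝ)) := by
  rw [sq, pow_mul]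
  calc (radius N ^ N) ^ N ≤ (Real.exp (-1)) ^ N :=
        pow_le_pow_left₀ (pow_nonneg (radius_pos hN).le _) (radius_pow_le_exp_neg_one hN) N
    _ = Real.exp (-(N : ℝ)) := by rw [← Real.exp_nat_mul]; simp

/-- `R^{-N} ≤ 8` (indeed `≤ e^{N/(N-1)} ≤ e²`). [folklore] -/
theorem inv_radius_pow_le {N : ℕ} (hN : 2 ≤ N) : (radius N)⁻¹ ^ N ≤ 8 := by
  have hR := radius_pos hN
  have hNpos : (0 : ℝ) < N := by exact_mod_cast (show 0 < N by omega)
  have h2 : (2 : ℝ) ≤ N := by exact_mod_cast hN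
  -- log R ≥ 1 - 1/R = -1/(N-1)
  have hlog : 1 - (radius N)⁻¹ ≤ Real.log (radius N) := Real.one_sub_inv_le_log_of_pos hR
  have hRinv : (radius N)⁻¹ = N / (N - 1) := by
    unfold radius; field_simp
  have hlog2 : -2 ≤ (N : ℝ) * Real.log (radius N) := by
    have hN1' : (N : ℝ) - 1 ≠ 0 := by linarith
    have h1 : 1 - (radius N)⁻¹ = -1 / (N - 1) := by
      rw [hRinv, eq_div_iff hN1', sub_mul, div_mul_cancel₀ _ hN1']; ring
    rw [h1] at hlog
    have hN1 : (0 : ℝ) < N - 1 := by linarith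
    have : (N : ℝ) * (-1 / (N - 1)) ≥ -2 := by
      rw [ge_iff_le, mul_div_assoc', le_div_iff₀ hN1]; nlinarith
    nlinarith [mul_le_mul_of_nonneg_left hlog hNpos.le]
  have : (radius N)⁻¹ ^ N = Real.exp (-(N * Real.log (radius N))) := by
    rw [Real.exp_neg, Real.exp_nat_mul, Real.exp_log hR, inv_pow]
  rw [this]
  calc Real.exp (-(N * Real.log (radius N))) ≤ Real.exp 2 := Real.exp_le_exp.mpr (by linarith)
    _ ≤ 8 := by
        have := Real.exp_one_lt_d9
        have h : Real.exp 2 = Real.exp 1 ^ 2 := by rw [← Real.exp_nat_mul]; norm_num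
        rw [h]; nlinarith [Real.exp_pos 1]

/-- `e^{-N} N⁴ ≤ 120/N`. [folklore] -/
theorem exp_neg_mul_pow_four_le {N : ℕ} (hN : 1 ≤ N) :
    Real.exp (-(N : ℝ)) * (N : ℝ) ^ 4 ≤ 120 / N := by
  have hNpos : (0 : ℝ) < N := by exact_mod_cast (show 0 < N by omega)
  have h := Real.pow_div_factorial_le_exp (x := (N : ℝ)) hNpos.le 5
  have h5 : (Nat.factorial 5 : ℝ) = 120 := by norm_num [Nat.factorial]
  rw [h5, div_le_iff₀ (by norm_num : (0:ℝ) < 120)] at h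
  rw [Real.exp_neg, le_div_iff₀ hNpos]
  have hexp := Real.exp_pos (N : ℝ)
  calc (Real.exp (N : ℝ))⁻¹ * (N : ℝ) ^ 4 * N = (N : ℝ) ^ 5 / Real.exp N := by
        rw [div_eq_mul_inv]; ring
    _ ≤ 120 := by rw [div_le_iff₀ hexp]; linarith


/-! ### Abel summation and the square of a polynomial -/

/-- **Abel summation for a polynomial**:
`∑_{n ≤ M} gₙ zⁿ = (1 − z) ∑_{n < M} (∑_{k ≤ n} g_k) zⁿ + (∑_{k ≤ M} g_k) z^M`. [folklore] -/
theorem sum_range_succ_mul_pow_eq_abel {K : Type*} [CommRing K] (g : ℕ → K) (z : K) (M : ℕ) :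
    ∑ n ∈ range (M + 1), g n * z ^ n =
      (1 - z) * ∑ n ∈ range M, (∑ k ∈ range (n + 1), g k) * z ^ n +
        (∑ k ∈ range (M + 1), g k) * z ^ M := by
  induction M with
  | zero => simp
  | succ M ih =>
      rw [sum_range_succ, ih, sum_range_succ (f := fun n => (∑ k ∈ range (n + 1), g k) * z ^ n),
        sum_range_succ (f := g) (n := M + 1)]
      ring

/-- The pairs `(i, j) ∈ [0, M]²` with `i + j ≤ M` are the union of the antidiagonals `0, …, M`.
[folklore] -/
theorem filter_add_le_eq_biUnion (M : ℕ) :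
    ((range (M + 1) ×ˢ range (M + 1)).filter fun p : ℕ × ℕ => p.1 + p.2 ≤ M) =
      (range (M + 1)).biUnion antidiagonal := by
  ext ⟨i, j⟩
  simp only [mem_filter, mem_product, mem_range, mem_biUnion, HasAntidiagonal.mem_antidiagonal]
  constructor
  · rintro ⟨-, h⟩; exact ⟨i + j, by omega, rfl⟩
  · rintro ⟨n, hn, hij⟩; omega

/-- **Square of a polynomial**: the coefficients up to degree `M` are the antidiagonal sums, the
rest is the tail over pairs with `i + j > M`. [folklore] -/
theorem sq_sum_range_mul_pow (c : ℕ → ℂ) (z : ℂ) (M : ℕ) :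
    (∑ n ∈ range (M + 1), c n * z ^ n) ^ 2 =
      ∑ n ∈ range (M + 1), (∑ p ∈ antidiagonal n, c p.1 * c p.2) * z ^ n +
        ∑ p ∈ (range (M + 1) ×ˢ range (M + 1)).filter (fun p : ℕ × ℕ => M < p.1 + p.2),
          c p.1 * c p.2 * z ^ (p.1 + p.2) := by
  have hexp : (∑ n ∈ range (M + 1), c n * z ^ n) ^ 2 =
      ∑ p ∈ range (M + 1) ×ˢ range (M + 1), c p.1 * c p.2 * z ^ (p.1 + p.2) := by
    rw [sq, sum_mul_sum, sum_product]
    refine sum_congr rfl fun i _ => sum_congr rfl fun j _ => ?_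
    rw [pow_add]; ring
  rw [hexp, ← sum_filter_add_sum_filter_not _ (fun p : ℕ × ℕ => p.1 + p.2 ≤ M)]
  congr 1
  · rw [filter_add_le_eq_biUnion, sum_biUnion]
    · refine sum_congr rfl fun n _ => ?_
      rw [sum_mul]
      refine sum_congr rfl fun p hp => ?_
      rw [HasAntidiagonal.mem_antidiagonal] at hp
      rw [hp]
    · -- antidiagonals are pairwise disjoint
      intro n _ m _ hnm
      simp only [Function.onFun]
      rw [Finset.disjoint_left]
      intro p hp hq
      rw [HasAntidiagonal.mem_antidiagonal] at hp hq
      exact hnm (hp.symm.trans hq)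
  · refine sum_congr ?_ fun _ _ => rfl
    ext p; simp only [mem_filter, not_le]

/-- The tail is small on `|z| ≤ 1`: `‖tail‖ ≤ ‖z‖^{M+1} (∑_{n ≤ M} cₙ)²` for real `cₙ ≥ 0`.
[folklore] -/
theorem norm_sq_tail_le (c : ℕ → ℝ) (hc : ∀ n, 0 ≤ c n) {z : ℂ} (hz : ‖z‖ ≤ 1) (M : ℕ) :
    ‖∑ p ∈ (range (M + 1) ×ˢ range (M + 1)).filter (fun p : ℕ × ℕ => M < p.1 + p.2),
        (c p.1 : ℂ) * c p.2 * z ^ (p.1 + p.2)‖ ≤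
      ‖z‖ ^ (M + 1) * (∑ n ∈ range (M + 1), c n) ^ 2 := by
  refine (norm_sum_le _ _).trans ?_
  calc ∑ p ∈ (range (M + 1) ×ˢ range (M + 1)).filter (fun p : ℕ × ℕ => M < p.1 + p.2),
        ‖(c p.1 : ℂ) * c p.2 * z ^ (p.1 + p.2)‖
      ≤ ∑ p ∈ (range (M + 1) ×ˢ range (M + 1)).filter (fun p : ℕ × ℕ => M < p.1 + p.2),
          c p.1 * c p.2 * ‖z‖ ^ (M + 1) := by
        refine sum_le_sum fun p hp => ?_
        rw [mem_filter] at hp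
        rw [norm_mul, norm_mul, norm_pow, Complex.norm_real, Complex.norm_real,
          Real.norm_of_nonneg (hc _), Real.norm_of_nonneg (hc _)]
        refine mul_le_mul_of_nonneg_left ?_ (mul_nonneg (hc _) (hc _))
        exact pow_le_pow_of_le_one (norm_nonneg _) hz (by omega)
    _ ≤ ∑ p ∈ range (M + 1) ×ˢ range (M + 1), c p.1 * c p.2 * ‖z‖ ^ (M + 1) :=
        sum_le_sum_of_subset_of_nonneg (filter_subset _ _) fun p _ _ => by
          have := hc p.1; have := hc p.2; positivity
    _ = ‖z‖ ^ (M + 1) * (∑ n ∈ range (M + 1), c n) ^ 2 := by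
        rw [sq, sum_mul_sum, sum_product, mul_sum]
        refine sum_congr rfl fun i _ => ?_
        rw [mul_sum]
        refine sum_congr rfl fun j _ => ?_
        ring

/-! ### The polynomials `F`, `V`, `D = F − V` -/

/-- `F(z) = ∑_{n ≤ M} Λ(n) zⁿ`. [cite: BhowmikRuzsa2018, proof of Theorem 2.1] -/
def Fpoly (M : ℕ) (z : ℂ) : ℂ := ∑ n ∈ range (M + 1), (Λ n : ℂ) * z ^ n

/-- `V(z) = ∑_{n ≤ M} zⁿ` (the truncation of `1/(1 − z)`). [folklore] -/
def Vpoly (M : ℕ) (z : ℂ) : ℂ := ∑ n ∈ range (M + 1), z ^ n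

/-- `D(z) = F(z) − V(z) = ∑_{n ≤ M} (Λ(n) − 1) zⁿ`. [folklore] -/
def Dpoly (M : ℕ) (z : ℂ) : ℂ := ∑ n ∈ range (M + 1), ((Λ n - 1 : ℝ) : ℂ) * z ^ n

/-- `D = F − V`. [folklore] -/
theorem Dpoly_eq (M : ℕ) (z : ℂ) : Dpoly M z = Fpoly M z - Vpoly M z := by
  unfold Dpoly Fpoly Vpoly
  rw [← sum_sub_distrib]
  refine sum_congr rfl fun n _ => ?_
  push_cast; ring

/-- `(1 − z)V(z) = 1 − z^{M+1}`. [folklore] -/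
theorem one_sub_mul_Vpoly (M : ℕ) (z : ℂ) : (1 - z) * Vpoly M z = 1 - z ^ (M + 1) := by
  unfold Vpoly; rw [mul_neg_geom_sum]

/-- `S_V(n) = ∑_{k ≤ n} #(antidiagonal k) = (n+1)(n+2)/2`. [folklore] -/
theorem sum_range_card_antidiagonal (n : ℕ) :
    ∑ k ∈ range (n + 1), (((antidiagonal k : Finset (ℕ × ℕ)).card : ℕ) : ℝ) = ((n : ℝ) + 1) * (n + 2) / 2 := by
  induction n with
  | zero => simp
  | succ n ih =>
      rw [sum_range_succ, ih, Finset.Nat.card_antidiagonal]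
      push_cast; ring

/-- The decomposition `F(z)² − V(z)² = (1 − z) ∑_{n<M} (S(n) − S_V(n)) zⁿ + (S(M) − S_V(M)) z^M + (T_F − T_V)`
with `S = goldbachLambdaSum`-type partial sums `∑_{k ≤ n} G(k)`, `S_V(n) = (n+1)(n+2)/2`.
[cite: BhowmikRuzsa2018, proof of Theorem 2.1] -/
theorem Fpoly_sq_sub_Vpoly_sq (M : ℕ) (z : ℂ) :
    Fpoly M z ^ 2 - Vpoly M z ^ 2 =
      (1 - z) * ∑ n ∈ range M,
          (((∑ k ∈ range (n + 1), Literature.NumberTheory.Sieve.goldbachLambdaCount k) - ((n : ℝ) + 1) * (n + 2) / 2 : ℝ) : ℂ) *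
            z ^ n +
        (((∑ k ∈ range (M + 1), Literature.NumberTheory.Sieve.goldbachLambdaCount k) - ((M : ℝ) + 1) * (M + 2) / 2 : ℝ) : ℂ) *
          z ^ M +
        (∑ p ∈ (range (M + 1) ×ˢ range (M + 1)).filter (fun p : ℕ × ℕ => M < p.1 + p.2),
            ((Λ p.1 : ℝ) : ℂ) * (Λ p.2 : ℝ) * z ^ (p.1 + p.2) -
          ∑ p ∈ (range (M + 1) ×ˢ range (M + 1)).filter (fun p : ℕ × ℕ => M < p.1 + p.2),
            ((1 : ℝ) : ℂ) * ((1 : ℝ) : ℂ) * z ^ (p.1 + p.2)) := by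
  -- squares
  have hF : Fpoly M z ^ 2 = _ := sq_sum_range_mul_pow (fun n => ((Λ n : ℝ) : ℂ)) z M
  have hV0 : Vpoly M z = ∑ n ∈ range (M + 1), ((1 : ℝ) : ℂ) * z ^ n := by
    unfold Vpoly; simp
  have hV := sq_sum_range_mul_pow (fun _ => ((1 : ℝ) : ℂ)) z M
  rw [← hV0] at hV
  -- Abel on the main parts
  have hAF := sum_range_succ_mul_pow_eq_abel
    (fun n => ∑ p ∈ antidiagonal n, ((Λ p.1 : ℝ) : ℂ) * ((Λ p.2 : ℝ) : ℂ)) z M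
  have hAV := sum_range_succ_mul_pow_eq_abel
    (fun n => ∑ p ∈ antidiagonal n, ((1 : ℝ) : ℂ) * ((1 : ℝ) : ℂ)) z M
  -- identify the coefficient sums
  have hG : ∀ n, (∑ p ∈ antidiagonal n, ((Λ p.1 : ℝ) : ℂ) * ((Λ p.2 : ℝ) : ℂ)) =
      ((Literature.NumberTheory.Sieve.goldbachLambdaCount n : ℝ) : ℂ) := by
    intro n; unfold Literature.NumberTheory.Sieve.goldbachLambdaCount; push_cast; rfl
  have h1 : ∀ n, (∑ p ∈ antidiagonal n, ((1 : ℝ) : ℂ) * ((1 : ℝ) : ℂ)) =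
      ((((antidiagonal n : Finset (ℕ × ℕ)).card : ℕ) : ℝ) : ℂ) := by
    intro n; simp
  rw [hF, hV]
  simp_rw [hG, h1] at hAF hAV ⊢
  rw [hAF, hAV]
  simp_rw [← Complex.ofReal_sum, sum_range_card_antidiagonal]
  push_cast
  simp only [sub_mul, sum_sub_distrib]
  ring


/-! ### The major arc: the complex square root -/

/-- `F` is continuous. [folklore] -/
theorem continuous_Fpoly (M : ℕ) : Continuous (Fpoly M) := by
  unfold Fpoly; fun_prop

/-! ### Geometry of the circle `|z| = R` near `z = 1` -/

/-- `‖1 − R e(y)‖² = 1 − 2R cos(2πy) + R²`. [folklore] -/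
theorem norm_sq_one_sub (R y : ℝ) :
    ‖1 - (R : ℂ) * e y‖ ^ 2 = 1 - 2 * R * Real.cos (2 * Real.pi * y) + R ^ 2 := by
  rw [Complex.sq_norm, Complex.normSq_apply]
  have hre : (1 - (R : ℂ) * e y).re = 1 - R * Real.cos (2 * Real.pi * y) := by
    simp [Complex.sub_re, Complex.mul_re, e_re, e_im]
  have him : (1 - (R : ℂ) * e y).im = -(R * Real.sin (2 * Real.pi * y)) := by
    simp [Complex.sub_im, Complex.mul_im, e_re, e_im]
  rw [hre, him]
  nlinarith [Real.sin_sq_add_cos_sq (2 * Real.pi * y)]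

/-- On `|y| ≤ |x| ≤ 1/2` the distance to `1` is monotone: `‖1 − R e(y)‖ ≤ ‖1 − R e(x)‖` (`R ≥ 0`).
[folklore] -/
theorem norm_one_sub_mono {R : ℝ} (hR : 0 ≤ R) {x y : ℝ} (hyx : |y| ≤ |x|) (hx : |x| ≤ 1 / 2) :
    ‖1 - (R : ℂ) * e y‖ ≤ ‖1 - (R : ℂ) * e x‖ := by
  have hcos : Real.cos (2 * Real.pi * x) ≤ Real.cos (2 * Real.pi * y) := by
    have habs : ∀ t : ℝ, |2 * Real.pi * t| = 2 * Real.pi * |t| := fun t => by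
      rw [abs_mul, abs_of_pos Real.two_pi_pos]
    rw [← Real.cos_abs (2 * Real.pi * x), ← Real.cos_abs (2 * Real.pi * y), habs, habs]
    refine Real.cos_le_cos_of_nonneg_of_le_pi (by positivity) ?_ (by nlinarith [Real.pi_pos])
    calc 2 * Real.pi * |x| ≤ 2 * Real.pi * (1 / 2) := by gcongr
      _ = Real.pi := by ring
  have h2 : ‖1 - (R : ℂ) * e y‖ ^ 2 ≤ ‖1 - (R : ℂ) * e x‖ ^ 2 := by
    rw [norm_sq_one_sub, norm_sq_one_sub]; nlinarith
  exact le_of_pow_le_pow_left₀ two_ne_zero (norm_nonneg _) h2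

/-- If `w² = 1 + E` with `‖E‖ ≤ 1/2` then `(Re w)² ≥ 1/2`. [folklore] -/
theorem half_le_re_sq {w E : ℂ} (h : w ^ 2 = 1 + E) (hE : ‖E‖ ≤ 1 / 2) : 1 / 2 ≤ w.re ^ 2 := by
  have hre : (w ^ 2).re = w.re ^ 2 - w.im ^ 2 := by rw [sq, Complex.mul_re]; ring
  have h1 : (w ^ 2).re = 1 + E.re := by rw [h]; simp
  have hEre : |E.re| ≤ 1 / 2 := (Complex.abs_re_le_norm E).trans hE
  nlinarith [abs_le.mp hEre, sq_nonneg w.im]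

/-- **The major-arc pointwise bound (Bhowmik–Ruzsa's "complex square root").** On `|z| = R < 1`
write `f = (1 − z)F(z)`, `v = (1 − z)V(z) = 1 − z^{M+1}`. If `‖F² − V²‖ ≤ B‖1 − z‖` on the arc
`‖1 − z‖ ≤ η`, `Bη³ ≤ 1/4` and `R^{M+1} ≤ 1/16`, then `f² = 1 + O(1/2)` on the arc, so `Re f`
keeps the sign it has at `z = R` (where `F(R) ≥ 0`) by the intermediate value theorem; hence
`‖f + v‖ ≥ 1`, `‖f − v‖ ≤ ‖f² − v²‖ ≤ B‖1 − z‖³` and `‖D(z)‖ = ‖f − v‖/‖1 − z‖ ≤ B‖1 − z‖²`.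
[cite: BhowmikRuzsa2018, proof of Theorem 2.1 ("we take the complex square root")] -/
theorem major_arc_pointwise {M : ℕ} {R B η : ℝ} (hR0 : 0 < R) (hR1 : R < 1) (hB : 0 ≤ B)
    (hsmall : B * η ^ 3 ≤ 1 / 4) (htail : R ^ (M + 1) ≤ 1 / 16)
    (hW : ∀ y : ℝ, ‖1 - (R : ℂ) * e y‖ ≤ η →
      ‖Fpoly M ((R : ℂ) * e y) ^ 2 - Vpoly M ((R : ℂ) * e y) ^ 2‖ ≤ B * ‖1 - (R : ℂ) * e y‖)
    {x : ℝ} (hx : |x| ≤ 1 / 2) (hxη : ‖1 - (R : ℂ) * e x‖ ≤ η) :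
    ‖Dpoly M ((R : ℂ) * e x)‖ ≤ B * ‖1 - (R : ℂ) * e x‖ ^ 2 := by
  -- notation
  set z : ℝ → ℂ := fun y => (R : ℂ) * e y with hz
  set f : ℝ → ℂ := fun y => (1 - z y) * Fpoly M (z y) with hf
  set v : ℝ → ℂ := fun y => (1 - z y) * Vpoly M (z y) with hv
  have hv_eq : ∀ y, v y = 1 - z y ^ (M + 1) := fun y => one_sub_mul_Vpoly M (z y)
  have hnorm_z : ∀ y, ‖z y‖ = R := fun y => by
    simp only [hz, norm_mul, norm_e, mul_one, Complex.norm_real, Real.norm_of_nonneg hR0.le]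
  have hη0 : 0 ≤ η := (norm_nonneg _).trans hxη
  -- `‖v - 1‖ ≤ 1/16`
  have hv1 : ∀ y, ‖v y - 1‖ ≤ 1 / 16 := fun y => by
    rw [hv_eq, sub_sub_cancel_left, norm_neg, norm_pow, hnorm_z]; exact htail
  -- `f² - v² = (1 - z)² (F² - V²)`
  have hfv : ∀ y, f y ^ 2 - v y ^ 2 =
      (1 - z y) ^ 2 * (Fpoly M (z y) ^ 2 - Vpoly M (z y) ^ 2) := by
    intro y; simp only [hf, hv]; ring
  have hfv_bound : ∀ y, ‖1 - z y‖ ≤ η → ‖f y ^ 2 - v y ^ 2‖ ≤ B * ‖1 - z y‖ ^ 3 := by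
    intro y hy
    rw [hfv, norm_mul, norm_pow]
    calc ‖1 - z y‖ ^ 2 * ‖Fpoly M (z y) ^ 2 - Vpoly M (z y) ^ 2‖
        ≤ ‖1 - z y‖ ^ 2 * (B * ‖1 - z y‖) := by gcongr; exact hW y hy
      _ = B * ‖1 - z y‖ ^ 3 := by ring
  have hfv_quarter : ∀ y, ‖1 - z y‖ ≤ η → ‖f y ^ 2 - v y ^ 2‖ ≤ 1 / 4 := by
    intro y hy
    refine (hfv_bound y hy).trans ?_
    calc B * ‖1 - z y‖ ^ 3 ≤ B * η ^ 3 := by gcongr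
      _ ≤ 1 / 4 := hsmall
  -- `(Re f)² ≥ 1/2` on the arc
  have hre_sq : ∀ y, ‖1 - z y‖ ≤ η → 1 / 2 ≤ (f y).re ^ 2 := by
    intro y hy
    have h1 : ‖v y ^ 2 - 1‖ ≤ 1 / 4 := by
      have : v y ^ 2 - 1 = (v y - 1) * (v y - 1 + 2) := by ring
      rw [this, norm_mul]
      have h2 : ‖v y - 1 + 2‖ ≤ 1 / 16 + 2 :=
        (norm_add_le _ _).trans (by rw [Complex.norm_two]; linarith [hv1 y])
      calc ‖v y - 1‖ * ‖v y - 1 + 2‖ ≤ (1 / 16) * (1 / 16 + 2) := by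
            gcongr; exact hv1 y
        _ ≤ 1 / 4 := by norm_num
    have hE : ‖(v y ^ 2 - 1) + (f y ^ 2 - v y ^ 2)‖ ≤ 1 / 2 := by
      refine (norm_add_le _ _).trans ?_
      linarith [hfv_quarter y hy]
    exact half_le_re_sq (by ring) hE
  -- continuity of `y ↦ Re f(y)`
  have hzc : Continuous z := by simp only [hz]; exact continuous_const.mul continuous_e
  have hcont : Continuous fun y => (f y).re := by
    have : Continuous f := by
      simp only [hf]
      exact (continuous_const.sub hzc).mul ((continuous_Fpoly M).comp hzc)
    exact Complex.continuous_re.comp this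
  -- points between `0` and `x` stay in the arc
  have harc : ∀ y ∈ Set.uIcc 0 x, ‖1 - z y‖ ≤ η := by
    intro y hy
    have hyx : |y| ≤ |x| := by
      rcases le_total 0 x with h0x | hx0
      · rw [Set.uIcc_of_le h0x] at hy
        rw [abs_of_nonneg hy.1, abs_of_nonneg h0x]; exact hy.2
      · rw [Set.uIcc_of_ge hx0] at hy
        rw [abs_of_nonpos hy.2, abs_of_nonpos hx0]; linarith [hy.1]
    exact (norm_one_sub_mono hR0.le hyx hx).trans hxη
  -- `Re f(0) ≥ 1/2`
  have hg0 : 1 / 2 ≤ (f 0).re := by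
    have hf0 : f 0 = (((1 - R) * ∑ n ∈ range (M + 1), Λ n * R ^ n : ℝ) : ℂ) := by
      simp only [hf, hz, Fpoly, e_zero, mul_one]
      push_cast
      rfl
    have hnonneg : 0 ≤ (f 0).re := by
      rw [hf0, Complex.ofReal_re]
      exact mul_nonneg (by linarith) (sum_nonneg fun n _ =>
        mul_nonneg ArithmeticFunction.vonMangoldt_nonneg (pow_nonneg hR0.le _))
    have hsq := hre_sq 0 (harc 0 Set.left_mem_uIcc)
    nlinarith
  -- `Re f(x) ≥ 1/2` by the intermediate value theorem
  have hgx : 1 / 2 ≤ (f x).re := by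
    have hsq := hre_sq x hxη
    by_contra hlt
    push Not at hlt
    have hneg : (f x).re < 0 := by nlinarith
    have hIVT := intermediate_value_uIcc (f := fun y => (f y).re) (a := (0 : ℝ)) (b := x)
      hcont.continuousOn
    have h0mem : (0 : ℝ) ∈ Set.uIcc ((fun y => (f y).re) 0) ((fun y => (f y).re) x) := by
      rw [Set.mem_uIcc]; right; constructor <;> simp only <;> linarith
    obtain ⟨y, hy, hy0⟩ := hIVT h0mem
    have := hre_sq y (harc y hy)
    simp only at hy0
    rw [hy0] at this
    norm_num at this
  -- `‖f + v‖ ≥ 1`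
  have hsum_re : 1 ≤ (f x + v x).re := by
    rw [Complex.add_re]
    have hvre : 1 - 1 / 16 ≤ (v x).re := by
      have h := (Complex.abs_re_le_norm _).trans (hv1 x)
      rw [Complex.sub_re, Complex.one_re] at h
      linarith [(abs_le.mp h).1]
    linarith
  have hfv_norm : 1 ≤ ‖f x + v x‖ := hsum_re.trans (Complex.re_le_norm _)
  -- `‖f - v‖ ≤ B ‖1 - z‖³`
  have hdiff : ‖f x - v x‖ ≤ B * ‖1 - z x‖ ^ 3 := by
    have hprod : (f x - v x) * (f x + v x) = f x ^ 2 - v x ^ 2 := by ring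
    have h1 : ‖f x - v x‖ * ‖f x + v x‖ ≤ B * ‖1 - z x‖ ^ 3 := by
      rw [← norm_mul, hprod]; exact hfv_bound x hxη
    calc ‖f x - v x‖ = ‖f x - v x‖ * 1 := (mul_one _).symm
      _ ≤ ‖f x - v x‖ * ‖f x + v x‖ := by gcongr
      _ ≤ B * ‖1 - z x‖ ^ 3 := h1
  -- `D = (f - v)/(1 - z)`
  have h1z : 1 - z x ≠ 0 := by
    intro h
    have h' : z x = 1 := (sub_eq_zero.mp h).symm
    have : ‖z x‖ = 1 := by rw [h', norm_one]
    rw [hnorm_z] at this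
    linarith
  have hD : Dpoly M (z x) = (f x - v x) / (1 - z x) := by
    rw [Dpoly_eq]; simp only [hf, hv]
    rw [← mul_sub, mul_div_cancel_left₀ _ h1z]
  change ‖Dpoly M (z x)‖ ≤ B * ‖1 - z x‖ ^ 2
  rw [hD, norm_div, div_le_iff₀ (norm_pos_iff.mpr h1z)]
  calc ‖f x - v x‖ ≤ B * ‖1 - z x‖ ^ 3 := hdiff
    _ = B * ‖1 - z x‖ ^ 2 * ‖1 - z x‖ := by ring


/-- `‖1 − R e(y)‖² = (1 − R)² + 4R sin²(πy)`. [folklore] -/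
theorem norm_sq_one_sub' (R y : ℝ) :
    ‖1 - (R : ℂ) * e y‖ ^ 2 = (1 - R) ^ 2 + 4 * R * Real.sin (Real.pi * y) ^ 2 := by
  rw [norm_sq_one_sub]
  have : Real.cos (2 * Real.pi * y) = 1 - 2 * Real.sin (Real.pi * y) ^ 2 := by
    rw [show 2 * Real.pi * y = 2 * (Real.pi * y) by ring, Real.cos_two_mul, Real.cos_sq']; ring
  rw [this]; ring

/-- For `R ≥ 1/4`: `|sin(πy)| ≤ ‖1 − R e(y)‖`. [folklore] -/
theorem abs_sin_le_norm_one_sub {R : ℝ} (hR : 1 / 4 ≤ R) (y : ℝ) :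
    |Real.sin (Real.pi * y)| ≤ ‖1 - (R : ℂ) * e y‖ := by
  have hsq : Real.sin (Real.pi * y) ^ 2 ≤ ‖1 - (R : ℂ) * e y‖ ^ 2 := by
    rw [norm_sq_one_sub']; nlinarith [sq_nonneg (Real.sin (Real.pi * y)), sq_nonneg (1 - R)]
  exact abs_le_of_sq_le_sq hsq (norm_nonneg _)

/-- For `R ≤ 1`: `‖1 − R e(y)‖² ≤ (1 − R)² + 4 sin²(πy)`. [folklore] -/
theorem norm_sq_one_sub_le {R : ℝ} (hR1 : R ≤ 1) (y : ℝ) :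
    ‖1 - (R : ℂ) * e y‖ ^ 2 ≤ (1 - R) ^ 2 + 4 * Real.sin (Real.pi * y) ^ 2 := by
  rw [norm_sq_one_sub']; nlinarith [sq_nonneg (Real.sin (Real.pi * y))]

/-- Jordan's inequality on the circle: `2 min(j, L − j)/L ≤ |sin(πj/L)|` for `j ≤ L`. [folklore] -/
theorem two_mul_min_div_le_abs_sin {L j : ℕ} (hL : 0 < L) (hj : j ≤ L) :
    2 * (min j (L - j) : ℕ) / (L : ℝ) ≤ |Real.sin (Real.pi * ((j : ℝ) / L))| := by
  have hLr : (0 : ℝ) < L := by exact_mod_cast hL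
  rcases le_or_gt (2 * j) L with h2 | h2
  · -- `j ≤ L/2`
    have hmin : (min j (L - j) : ℕ) = j := min_eq_left (by omega)
    rw [hmin]
    have harg0 : 0 ≤ Real.pi * ((j : ℝ) / L) := by positivity
    have harg1 : Real.pi * ((j : ℝ) / L) ≤ Real.pi / 2 := by
      rw [mul_div_assoc', div_le_div_iff₀ hLr two_pos]
      have : (2 : ℝ) * j ≤ L := by exact_mod_cast h2
      nlinarith [Real.pi_pos]
    have hJ := Real.mul_le_sin harg0 harg1
    calc 2 * ((j : ℕ) : ℝ) / (L : ℝ) = 2 / Real.pi * (Real.pi * ((j : ℝ) / L)) := by field_simp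
      _ ≤ Real.sin (Real.pi * ((j : ℝ) / L)) := hJ
      _ ≤ |Real.sin (Real.pi * ((j : ℝ) / L))| := le_abs_self _
  · -- `j > L/2`: use `sin(π - x) = sin x`
    have hmin : (min j (L - j) : ℕ) = L - j := min_eq_right (by omega)
    rw [hmin]
    have hsymm : Real.sin (Real.pi * ((j : ℝ) / L)) = Real.sin (Real.pi * (((L - j : ℕ) : ℝ) / L)) := by
      rw [← Real.sin_pi_sub]; congr 1
      rw [Nat.cast_sub hj]; field_simp
    rw [hsymm]
    have harg0 : 0 ≤ Real.pi * (((L - j : ℕ) : ℝ) / L) := by positivity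
    have harg1 : Real.pi * (((L - j : ℕ) : ℝ) / L) ≤ Real.pi / 2 := by
      rw [mul_div_assoc', div_le_div_iff₀ hLr two_pos]
      have : (2 : ℝ) * ((L - j : ℕ) : ℝ) ≤ L := by
        rw [Nat.cast_sub hj]; have : (L : ℝ) < 2 * j := by exact_mod_cast h2
        linarith
      nlinarith [Real.pi_pos]
    have hJ := Real.mul_le_sin harg0 harg1
    calc 2 * (((L - j : ℕ) : ℕ) : ℝ) / (L : ℝ) = 2 / Real.pi * (Real.pi * (((L - j : ℕ) : ℝ) / L)) := by
          field_simp
      _ ≤ Real.sin (Real.pi * (((L - j : ℕ) : ℝ) / L)) := hJ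
      _ ≤ |Real.sin (Real.pi * (((L - j : ℕ) : ℝ) / L))| := le_abs_self _

/-- `|sin(πj/L)| ≤ π min(j, L − j)/L` for `j ≤ L`. [folklore] -/
theorem abs_sin_le_pi_mul_min_div {L j : ℕ} (hL : 0 < L) (hj : j ≤ L) :
    |Real.sin (Real.pi * ((j : ℝ) / L))| ≤ Real.pi * (min j (L - j) : ℕ) / (L : ℝ) := by
  have hLr : (0 : ℝ) < L := by exact_mod_cast hL
  have hargle : Real.pi * ((j : ℝ) / L) ≤ Real.pi := by
    have : (j : ℝ) / L ≤ 1 := by rw [div_le_one hLr]; exact_mod_cast hj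
    nlinarith [Real.pi_pos]
  have hsin0 : 0 ≤ Real.sin (Real.pi * ((j : ℝ) / L)) :=
    Real.sin_nonneg_of_nonneg_of_le_pi (by positivity) hargle
  rw [abs_of_nonneg hsin0]
  rcases le_or_gt (2 * j) L with h2 | h2
  · rw [min_eq_left (by omega : j ≤ L - j)]
    calc Real.sin (Real.pi * ((j : ℝ) / L)) ≤ Real.pi * ((j : ℝ) / L) := Real.sin_le (by positivity)
      _ = Real.pi * (j : ℕ) / (L : ℝ) := by ring
  · rw [min_eq_right (by omega : L - j ≤ j)]
    have hsymm : Real.sin (Real.pi * ((j : ℝ) / L)) = Real.sin (Real.pi * (((L - j : ℕ) : ℝ) / L)) := by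
      rw [← Real.sin_pi_sub]; congr 1
      rw [Nat.cast_sub hj]; field_simp
    rw [hsymm]
    calc Real.sin (Real.pi * (((L - j : ℕ) : ℝ) / L)) ≤ Real.pi * (((L - j : ℕ) : ℝ) / L) :=
          Real.sin_le (by positivity)
      _ = Real.pi * ((L - j : ℕ) : ℕ) / (L : ℝ) := by ring

/-! ### The extraction kernel -/

/-- `K_j = ∑_{1 ≤ m ≤ N} R^{-m} e(−mj/L)`. [cite: BhowmikRuzsa2018, proof of Theorem 2.1 (kernel `K`)] -/
def kern (R : ℝ) (L N j : ℕ) : ℂ := ∑ m ∈ Icc 1 N, ((R : ℂ)⁻¹) ^ m * e (-((m : ℝ) * j / L))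

/-- `‖K_j‖ ≤ (R^{-N} + 1)/‖1 − R e(j/L)‖` (`0 < R < 1`). [cite: BhowmikRuzsa2018, proof of Theorem 2.1 (`K(z) ≪ |1−z|⁻¹`)] -/
theorem norm_kern_le {R : ℝ} (hR0 : 0 < R) (hR1 : R < 1) (L N j : ℕ) :
    ‖kern R L N j‖ ≤ ((R⁻¹) ^ N + 1) / ‖1 - (R : ℂ) * e ((j : ℝ) / L)‖ := by
  set x : ℝ := (j : ℝ) / L with hx
  set w : ℂ := (R : ℂ)⁻¹ * e (-x) with hw
  have hRc : (R : ℂ) ≠ 0 := Complex.ofReal_ne_zero.mpr hR0.ne'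
  -- `K = ∑_{m=1}^{N} w^m = w ∑_{k<N} w^k`
  have hterm : ∀ m : ℕ, ((R : ℂ)⁻¹) ^ m * e (-((m : ℝ) * j / L)) = w ^ m := by
    intro m
    rw [hw, mul_pow, ← e_nat_mul]; congr 2; rw [hx]; ring
  have hK : kern R L N j = w * ∑ k ∈ range N, w ^ k := by
    unfold kern
    simp_rw [hterm]
    rw [show Icc 1 N = Ico 1 (N + 1) from rfl, Finset.sum_Ico_eq_sum_range, mul_sum]
    simp_rw [show N + 1 - 1 = N from rfl, pow_add, pow_one]
  -- norms
  have hnw : ‖w‖ = R⁻¹ := by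
    rw [hw, norm_mul, norm_inv, Complex.norm_real, Real.norm_of_nonneg hR0.le, norm_e, mul_one]
  have hw1 : w - 1 = (R : ℂ)⁻¹ * e (-x) * (1 - (R : ℂ) * e x) := by
    calc w - 1 = (R : ℂ)⁻¹ * e (-x) - ((R : ℂ)⁻¹ * R) * (e (-x) * e x) := by
          rw [inv_mul_cancel₀ hRc, e_neg_mul_e, one_mul, hw]
      _ = (R : ℂ)⁻¹ * e (-x) * (1 - (R : ℂ) * e x) := by ring
  have hnw1 : ‖w - 1‖ = R⁻¹ * ‖1 - (R : ℂ) * e x‖ := by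
    rw [hw1, norm_mul, norm_mul, norm_inv, Complex.norm_real, Real.norm_of_nonneg hR0.le, norm_e,
      mul_one]
  have h1z : 1 - (R : ℂ) * e x ≠ 0 := by
    intro h
    have : ‖(R : ℂ) * e x‖ = 1 := by rw [← (sub_eq_zero.mp h)]; simp
    rw [norm_mul, Complex.norm_real, Real.norm_of_nonneg hR0.le, norm_e, mul_one] at this
    linarith
  have hwne : w ≠ 1 := by
    intro h
    have : ‖w - 1‖ = 0 := by rw [h, sub_self, norm_zero]
    rw [hnw1] at this
    rcases mul_eq_zero.mp this with h' | h'
    · exact (inv_ne_zero hR0.ne') h'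
    · exact h1z (norm_eq_zero.mp h')
  have hpos : 0 < ‖1 - (R : ℂ) * e x‖ := norm_pos_iff.mpr h1z
  rw [hK, geom_sum_eq hwne, norm_mul, norm_div, hnw, hnw1]
  have hnum : ‖w ^ N - 1‖ ≤ R⁻¹ ^ N + 1 := by
    refine (norm_sub_le _ _).trans ?_
    rw [norm_pow, hnw, norm_one]
  rw [mul_div_assoc']
  rw [div_le_div_iff₀ (by positivity) hpos]
  calc R⁻¹ * ‖w ^ N - 1‖ * ‖1 - (R : ℂ) * e x‖ ≤ R⁻¹ * (R⁻¹ ^ N + 1) * ‖1 - (R : ℂ) * e x‖ := by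
        gcongr
    _ = (R⁻¹ ^ N + 1) * (R⁻¹ * ‖1 - (R : ℂ) * e x‖) := by ring


/-! ### Minor and major arcs over the sample points -/

/-- `∑_{i ∈ S} 1/i² ≤ 2/μ` when every `i ∈ S` is `≥ μ ≥ 1`. [folklore] -/
theorem sum_inv_sq_le_of_ge {μ : ℝ} (hμ : 1 ≤ μ) (S : Finset ℕ) (hS : ∀ i ∈ S, μ ≤ i) :
    ∑ i ∈ S, ((i : ℝ) ^ 2)⁻¹ ≤ 2 / μ := by
  set k : ℕ := ⌈μ⌉₊ - 1 with hk
  have hk1 : 1 ≤ ⌈μ⌉₊ := Nat.ceil_pos.mpr (by linarith)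
  have hsub : S ⊆ Ioo k (S.sup id + 1) := by
    intro i hi
    rw [mem_Ioo]
    constructor
    · have : ⌈μ⌉₊ ≤ i := Nat.ceil_le.mpr (hS i hi)
      omega
    · have : i ≤ S.sup id := le_sup (f := id) hi
      omega
  calc ∑ i ∈ S, ((i : ℝ) ^ 2)⁻¹ ≤ ∑ i ∈ Ioo k (S.sup id + 1), ((i : ℝ) ^ 2)⁻¹ :=
        sum_le_sum_of_subset_of_nonneg hsub fun i _ _ => by positivity
    _ ≤ 2 / ((k : ℝ) + 1) := sum_Ioo_inv_sq_le k _
    _ ≤ 2 / μ := by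
        have hk' : ((k : ℝ) + 1) = ⌈μ⌉₊ := by
          rw [hk, Nat.cast_sub hk1]; push_cast; ring
        rw [hk']
        exact div_le_div_of_nonneg_left (by norm_num) (by linarith) (Nat.le_ceil μ)

/-- **Minor-arc kernel bound**: `∑_{j ∈ S} ‖K_j‖² ≤ (R^{-N} + 1)² L²/μ` if every `j ∈ S`,
`j < L`, has `min(j, L − j) ≥ μ ≥ 1` (`1/4 ≤ R < 1`).
[cite: BhowmikRuzsa2018, proof of Theorem 2.1 (`I ≪ N^{1−δ/3}`)] -/
theorem minor_kernel_sq_sum {R μ : ℝ} {L N : ℕ} (hL : 0 < L) (hR0 : 0 < R) (hR4 : 1 / 4 ≤ R)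
    (hR1 : R < 1) (hμ : 1 ≤ μ) (S : Finset ℕ) (hSL : ∀ j ∈ S, j < L)
    (hS : ∀ j ∈ S, μ ≤ ((min j (L - j) : ℕ) : ℝ)) :
    ∑ j ∈ S, ‖kern R L N j‖ ^ 2 ≤ (R⁻¹ ^ N + 1) ^ 2 * (L : ℝ) ^ 2 / μ := by
  have hLr : (0 : ℝ) < L := by exact_mod_cast hL
  set A : ℝ := R⁻¹ ^ N + 1 with hA
  have hA0 : 0 ≤ A := by positivity
  -- pointwise: `‖K_j‖² ≤ A² L²/4 · (1/j² + 1/(L-j)²)`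
  have hpt : ∀ j ∈ S, ‖kern R L N j‖ ^ 2 ≤
      A ^ 2 * (L : ℝ) ^ 2 / 4 * ((((j : ℕ) : ℝ) ^ 2)⁻¹ + ((((L - j : ℕ) : ℕ) : ℝ) ^ 2)⁻¹) := by
    intro j hj
    have hjL := hSL j hj
    have hm := hS j hj
    have hm1 : (1 : ℝ) ≤ ((min j (L - j) : ℕ) : ℝ) := hμ.trans hm
    have hm1' : 1 ≤ min j (L - j) := by exact_mod_cast hm1
    have hj1 : 1 ≤ j := le_trans hm1' (min_le_left _ _)
    have hLj1 : 1 ≤ L - j := le_trans hm1' (min_le_right _ _)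
    have hsin : 2 * ((min j (L - j) : ℕ) : ℝ) / L ≤ ‖1 - (R : ℂ) * e ((j : ℝ) / L)‖ :=
      (two_mul_min_div_le_abs_sin hL hjL.le).trans (abs_sin_le_norm_one_sub hR4 _)
    have hlow : 0 < 2 * ((min j (L - j) : ℕ) : ℝ) / L := by positivity
    have hK := norm_kern_le hR0 hR1 L N j
    have hK' : ‖kern R L N j‖ ≤ A / (2 * ((min j (L - j) : ℕ) : ℝ) / L) :=
      hK.trans (div_le_div_of_nonneg_left hA0 hlow hsin)
    have hK2 : ‖kern R L N j‖ ^ 2 ≤ (A / (2 * ((min j (L - j) : ℕ) : ℝ) / L)) ^ 2 :=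
      pow_le_pow_left₀ (norm_nonneg _) hK' 2
    refine hK2.trans ?_
    have hmin_inv : (((min j (L - j) : ℕ) : ℝ) ^ 2)⁻¹ ≤
        (((j : ℕ) : ℝ) ^ 2)⁻¹ + ((((L - j : ℕ) : ℕ) : ℝ) ^ 2)⁻¹ := by
      rcases min_choice j (L - j) with h | h <;> rw [h]
      · have : 0 ≤ ((((L - j : ℕ) : ℕ) : ℝ) ^ 2)⁻¹ := by positivity
        linarith
      · have : 0 ≤ (((j : ℕ) : ℝ) ^ 2)⁻¹ := by positivity
        linarith
    calc (A / (2 * ((min j (L - j) : ℕ) : ℝ) / L)) ^ 2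
        = A ^ 2 * (L : ℝ) ^ 2 / 4 * (((min j (L - j) : ℕ) : ℝ) ^ 2)⁻¹ := by
          field_simp
          ring
      _ ≤ A ^ 2 * (L : ℝ) ^ 2 / 4 * ((((j : ℕ) : ℝ) ^ 2)⁻¹ + ((((L - j : ℕ) : ℕ) : ℝ) ^ 2)⁻¹) := by
          gcongr
  -- sum the two series
  have h1 : ∑ j ∈ S, (((j : ℕ) : ℝ) ^ 2)⁻¹ ≤ 2 / μ :=
    sum_inv_sq_le_of_ge hμ S fun j hj => (hS j hj).trans (by exact_mod_cast min_le_left _ _)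
  have h2 : ∑ j ∈ S, ((((L - j : ℕ) : ℕ) : ℝ) ^ 2)⁻¹ ≤ 2 / μ := by
    have hinj : Set.InjOn (fun j : ℕ => L - j) S := by
      intro a ha b hb hab
      have := hSL a ha; have := hSL b hb
      simp only at hab; omega
    rw [← sum_image (f := fun i : ℕ => ((i : ℝ) ^ 2)⁻¹) hinj]
    refine sum_inv_sq_le_of_ge hμ _ fun i hi => ?_
    rw [mem_image] at hi
    obtain ⟨j, hj, rfl⟩ := hi
    exact (hS j hj).trans (by exact_mod_cast min_le_right _ _)
  calc ∑ j ∈ S, ‖kern R L N j‖ ^ 2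
      ≤ ∑ j ∈ S, A ^ 2 * (L : ℝ) ^ 2 / 4 * ((((j : ℕ) : ℝ) ^ 2)⁻¹ + ((((L - j : ℕ) : ℕ) : ℝ) ^ 2)⁻¹) :=
        sum_le_sum hpt
    _ = A ^ 2 * (L : ℝ) ^ 2 / 4 * (∑ j ∈ S, (((j : ℕ) : ℝ) ^ 2)⁻¹ + ∑ j ∈ S, ((((L - j : ℕ) : ℕ) : ℝ) ^ 2)⁻¹) := by
        rw [← mul_sum, sum_add_distrib]
    _ ≤ A ^ 2 * (L : ℝ) ^ 2 / 4 * (2 / μ + 2 / μ) := by gcongr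
    _ = A ^ 2 * (L : ℝ) ^ 2 / μ := by ring

/-- A point outside the major arc has `min(j, L − j) ≥ ηL/10`, provided `2(1 − R)² ≤ η²`
(`0 ≤ R ≤ 1`). [folklore] -/
theorem min_ge_of_minor {R η : ℝ} {L j : ℕ} (hL : 0 < L) (hjL : j ≤ L) (hR1 : R ≤ 1)
    (hη : 0 ≤ η) (hηR : 2 * (1 - R) ^ 2 ≤ η ^ 2) (hminor : η < ‖1 - (R : ℂ) * e ((j : ℝ) / L)‖) :
    η * L / 10 ≤ ((min j (L - j) : ℕ) : ℝ) := by
  have hLr : (0 : ℝ) < L := by exact_mod_cast hL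
  set m : ℝ := ((min j (L - j) : ℕ) : ℝ) with hm
  have hm0 : 0 ≤ m := by positivity
  have hsq : η ^ 2 < ‖1 - (R : ℂ) * e ((j : ℝ) / L)‖ ^ 2 := pow_lt_pow_left₀ hminor hη two_ne_zero
  have hup := norm_sq_one_sub_le hR1 ((j : ℝ) / L)
  have hsin := abs_sin_le_pi_mul_min_div hL hjL
  have hsin2 : Real.sin (Real.pi * ((j : ℝ) / L)) ^ 2 ≤ (Real.pi * m / L) ^ 2 := by
    rw [← sq_abs]; exact pow_le_pow_left₀ (abs_nonneg _) hsin 2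
  have hpi := Real.pi_lt_d2
  have hpi0 := Real.pi_pos
  -- `η² L² < 8 π² m² < 80 m² ≤ (10 m)²`
  have h1 : η ^ 2 / 8 < (Real.pi * m / L) ^ 2 := by nlinarith
  have h2 : (η * L / 10) ^ 2 < m ^ 2 := by
    have h1' : η ^ 2 * L ^ 2 < 8 * Real.pi ^ 2 * m ^ 2 := by
      have := h1; rw [div_pow, lt_div_iff₀ (by positivity)] at this; nlinarith
    have hpi2 : Real.pi ^ 2 < 10 := by nlinarith
    have h3 : 8 * Real.pi ^ 2 * m ^ 2 ≤ 80 * m ^ 2 := by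
      nlinarith [mul_nonneg (sub_nonneg.mpr hpi2.le) (sq_nonneg m)]
    rw [div_pow, mul_pow]
    nlinarith
  exact (lt_of_pow_lt_pow_left₀ 2 hm0 h2).le

/-- **Major-arc contribution**: with `‖D_j‖ ≤ B‖1 − z_j‖²` on the arc `‖1 − z_j‖ ≤ η`,
`∑_{major} ‖D_j‖‖K_j‖ ≤ B(R^{-N}+1)η(ηL + 2)` (`1/4 ≤ R < 1`).
[cite: BhowmikRuzsa2018, proof of Theorem 2.1 (major arc)] -/
theorem major_sum_le {R η B : ℝ} {L N : ℕ} (hL : 0 < L) (hR0 : 0 < R) (hR4 : 1 / 4 ≤ R)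
    (hR1 : R < 1) (hη : 0 ≤ η) (hB : 0 ≤ B) (D : ℕ → ℂ)
    (hD : ∀ j ∈ range L, ‖1 - (R : ℂ) * e ((j : ℝ) / L)‖ ≤ η →
      ‖D j‖ ≤ B * ‖1 - (R : ℂ) * e ((j : ℝ) / L)‖ ^ 2) :
    ∑ j ∈ (range L).filter (fun j : ℕ => ‖1 - (R : ℂ) * e ((j : ℝ) / L)‖ ≤ η),
        ‖D j‖ * ‖kern R L N j‖ ≤ B * (R⁻¹ ^ N + 1) * η * (η * L + 2) := by
  have hLr : (0 : ℝ) < L := by exact_mod_cast hL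
  set A : ℝ := R⁻¹ ^ N + 1 with hA
  set T := (range L).filter (fun j : ℕ => ‖1 - (R : ℂ) * e ((j : ℝ) / L)‖ ≤ η) with hT
  -- pointwise bound `B A η`
  have hpt : ∀ j ∈ T, ‖D j‖ * ‖kern R L N j‖ ≤ B * A * η := by
    intro j hj
    rw [hT, mem_filter] at hj
    have h1z : 0 < ‖1 - (R : ℂ) * e ((j : ℝ) / L)‖ := by
      rw [norm_pos_iff]; intro h
      have : ‖(R : ℂ) * e ((j : ℝ) / L)‖ = 1 := by rw [← sub_eq_zero.mp h]; simp
      rw [norm_mul, Complex.norm_real, Real.norm_of_nonneg hR0.le, norm_e, mul_one] at this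
      linarith
    calc ‖D j‖ * ‖kern R L N j‖
        ≤ (B * ‖1 - (R : ℂ) * e ((j : ℝ) / L)‖ ^ 2) * (A / ‖1 - (R : ℂ) * e ((j : ℝ) / L)‖) :=
          mul_le_mul (hD j hj.1 hj.2) (norm_kern_le hR0 hR1 L N j) (norm_nonneg _) (by positivity)
      _ = B * A * ‖1 - (R : ℂ) * e ((j : ℝ) / L)‖ := by field_simp
      _ ≤ B * A * η := by gcongr; exact hj.2
  -- count: `#T ≤ η L + 2`
  have hcount : (T.card : ℝ) ≤ η * L + 2 := by
    set c : ℕ := ⌊η * L / 2⌋₊ with hc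
    have hTsub : T ⊆ (range L).filter (fun j : ℕ => j ≤ c) ∪ (range L).filter (fun j : ℕ => L - j ≤ c) := by
      intro j hj
      rw [hT, mem_filter] at hj
      have hjL : j < L := mem_range.mp hj.1
      have h2m : 2 * ((min j (L - j) : ℕ) : ℝ) / L ≤ η :=
        ((two_mul_min_div_le_abs_sin hL hjL.le).trans (abs_sin_le_norm_one_sub hR4 _)).trans hj.2
      have hmle : ((min j (L - j) : ℕ) : ℝ) ≤ η * L / 2 := by
        rw [div_le_iff₀ hLr] at h2m; linarith
      have hmc : min j (L - j) ≤ c := Nat.le_floor hmle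
      rw [mem_union, mem_filter, mem_filter]
      rcases min_le_iff.mp hmc with h | h
      · exact Or.inl ⟨hj.1, h⟩
      · exact Or.inr ⟨hj.1, h⟩
    have hU1 : ((range L).filter (fun j : ℕ => j ≤ c)).card ≤ c + 1 := by
      calc ((range L).filter (fun j : ℕ => j ≤ c)).card ≤ (range (c + 1)).card :=
            card_le_card fun j hj => by
              rw [mem_filter] at hj; rw [mem_range]; omega
        _ = c + 1 := card_range _
    have hU2 : ((range L).filter (fun j : ℕ => L - j ≤ c)).card ≤ c + 1 := by
      have hinj : Set.InjOn (fun j : ℕ => L - j) ((range L).filter (fun j : ℕ => L - j ≤ c)) := by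
        intro a ha b hb hab
        rw [mem_coe, mem_filter, mem_range] at ha hb
        simp only at hab; omega
      rw [← card_image_of_injOn hinj]
      calc (((range L).filter (fun j : ℕ => L - j ≤ c)).image (fun j : ℕ => L - j)).card
          ≤ (range (c + 1)).card := card_le_card fun i hi => by
            rw [mem_image] at hi
            obtain ⟨j, hj, rfl⟩ := hi
            rw [mem_filter] at hj; rw [mem_range]; omega
        _ = c + 1 := card_range _
    have hcardN : T.card ≤ 2 * c + 2 :=
      (card_le_card hTsub).trans ((card_union_le _ _).trans (by omega))
    have hc_le : (c : ℝ) ≤ η * L / 2 := Nat.floor_le (by positivity)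
    calc (T.card : ℝ) ≤ ((2 * c + 2 : ℕ) : ℝ) := by exact_mod_cast hcardN
      _ = 2 * (c : ℝ) + 2 := by push_cast; ring
      _ ≤ η * L + 2 := by linarith
  calc ∑ j ∈ T, ‖D j‖ * ‖kern R L N j‖ ≤ ∑ j ∈ T, B * A * η := sum_le_sum hpt
    _ = T.card * (B * A * η) := by rw [sum_const, nsmul_eq_mul]
    _ ≤ (η * L + 2) * (B * A * η) := by gcongr
    _ = B * A * η * (η * L + 2) := by ring

/-! ### The mean square `∑ (Λ(n) − 1)² R^{2n} = O(N log N)` -/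

/-- Chebyshev's constant `c₀ = log 4 + 4` of Mathlib's `Chebyshev.psi_le_const_mul_self`. [folklore] -/
def chebC : ℝ := Real.log 4 + 4

/-- `c₀ > 0`. [folklore] -/
theorem chebC_pos : 0 < chebC := by
  unfold chebC; have : 0 < Real.log 4 := Real.log_pos (by norm_num); linarith

/-- `∑_{k ≤ n} Λ(k) = ψ(n) ≤ c₀ n`. [folklore] -/
theorem sum_range_vonMangoldt_eq_psi (n : ℕ) : ∑ k ∈ range (n + 1), Λ k = ψ (n : ℝ) := by
  rw [Chebyshev.psi_eq_sum_Icc, Nat.floor_natCast, Nat.range_succ_eq_Icc_zero]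

/-- Chebyshev: `ψ(n) ≤ c₀ n` (Mathlib `Chebyshev.psi_le_const_mul_self`). [folklore] -/
theorem sum_range_vonMangoldt_le (n : ℕ) : ∑ k ∈ range (n + 1), Λ k ≤ chebC * n := by
  rw [sum_range_vonMangoldt_eq_psi]; exact Chebyshev.psi_le_const_mul_self (Nat.cast_nonneg n)

/-- `∑_{n ≤ N²} Λ(n) R^{2n} ≤ 126 c₀ N` (Abel summation with `ψ(n) ≤ c₀ n`). [folklore] -/
theorem sum_vonMangoldt_mul_radius_pow_le {N : ℕ} (hN : 2 ≤ N) :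
    ∑ n ∈ range (N ^ 2 + 1), Λ n * radius N ^ (2 * n) ≤ 126 * chebC * N := by
  have hNpos : (0 : ℝ) < N := by exact_mod_cast (show 0 < N by omega)
  have hR0 := (radius_pos hN).le
  have hR1 := (radius_lt_one hN).le
  set r : ℝ := radius N ^ 2 with hr
  have hr0 : 0 ≤ r := by positivity
  have hr1 : r ≤ 1 := by rw [hr]; exact pow_le_one₀ hR0 hR1
  have hrn : ∀ n : ℕ, radius N ^ (2 * n) = r ^ n := fun n => by rw [hr, ← pow_mul]
  simp_rw [hrn]
  rw [sum_range_succ_mul_pow_eq_abel (fun n => Λ n) r (N ^ 2)]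
  -- first part: `(1 - r) ∑_{n<M} ψ(n) rⁿ ≤ (1 - r) c₀ ∑ n rⁿ ≤ (2/N) c₀ 3N²`
  have h1r : 1 - r ≤ 2 / N := by
    have : 1 - r = (1 - radius N) * (1 + radius N) := by rw [hr]; ring
    rw [this, one_sub_radius]
    calc 1 / (N : ℝ) * (1 + radius N) ≤ 1 / N * 2 := by gcongr; linarith
      _ = 2 / N := by ring
  have hA : ∑ n ∈ range (N ^ 2), (∑ k ∈ range (n + 1), Λ k) * r ^ n ≤ chebC * (3 * (N : ℝ) ^ 2) := by
    calc ∑ n ∈ range (N ^ 2), (∑ k ∈ range (n + 1), Λ k) * r ^ n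
        ≤ ∑ n ∈ range (N ^ 2), (chebC * n) * r ^ n :=
          sum_le_sum fun n _ => mul_le_mul_of_nonneg_right (sum_range_vonMangoldt_le n) (by positivity)
      _ = chebC * ∑ n ∈ range (N ^ 2), (n : ℝ) ^ (1 : ℝ) * radius N ^ (2 * n) := by
          rw [mul_sum]; refine sum_congr rfl fun n _ => ?_; rw [Real.rpow_one, hrn]; ring
      _ ≤ chebC * (3 * (N : ℝ) ^ ((1 : ℝ) + 1)) :=
          mul_le_mul_of_nonneg_left (sum_rpow_mul_radius_pow_two_mul_le hN zero_le_one one_le_two _)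
            chebC_pos.le
      _ = chebC * (3 * (N : ℝ) ^ 2) := by norm_num
  -- second part: `ψ(M) r^M ≤ c₀ N² e^{-N} ≤ 120 c₀`
  have hB : (∑ k ∈ range (N ^ 2 + 1), Λ k) * r ^ (N ^ 2) ≤ 120 * chebC := by
    have hψ := sum_range_vonMangoldt_le (N ^ 2)
    have hrM : r ^ (N ^ 2) ≤ Real.exp (-(N : ℝ)) := by
      calc r ^ (N ^ 2) = (radius N ^ (N ^ 2)) ^ 2 := by rw [hr, ← pow_mul, ← pow_mul, mul_comm]
        _ ≤ radius N ^ (N ^ 2) := by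
            refine pow_le_of_le_one (pow_nonneg hR0 _) (pow_le_one₀ hR0 hR1) two_ne_zero
        _ ≤ Real.exp (-(N : ℝ)) := radius_pow_sq_le hN
    have hexp := exp_neg_mul_pow_four_le (show 1 ≤ N by omega)
    have hN1 : (1 : ℝ) ≤ N := by exact_mod_cast (show 1 ≤ N by omega)
    have hc0 := chebC_pos.le
    calc (∑ k ∈ range (N ^ 2 + 1), Λ k) * r ^ (N ^ 2) ≤ (chebC * ((N ^ 2 : ℕ) : ℝ)) * Real.exp (-(N : ℝ)) :=
          mul_le_mul hψ hrM (by positivity) (mul_nonneg hc0 (by positivity))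
      _ = chebC * (Real.exp (-(N : ℝ)) * (N : ℝ) ^ 4) / (N : ℝ) ^ 2 := by
          push_cast; field_simp
      _ ≤ chebC * (120 / N) / (N : ℝ) ^ 2 := by gcongr
      _ ≤ chebC * (120 / N) := div_le_self (mul_nonneg hc0 (by positivity)) (by nlinarith)
      _ ≤ chebC * 120 := by
          refine mul_le_mul_of_nonneg_left (div_le_self (by norm_num) hN1) hc0
      _ = 120 * chebC := by ring
  have hfirst : (1 - r) * ∑ n ∈ range (N ^ 2), (∑ k ∈ range (n + 1), Λ k) * r ^ n ≤
      (2 / N) * (chebC * (3 * (N : ℝ) ^ 2)) :=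
    mul_le_mul h1r hA (sum_nonneg fun n _ => mul_nonneg
      (sum_nonneg fun k _ => ArithmeticFunction.vonMangoldt_nonneg) (by positivity)) (by positivity)
  calc (1 - r) * ∑ n ∈ range (N ^ 2), (∑ k ∈ range (n + 1), Λ k) * r ^ n +
        (∑ k ∈ range (N ^ 2 + 1), Λ k) * r ^ (N ^ 2)
      ≤ (2 / N) * (chebC * (3 * (N : ℝ) ^ 2)) + 120 * chebC := add_le_add hfirst hB
    _ = 6 * chebC * N + 120 * chebC := by field_simp; ring
    _ ≤ 126 * chebC * N := by
        have hN1 : (1 : ℝ) ≤ N := by exact_mod_cast (show 1 ≤ N by omega)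
        nlinarith [chebC_pos]

/-- **Mean square of the coefficients of `D`**: `∑_{n ≤ N²} (Λ(n) − 1)² R^{2n} ≤ (252 c₀ + 3) N log N`
for `N ≥ 3`. [cite: BhowmikRuzsa2018, proof of Theorem 2.1 (`∑ (Λ(n)−1)² (1−1/N)^{2n} = O(N log N)`)] -/
theorem meanSquare_le {N : ℕ} (hN : 3 ≤ N) :
    ∑ n ∈ range (N ^ 2 + 1), (Λ n - 1) ^ 2 * radius N ^ (2 * n) ≤
      (252 * chebC + 3) * N * Real.log N := by
  have hN2 : 2 ≤ N := by omega
  have hNpos : (0 : ℝ) < N := by exact_mod_cast (show 0 < N by omega)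
  have hR0 := (radius_pos hN2).le
  have hlog1 : 1 ≤ Real.log N := by
    rw [Real.le_log_iff_exp_le hNpos]
    have h3 : (3 : ℝ) ≤ N := by exact_mod_cast hN
    linarith [Real.exp_one_lt_d9]
  -- `(Λ - 1)² ≤ Λ log M · Λ... ≤ Λ² + 1`, `Λ(n)² ≤ (2 log N) Λ(n)`
  have hpt : ∀ n ∈ range (N ^ 2 + 1), (Λ n - 1) ^ 2 * radius N ^ (2 * n) ≤
      (2 * Real.log N) * (Λ n * radius N ^ (2 * n)) + (n : ℝ) ^ (0 : ℝ) * radius N ^ (2 * n) := by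
    intro n hn
    rw [mem_range] at hn
    have hΛ0 : 0 ≤ Λ n := ArithmeticFunction.vonMangoldt_nonneg
    have hΛlog : Λ n ≤ 2 * Real.log N := by
      rcases Nat.eq_zero_or_pos n with rfl | hnpos
      · simp; positivity
      · calc Λ n ≤ Real.log n := ArithmeticFunction.vonMangoldt_le_log
          _ ≤ Real.log ((N : ℝ) ^ 2) := Real.log_le_log (by exact_mod_cast hnpos) (by exact_mod_cast (by omega : n ≤ N ^ 2))
          _ = 2 * Real.log N := by rw [Real.log_pow]; push_cast; ring
    rw [Real.rpow_zero, one_mul]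
    have hsq : (Λ n - 1) ^ 2 ≤ 2 * Real.log N * Λ n + 1 := by nlinarith
    have hr : 0 ≤ radius N ^ (2 * n) := by positivity
    nlinarith
  calc ∑ n ∈ range (N ^ 2 + 1), (Λ n - 1) ^ 2 * radius N ^ (2 * n)
      ≤ ∑ n ∈ range (N ^ 2 + 1), ((2 * Real.log N) * (Λ n * radius N ^ (2 * n)) +
          (n : ℝ) ^ (0 : ℝ) * radius N ^ (2 * n)) := sum_le_sum hpt
    _ = (2 * Real.log N) * ∑ n ∈ range (N ^ 2 + 1), Λ n * radius N ^ (2 * n) +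
          ∑ n ∈ range (N ^ 2 + 1), (n : ℝ) ^ (0 : ℝ) * radius N ^ (2 * n) := by
        rw [sum_add_distrib, mul_sum]
    _ ≤ (2 * Real.log N) * (126 * chebC * N) + 3 * (N : ℝ) ^ ((0 : ℝ) + 1) := by
        gcongr
        · exact sum_vonMangoldt_mul_radius_pow_le hN2
        · exact sum_rpow_mul_radius_pow_two_mul_le hN2 le_rfl (by norm_num) _
    _ = 252 * chebC * N * Real.log N + 3 * N := by norm_num; ring
    _ ≤ (252 * chebC + 3) * N * Real.log N := by nlinarith [chebC_pos]

/-! ### The bound `‖F² − V²‖ ≤ κ N^{3−δ} ‖1 − z‖` on `|z| = R` -/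

/-- `S(0) = G(0) = Λ(0)² = 0`. [folklore] -/
theorem goldbachLambdaSum_zero : goldbachLambdaSum 0 = 0 := by
  simp [goldbachLambdaSum, Literature.NumberTheory.Sieve.goldbachLambdaCount]

/-- The constant `κ = 144C + 842 + 120c₀²` of the `W`-bound. [folklore] -/
def kappa (C : ℝ) : ℝ := 144 * C + 842 + 120 * chebC ^ 2

/-- `κ ≥ 842`. [folklore] -/
theorem kappa_ge (C : ℝ) (hC : 0 ≤ C) : 842 ≤ kappa C := by
  unfold kappa; nlinarith [sq_nonneg chebC]

/-- `|S(n) − (n+1)(n+2)/2| ≤ [n = 0] + (C + 5/2) n^{2−δ}` under the power-saving hypothesis.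
[folklore] -/
theorem abs_S_sub_SV_le {C δ : ℝ} (hδ1 : δ ≤ 1)
    (hS : ∀ n : ℕ, 1 ≤ n → |goldbachLambdaSum n - (n : ℝ) ^ 2 / 2| ≤ C * (n : ℝ) ^ (2 - δ))
    (n : ℕ) :
    |goldbachLambdaSum n - ((n : ℝ) + 1) * (n + 2) / 2| ≤
      (if n = 0 then 1 else 0) + (C + 5 / 2) * (n : ℝ) ^ (2 - δ) := by
  rcases Nat.eq_zero_or_pos n with rfl | hn
  · rw [goldbachLambdaSum_zero, if_pos rfl, Nat.cast_zero, Real.zero_rpow (by linarith)]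
    norm_num
  · rw [if_neg (by omega), zero_add]
    have h1 : (1 : ℝ) ≤ n := by exact_mod_cast hn
    have hpow : (n : ℝ) ≤ (n : ℝ) ^ (2 - δ) := by
      calc (n : ℝ) = (n : ℝ) ^ (1 : ℝ) := (Real.rpow_one _).symm
        _ ≤ (n : ℝ) ^ (2 - δ) := Real.rpow_le_rpow_of_exponent_le h1 (by linarith)
    have hmain := hS n hn
    have : goldbachLambdaSum n - ((n : ℝ) + 1) * (n + 2) / 2 =
        (goldbachLambdaSum n - (n : ℝ) ^ 2 / 2) - (3 * n + 2) / 2 := by ring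
    rw [this]
    refine (abs_sub _ _).trans ?_
    rw [abs_of_nonneg (by positivity : (0 : ℝ) ≤ (3 * n + 2) / 2)]
    nlinarith

/-- **The `W`-bound.** Under `|S(n) − n²/2| ≤ C n^{2−δ}` (`n ≥ 1`, `0 < δ ≤ 1`), for `N ≥ 2`
and `|z| = R = 1 − 1/N`, `M = N²`: `‖F(z)² − V(z)²‖ ≤ κ N^{3−δ} ‖1 − z‖`.
[cite: BhowmikRuzsa2018, proof of Theorem 2.1 (`F(z)² = (1−z)⁻² + O(|1−z|N^{3−δ})`)] -/
theorem W_bound {C δ : ℝ} (hC : 0 ≤ C) (hδ0 : 0 < δ) (hδ1 : δ ≤ 1)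
    (hS : ∀ n : ℕ, 1 ≤ n → |goldbachLambdaSum n - (n : ℝ) ^ 2 / 2| ≤ C * (n : ℝ) ^ (2 - δ))
    {N : ℕ} (hN : 2 ≤ N) {z : ℂ} (hz : ‖z‖ = radius N) :
    ‖Fpoly (N ^ 2) z ^ 2 - Vpoly (N ^ 2) z ^ 2‖ ≤ kappa C * (N : ℝ) ^ (3 - δ) * ‖1 - z‖ := by
  have hNpos : (0 : ℝ) < N := by exact_mod_cast (show 0 < N by omega)
  have hN1 : (1 : ℝ) ≤ N := by exact_mod_cast (show 1 ≤ N by omega)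
  have hR0 := (radius_pos hN).le
  have hR1 := (radius_lt_one hN).le
  have hz1 : ‖z‖ ≤ 1 := hz ▸ hR1
  set M : ℕ := N ^ 2 with hM
  have hM1 : 1 ≤ M := Nat.one_le_pow _ _ (by omega)
  -- `1/N ≤ ‖1 - z‖`
  have h1z : 1 / (N : ℝ) ≤ ‖1 - z‖ := by
    have := norm_sub_norm_le (1 : ℂ) z
    rw [norm_one, hz, one_sub_radius] at this
    exact this
  have hpow1 : (1 : ℝ) ≤ (N : ℝ) ^ (3 - δ) := Real.one_le_rpow hN1 (by linarith)
  -- small quantities: `R^M ≤ e^{-N}`, `e^{-N} N⁴ ≤ 120/N`, `e^{-N} ≤ 1/N`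
  have hRM : radius N ^ M ≤ Real.exp (-(N : ℝ)) := radius_pow_sq_le hN
  have hRM1 : radius N ^ (M + 1) ≤ radius N ^ M := pow_le_pow_of_le_one hR0 hR1 (by omega)
  have hexp4 := exp_neg_mul_pow_four_le (show 1 ≤ N by omega)
  have hexp1 : Real.exp (-(N : ℝ)) ≤ 1 / N := by
    rw [Real.exp_neg, one_div]
    exact inv_anti₀ hNpos ((by linarith : (N : ℝ) ≤ N + 1).trans (Real.add_one_le_exp _))
  have hN4 : (N : ℝ) ^ 4 = ((M : ℕ) : ℝ) ^ 2 := by rw [hM]; push_cast; ring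
  -- decomposition
  rw [Fpoly_sq_sub_Vpoly_sq]
  -- (1) the main sum
  have hmain : ‖(1 - z) * ∑ n ∈ range M,
      (((goldbachLambdaSum n) - ((n : ℝ) + 1) * (n + 2) / 2 : ℝ) : ℂ) * z ^ n‖ ≤
      ‖1 - z‖ * (1 + (C + 5 / 2) * (24 * (N : ℝ) ^ (3 - δ))) := by
    rw [norm_mul]
    refine mul_le_mul_of_nonneg_left ?_ (norm_nonneg _)
    refine (norm_sum_le _ _).trans ?_
    calc ∑ n ∈ range M, ‖(((goldbachLambdaSum n) - ((n : ℝ) + 1) * (n + 2) / 2 : ℝ) : ℂ) * z ^ n‖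
        ≤ ∑ n ∈ range M, ((if n = 0 then (1 : ℝ) else 0) + (C + 5 / 2) * (n : ℝ) ^ (2 - δ)) *
            radius N ^ n := by
          refine sum_le_sum fun n _ => ?_
          rw [norm_mul, norm_pow, hz, Complex.norm_real, Real.norm_eq_abs]
          exact mul_le_mul_of_nonneg_right (abs_S_sub_SV_le hδ1 hS n) (by positivity)
      _ = ∑ n ∈ range M, (if n = 0 then (1 : ℝ) else 0) * radius N ^ n +
            (C + 5 / 2) * ∑ n ∈ range M, (n : ℝ) ^ (2 - δ) * radius N ^ n := by
          rw [mul_sum, ← sum_add_distrib]; refine sum_congr rfl fun n _ => ?_; ring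
      _ ≤ 1 + (C + 5 / 2) * (24 * (N : ℝ) ^ ((2 - δ) + 1)) := by
          gcongr
          · simp_rw [boole_mul]
            rw [Finset.sum_ite_eq']
            split_ifs <;> simp
          · exact sum_rpow_mul_radius_pow_le hN (by linarith) (by linarith) _
      _ = 1 + (C + 5 / 2) * (24 * (N : ℝ) ^ (3 - δ)) := by
          rw [show (2 - δ + 1 : ℝ) = 3 - δ by ring]
  -- (2) the boundary term
  have hbdry : ‖(((goldbachLambdaSum M) - ((M : ℝ) + 1) * (M + 2) / 2 : ℝ) : ℂ) * z ^ M‖ ≤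
      (301 + 120 * C) / N := by
    rw [norm_mul, norm_pow, hz, Complex.norm_real, Real.norm_eq_abs]
    have hSM := abs_S_sub_SV_le hδ1 hS M
    rw [if_neg (by omega)] at hSM
    have hMpow : ((M : ℕ) : ℝ) ^ (2 - δ) ≤ ((M : ℕ) : ℝ) ^ 2 := by
      calc ((M : ℕ) : ℝ) ^ (2 - δ) ≤ ((M : ℕ) : ℝ) ^ (2 : ℝ) :=
            Real.rpow_le_rpow_of_exponent_le (by exact_mod_cast hM1) (by linarith)
        _ = ((M : ℕ) : ℝ) ^ 2 := by norm_num
    calc |goldbachLambdaSum M - ((M : ℝ) + 1) * (M + 2) / 2| * radius N ^ M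
        ≤ (0 + (C + 5 / 2) * ((M : ℕ) : ℝ) ^ 2) * Real.exp (-(N : ℝ)) := by
          refine mul_le_mul (hSM.trans (by gcongr)) hRM (by positivity) (by positivity)
      _ = (C + 5 / 2) * (Real.exp (-(N : ℝ)) * (N : ℝ) ^ 4) := by rw [hN4]; ring
      _ ≤ (C + 5 / 2) * (120 / N) := by gcongr
      _ ≤ (301 + 120 * C) / N := by
          rw [mul_div_assoc', div_le_div_iff_of_pos_right hNpos]; nlinarith
  -- (3) the tails
  have htailF : ‖∑ p ∈ (range (M + 1) ×ˢ range (M + 1)).filter (fun p : ℕ × ℕ => M < p.1 + p.2),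
      ((Λ p.1 : ℝ) : ℂ) * (Λ p.2 : ℝ) * z ^ (p.1 + p.2)‖ ≤ 120 * chebC ^ 2 / N := by
    refine (norm_sq_tail_le (fun n => Λ n) (fun n => ArithmeticFunction.vonMangoldt_nonneg) hz1 M).trans ?_
    rw [hz]
    have hψ := sum_range_vonMangoldt_le M
    have hψ0 : 0 ≤ ∑ n ∈ range (M + 1), Λ n := sum_nonneg fun n _ => ArithmeticFunction.vonMangoldt_nonneg
    calc radius N ^ (M + 1) * (∑ n ∈ range (M + 1), Λ n) ^ 2
        ≤ Real.exp (-(N : ℝ)) * (chebC * M) ^ 2 :=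
          mul_le_mul (hRM1.trans hRM) (pow_le_pow_left₀ hψ0 hψ 2) (by positivity) (by positivity)
      _ = chebC ^ 2 * (Real.exp (-(N : ℝ)) * (N : ℝ) ^ 4) := by rw [hN4]; ring
      _ ≤ chebC ^ 2 * (120 / N) := by gcongr
      _ = 120 * chebC ^ 2 / N := by ring
  have htailV : ‖∑ p ∈ (range (M + 1) ×ˢ range (M + 1)).filter (fun p : ℕ × ℕ => M < p.1 + p.2),
      ((1 : ℝ) : ℂ) * ((1 : ℝ) : ℂ) * z ^ (p.1 + p.2)‖ ≤ 480 / N := by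
    refine (norm_sq_tail_le (fun _ => (1 : ℝ)) (fun _ => zero_le_one) hz1 M).trans ?_
    rw [hz, sum_const, card_range, nsmul_eq_mul, mul_one]
    have hM2 : ((M + 1 : ℕ) : ℝ) ^ 2 ≤ 4 * ((M : ℕ) : ℝ) ^ 2 := by
      have h1M : (1 : ℝ) ≤ M := by exact_mod_cast hM1
      have : ((M + 1 : ℕ) : ℝ) ≤ 2 * M := by push_cast; linarith
      nlinarith
    calc radius N ^ (M + 1) * ((M + 1 : ℕ) : ℝ) ^ 2 ≤ Real.exp (-(N : ℝ)) * (4 * ((M : ℕ) : ℝ) ^ 2) :=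
          mul_le_mul (hRM1.trans hRM) hM2 (by positivity) (by positivity)
      _ = 4 * (Real.exp (-(N : ℝ)) * (N : ℝ) ^ 4) := by rw [hN4]; ring
      _ ≤ 4 * (120 / N) := by gcongr
      _ = 480 / N := by ring
  -- (4) combine
  have hsmall : (301 + 120 * C) / N + (120 * chebC ^ 2 / N + 480 / N) ≤
      (781 + 120 * C + 120 * chebC ^ 2) * ((N : ℝ) ^ (3 - δ) * ‖1 - z‖) := by
    have : (301 + 120 * C) / N + (120 * chebC ^ 2 / N + 480 / N) =
        (781 + 120 * C + 120 * chebC ^ 2) * (1 / N) := by ring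
    rw [this]
    refine mul_le_mul_of_nonneg_left ?_ (by positivity)
    calc 1 / (N : ℝ) ≤ ‖1 - z‖ := h1z
      _ = 1 * ‖1 - z‖ := (one_mul _).symm
      _ ≤ (N : ℝ) ^ (3 - δ) * ‖1 - z‖ := by gcongr
  calc ‖(1 - z) * ∑ n ∈ range M, (((goldbachLambdaSum n) - ((n : ℝ) + 1) * (n + 2) / 2 : ℝ) : ℂ) * z ^ n +
          (((goldbachLambdaSum M) - ((M : ℝ) + 1) * (M + 2) / 2 : ℝ) : ℂ) * z ^ M +
          (∑ p ∈ (range (M + 1) ×ˢ range (M + 1)).filter (fun p : ℕ × ℕ => M < p.1 + p.2),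
              ((Λ p.1 : ℝ) : ℂ) * (Λ p.2 : ℝ) * z ^ (p.1 + p.2) -
            ∑ p ∈ (range (M + 1) ×ˢ range (M + 1)).filter (fun p : ℕ × ℕ => M < p.1 + p.2),
              ((1 : ℝ) : ℂ) * ((1 : ℝ) : ℂ) * z ^ (p.1 + p.2))‖
      ≤ ‖1 - z‖ * (1 + (C + 5 / 2) * (24 * (N : ℝ) ^ (3 - δ))) + (301 + 120 * C) / N +
          (120 * chebC ^ 2 / N + 480 / N) := by
        refine (norm_add_le _ _).trans (add_le_add ((norm_add_le _ _).trans (add_le_add hmain hbdry)) ?_)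
        exact (norm_sub_le _ _).trans (add_le_add htailF htailV)
    _ ≤ ‖1 - z‖ * ((61 + 24 * C) * (N : ℝ) ^ (3 - δ)) +
          (781 + 120 * C + 120 * chebC ^ 2) * ((N : ℝ) ^ (3 - δ) * ‖1 - z‖) := by
        have hX : ‖1 - z‖ * (1 + (C + 5 / 2) * (24 * (N : ℝ) ^ (3 - δ))) ≤
            ‖1 - z‖ * ((61 + 24 * C) * (N : ℝ) ^ (3 - δ)) :=
          mul_le_mul_of_nonneg_left (by nlinarith [hpow1]) (norm_nonneg _)
        linarith [hX, hsmall]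
    _ = kappa C * (N : ℝ) ^ (3 - δ) * ‖1 - z‖ := by unfold kappa; ring

/-! ### Assembly: `ψ(N) − N ≪ N^{1−δ/6} (log N)^{1/2}` -/

/-- `e(x − 1) = e(x)`. [folklore] -/
theorem e_sub_one (x : ℝ) : e (x - 1) = e x := by
  rw [sub_eq_add_neg, e_add]
  have : e (-1) = 1 := by
    have h := Literature.NumberTheory.Sieve.RamanujanSum.fourierChar_intCast (-1)
    unfold e; exact_mod_cast h
  simp [this]

/-- `∑_{1 ≤ n ≤ N} (Λ(n) − 1) = ψ(N) − N`. [folklore] -/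
theorem sum_Icc_vonMangoldt_sub_one (N : ℕ) :
    ∑ n ∈ Icc 1 N, (Λ n - 1) = ψ (N : ℝ) - N := by
  have hI : Icc 1 N = Ioc 0 N := by ext n; simp only [mem_Icc, mem_Ioc]; omega
  rw [sum_sub_distrib, sum_const, Nat.card_Icc, nsmul_eq_mul, mul_one, Chebyshev.psi,
    Nat.floor_natCast, hI]
  push_cast; ring

/-- The mean-square constant `C_ms = 252 c₀ + 3`. [folklore] -/
def Cms : ℝ := 252 * chebC + 3

/-- `C_ms > 0`. [folklore] -/
theorem Cms_pos : 0 < Cms := by unfold Cms; linarith [chebC_pos]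

/-- Parameter algebra: `B η³ = 1/(64κ²)` for `B = κN³/v⁶`, `η = v²/(4κN)`. [folklore] -/
theorem param_cube {κ v N : ℝ} (hκ : 0 < κ) (hv : 0 < v) (hN : 0 < N) :
    κ * N ^ 3 / v ^ 6 * (v ^ 2 / (4 * κ * N)) ^ 3 = 1 / (64 * κ ^ 2) := by
  field_simp; ring

/-- Parameter algebra: `2/N² ≤ η²` once `v² ≥ 6κ`. [folklore] -/
theorem param_sq {κ v N : ℝ} (hκ : 0 < κ) (hv2κ : 6 * κ ≤ v ^ 2) (hN : 0 < N) :
    2 * (1 / N) ^ 2 ≤ (v ^ 2 / (4 * κ * N)) ^ 2 := by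
  rw [div_pow, div_pow, one_pow, show (2 : ℝ) * (1 / N ^ 2) = 2 / N ^ 2 by ring,
    div_le_div_iff₀ (by positivity) (by positivity)]
  have h6 : (6 * κ) ^ 2 ≤ (v ^ 2) ^ 2 := pow_le_pow_left₀ (by positivity) hv2κ 2
  have hN2 : 0 ≤ N ^ 2 := sq_nonneg _
  calc 2 * (4 * κ * N) ^ 2 = 32 * κ ^ 2 * N ^ 2 := by ring
    _ ≤ (6 * κ) ^ 2 * N ^ 2 := by nlinarith only [hN2, sq_nonneg κ]
    _ ≤ (v ^ 2) ^ 2 * N ^ 2 := mul_le_mul_of_nonneg_right h6 hN2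

/-- Parameter algebra: `η N² ≥ 10` once `v² ≥ 6κ`, `N ≥ 40κ`, `κ ≥ 842`. [folklore] -/
theorem param_ten {κ v N : ℝ} (hκ : 842 ≤ κ) (hv2κ : 6 * κ ≤ v ^ 2) (hN40 : 40 * κ ≤ N) :
    10 ≤ v ^ 2 / (4 * κ * N) * N ^ 2 := by
  have hκ0 : 0 < κ := by linarith
  have hN : 0 < N := by nlinarith only [hκ, hN40]
  have : v ^ 2 / (4 * κ * N) * N ^ 2 = v ^ 2 * N / (4 * κ) := by
    field_simp
  rw [this, le_div_iff₀ (by positivity)]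
  have h' : (6 * κ) * (40 * κ) ≤ v ^ 2 * N := mul_le_mul hv2κ hN40 (by positivity) (by positivity)
  nlinarith only [h', hκ]

/-- Final algebra for the major arc: `9Bη(ηL + 2) ≤ L N/v` with `B = κN³/v⁶`, `η = v²/(4κN)`,
given `ηL ≥ 10`, `κ ≥ 842`, `v ≥ 1`. [folklore] -/
theorem final_major {κ v N L : ℝ} (hκ : 842 ≤ κ) (hv1 : 1 ≤ v) (hN : 0 < N) (hL : 0 < L)
    (hηL : 10 ≤ v ^ 2 / (4 * κ * N) * L) :
    9 * (κ * N ^ 3 / v ^ 6) * (v ^ 2 / (4 * κ * N)) * (v ^ 2 / (4 * κ * N) * L + 2) ≤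
      L * (N / v) := by
  have hκ0 : 0 < κ := by linarith
  have hv : 0 < v := by linarith
  set η : ℝ := v ^ 2 / (4 * κ * N) with hη
  have hη0 : 0 < η := by positivity
  have h1 : η * L + 2 ≤ 6 / 5 * (η * L) := by linarith
  have hBη2 : (κ * N ^ 3 / v ^ 6) * η * η = N / (16 * κ * v ^ 2) := by
    rw [hη]; field_simp; ring
  calc 9 * (κ * N ^ 3 / v ^ 6) * η * (η * L + 2)
      ≤ 9 * (κ * N ^ 3 / v ^ 6) * η * (6 / 5 * (η * L)) := by gcongr
    _ = 54 / 5 * ((κ * N ^ 3 / v ^ 6) * η * η) * L := by ring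
    _ = 54 / 5 * (N / (16 * κ * v ^ 2)) * L := by rw [hBη2]
    _ = L * (N / v) * (27 / (40 * κ * v)) := by field_simp; ring
    _ ≤ L * (N / v) * 1 := by
        refine mul_le_mul_of_nonneg_left ?_ (by positivity)
        rw [div_le_one (by positivity)]; nlinarith
    _ = L * (N / v) := mul_one _

/-- Final algebra for the minor arc:
`(L X) · (81 L²/μ) = (L · 9√(40κC) · (N/v) · √(log N))²` with `X = C N log N`, `μ = ηL/10`,
`η = v²/(4κN)`. [folklore] -/
theorem final_minor_sq {κ v N L Cm lg : ℝ} (hκ : 0 < κ) (hv : 0 < v) (hN : 0 < N) (hL : 0 < L)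
    (hCm : 0 ≤ Cm) (hlg : 0 ≤ lg) :
    (L * (Cm * N * lg)) * (81 * (L ^ 2 / (v ^ 2 / (4 * κ * N) * L / 10))) =
      (L * (9 * Real.sqrt (40 * κ * Cm) * (N / v) * Real.sqrt lg)) ^ 2 := by
  have h1 : Real.sqrt (40 * κ * Cm) ^ 2 = 40 * κ * Cm := Real.sq_sqrt (by positivity)
  have h2 : Real.sqrt lg ^ 2 = lg := Real.sq_sqrt hlg
  rw [mul_pow, mul_pow, mul_pow, mul_pow, h1, h2]
  field_simp
  ring

/-- **Bhowmik–Ruzsa, proof of Theorem 2.1, made explicit.** If `|S(n) − n²/2| ≤ C n^{2−δ}` for all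
`n ≥ 1` (`0 < δ ≤ 1`), then for all large `N`,
`|ψ(N) − N| ≤ (1 + 9 √(40 κ C_ms)) N^{1−δ/6} (log N)^{1/2}`.
[cite: BhowmikRuzsa2018, proof of Theorem 2.1] -/
theorem abs_psi_sub_le {C δ : ℝ} (hC : 0 ≤ C) (hδ0 : 0 < δ) (hδ1 : δ ≤ 1)
    (hS : ∀ n : ℕ, 1 ≤ n → |goldbachLambdaSum n - (n : ℝ) ^ 2 / 2| ≤ C * (n : ℝ) ^ (2 - δ))
    {N : ℕ} (hN11 : 11 ≤ N) (hN40 : 40 * kappa C ≤ N) (hNpow : 6 * kappa C ≤ (N : ℝ) ^ (δ / 3)) :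
    |ψ (N : ℝ) - N| ≤
      (1 + 9 * Real.sqrt (40 * kappa C * Cms)) * (N : ℝ) ^ (1 - δ / 6) * Real.sqrt (Real.log N) := by
  -- basic quantities
  have hN2 : 2 ≤ N := by omega
  have hN3 : 3 ≤ N := by omega
  have hNpos : (0 : ℝ) < N := by exact_mod_cast (show 0 < N by omega)
  have hN1 : (1 : ℝ) ≤ N := by exact_mod_cast (show 1 ≤ N by omega)
  set κ : ℝ := kappa C with hκ
  have hκ842 : 842 ≤ κ := kappa_ge C hC
  have hκpos : 0 < κ := by linarith
  set R : ℝ := radius N with hRdef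
  have hR0 : 0 < R := radius_pos hN2
  have hR1 : R < 1 := radius_lt_one hN2
  have hR4 : 1 / 4 ≤ R := by
    have h2N : (2 : ℝ) ≤ N := by exact_mod_cast hN2
    have : 1 / (N : ℝ) ≤ 1 / 2 := div_le_div_of_nonneg_left (by norm_num) (by norm_num) h2N
    rw [hRdef, radius]; linarith
  set M : ℕ := N ^ 2 with hMdef
  set L : ℕ := N ^ 2 + 1 with hLdef
  have hL : 0 < L := by positivity
  have hLr : (0 : ℝ) < L := by exact_mod_cast hL
  have hML : M < L := by omega
  have hNM : N ≤ M := by rw [hMdef]; nlinarith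
  have hLN2 : ((N : ℝ)) ^ 2 ≤ L := by rw [hLdef]; push_cast; linarith
  have hLle : (L : ℝ) ≤ 2 * (N : ℝ) ^ 2 := by rw [hLdef]; push_cast; nlinarith
  -- atoms for the powers of `N`: `v = N^{δ/6}`
  set v : ℝ := (N : ℝ) ^ (δ / 6) with hvdef
  have hv : 0 < v := Real.rpow_pos_of_pos hNpos _
  have hv1 : 1 ≤ v := Real.one_le_rpow hN1 (by positivity)
  have hv2 : v ^ 2 = (N : ℝ) ^ (δ / 3) := by
    rw [hvdef, ← Real.rpow_natCast, ← Real.rpow_mul hNpos.le]; congr 1; push_cast; ring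
  have hv6 : v ^ 6 = (N : ℝ) ^ δ := by
    rw [hvdef, ← Real.rpow_natCast, ← Real.rpow_mul hNpos.le]; congr 1; push_cast; ring
  have hN3pow : (N : ℝ) ^ (3 : ℝ) = (N : ℝ) ^ (3 : ℕ) := by
    rw [← Real.rpow_natCast]; norm_num
  have h36 : (N : ℝ) ^ (3 - δ) = (N : ℝ) ^ 3 / v ^ 6 := by
    rw [Real.rpow_sub hNpos, hN3pow, hv6]
  have h31 : (N : ℝ) ^ (δ / 3 - 1) = v ^ 2 / N := by
    rw [Real.rpow_sub hNpos, Real.rpow_one, hv2]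
  have h13 : (N : ℝ) ^ (1 - δ / 3) = N / v ^ 2 := by
    rw [Real.rpow_sub hNpos, Real.rpow_one, hv2]
  have h16 : (N : ℝ) ^ (1 - δ / 6) = N / v := by
    rw [Real.rpow_sub hNpos, Real.rpow_one, hvdef]
  have hv2κ : 6 * κ ≤ v ^ 2 := by rw [hv2]; exact hNpow
  have hvN : v ^ 2 ≤ N := by
    rw [hv2]
    calc (N : ℝ) ^ (δ / 3) ≤ (N : ℝ) ^ (1 : ℝ) := Real.rpow_le_rpow_of_exponent_le hN1 (by linarith)
      _ = N := Real.rpow_one _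
  -- parameters
  set B : ℝ := κ * (N : ℝ) ^ (3 - δ) with hBdef
  have hB' : B = κ * (N : ℝ) ^ 3 / v ^ 6 := by rw [hBdef, h36]; ring
  have hB0 : 0 ≤ B := by positivity
  set η : ℝ := v ^ 2 / (4 * κ * N) with hηdef
  have hη0 : 0 < η := by positivity
  set A : ℝ := R⁻¹ ^ N + 1 with hAdef
  have hA9 : A ≤ 9 := by have := inv_radius_pow_le hN2; rw [hAdef]; linarith
  have hA0 : 0 ≤ A := by positivity
  -- `B η³ ≤ 1/4`, `2(1-R)² ≤ η²`, `η L ≥ 10`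
  have hBη3 : B * η ^ 3 ≤ 1 / 4 := by
    rw [hB', hηdef, param_cube hκpos hv hNpos, div_le_div_iff₀ (by positivity) (by norm_num)]
    nlinarith only [hκ842]
  have hηR : 2 * (1 - R) ^ 2 ≤ η ^ 2 := by
    rw [hRdef, one_sub_radius, hηdef]; exact param_sq hκpos hv2κ hNpos
  have hηL : 10 ≤ η * L := by
    have h1 : η * (N : ℝ) ^ 2 ≤ η * L := mul_le_mul_of_nonneg_left hLN2 hη0.le
    have h2 : 10 ≤ η * (N : ℝ) ^ 2 := by rw [hηdef]; exact param_ten hκ842 hv2κ hN40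
    linarith only [h1, h2]
  set μ : ℝ := η * L / 10 with hμdef
  have hμ1 : 1 ≤ μ := by rw [hμdef]; linarith only [hηL]
  -- the sample values
  set Dj : ℕ → ℂ := fun j => Dpoly M (zpt R L j) with hDj
  -- (F1) extraction: `∑_j D_j K_j = L (ψ N - N)`
  have hext : ∑ j ∈ range L, Dj j * kern R L N j = (L : ℂ) * ((ψ (N : ℝ) - N : ℝ) : ℂ) := by
    have h := extraction_zpt (fun n => ((Λ n - 1 : ℝ) : ℂ)) hR0.ne' hML hNM (L := L)
    rw [← Complex.ofReal_sum, sum_Icc_vonMangoldt_sub_one] at h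
    exact h
  -- (F2) `|ψ N - N| L ≤ ∑_j ‖D_j‖ ‖K_j‖`
  have hF2 : |ψ (N : ℝ) - N| * L ≤ ∑ j ∈ range L, ‖Dj j‖ * ‖kern R L N j‖ := by
    have h1 : ‖(L : ℂ) * ((ψ (N : ℝ) - N : ℝ) : ℂ)‖ = |ψ (N : ℝ) - N| * L := by
      rw [norm_mul, Complex.norm_natCast, Complex.norm_real, Real.norm_eq_abs, mul_comm]
    rw [← h1, ← hext]
    refine (norm_sum_le _ _).trans (sum_le_sum fun j _ => ?_)
    rw [norm_mul]
  -- (F3) the `W`-bound on the circle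
  have hW : ∀ y : ℝ, ‖1 - (R : ℂ) * e y‖ ≤ η →
      ‖Fpoly M ((R : ℂ) * e y) ^ 2 - Vpoly M ((R : ℂ) * e y) ^ 2‖ ≤ B * ‖1 - (R : ℂ) * e y‖ := by
    intro y _
    have hz : ‖(R : ℂ) * e y‖ = radius N := by
      rw [norm_mul, Complex.norm_real, Real.norm_of_nonneg hR0.le, norm_e, mul_one]
    exact W_bound hC hδ0 hδ1 hS hN2 hz
  -- (F5) `R^{M+1} ≤ 1/16`
  have htail : R ^ (M + 1) ≤ 1 / 16 := by
    have h16 : (16 : ℝ) ≤ Real.exp 3 := by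
      have he : (2.7 : ℝ) < Real.exp 1 := lt_trans (by norm_num) Real.exp_one_gt_d9
      have h3 : Real.exp 3 = Real.exp 1 ^ 3 := by rw [← Real.exp_nat_mul]; norm_num
      rw [h3]
      calc (16 : ℝ) ≤ 2.7 ^ 3 := by norm_num
        _ ≤ Real.exp 1 ^ 3 := pow_le_pow_left₀ (by norm_num) he.le 3
    have hN3r : (3 : ℝ) ≤ N := by exact_mod_cast hN3
    calc R ^ (M + 1) ≤ R ^ M := pow_le_pow_of_le_one hR0.le hR1.le (by omega)
      _ ≤ Real.exp (-(N : ℝ)) := radius_pow_sq_le hN2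
      _ ≤ Real.exp (-3) := Real.exp_le_exp.mpr (by linarith only [hN3r])
      _ ≤ 1 / 16 := by rw [Real.exp_neg, one_div]; exact inv_anti₀ (by norm_num) h16
  -- (F6) `‖D_j‖ ≤ B ‖1 - z_j‖²` on the major arc
  have hDmajor : ∀ j ∈ range L, ‖1 - (R : ℂ) * e ((j : ℝ) / L)‖ ≤ η →
      ‖Dj j‖ ≤ B * ‖1 - (R : ℂ) * e ((j : ℝ) / L)‖ ^ 2 := by
    intro j hj hmaj
    obtain ⟨x, hxabs, hxe⟩ : ∃ x : ℝ, |x| ≤ 1 / 2 ∧ e x = e ((j : ℝ) / L) := by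
      have hjL : (j : ℝ) < L := by exact_mod_cast (mem_range.mp hj)
      by_cases h2 : 2 * j ≤ L
      · refine ⟨(j : ℝ) / L, ?_, rfl⟩
        have h2r : (2 : ℝ) * j ≤ L := by exact_mod_cast h2
        rw [abs_of_nonneg (by positivity), div_le_iff₀ hLr]
        linarith only [h2r]
      · refine ⟨(j : ℝ) / L - 1, ?_, e_sub_one _⟩
        have h2r : (L : ℝ) < 2 * j := by exact_mod_cast (not_le.mp h2)
        have hlo : 1 / 2 ≤ (j : ℝ) / L := by rw [le_div_iff₀ hLr]; linarith only [h2r]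
        have hhi : (j : ℝ) / L ≤ 1 := by rw [div_le_one hLr]; linarith only [hjL]
        rw [abs_le]; constructor <;> linarith only [hlo, hhi]
    have hzj : zpt R L j = (R : ℂ) * e x := by unfold zpt; rw [hxe]
    have hmaj' : ‖1 - (R : ℂ) * e x‖ ≤ η := by rwa [hxe]
    have key := major_arc_pointwise (M := M) hR0 hR1 hB0 hBη3 htail hW hxabs hmaj'
    rw [hxe] at key
    simp only [hDj]; rw [hzj, hxe]; exact key
  -- (F7) the major arc
  set T := (range L).filter (fun j : ℕ => ‖1 - (R : ℂ) * e ((j : ℝ) / L)‖ ≤ η) with hTdef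
  have hmajor : ∑ j ∈ T, ‖Dj j‖ * ‖kern R L N j‖ ≤ B * A * η * (η * L + 2) :=
    major_sum_le hL hR0 hR4 hR1 hη0.le hB0 Dj hDmajor
  have hmajor' : ∑ j ∈ T, ‖Dj j‖ * ‖kern R L N j‖ ≤ L * (N / v) := by
    refine hmajor.trans ?_
    have h9 : B * A * η * (η * L + 2) ≤ 9 * B * η * (η * L + 2) := by
      have : 0 ≤ B * η * (η * L + 2) := by positivity
      nlinarith only [hA9, this]
    refine h9.trans ?_
    rw [hB', hηdef]
    have hηL' : 10 ≤ v ^ 2 / (4 * κ * N) * L := by rw [← hηdef]; exact hηL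
    exact final_major hκ842 hv1 hNpos hLr hηL'
  -- (F8) the minor arc: kernel mean square
  set S := (range L).filter (fun j : ℕ => ¬ ‖1 - (R : ℂ) * e ((j : ℝ) / L)‖ ≤ η) with hSdef
  have hsplit : ∑ j ∈ range L, ‖Dj j‖ * ‖kern R L N j‖ =
      ∑ j ∈ T, ‖Dj j‖ * ‖kern R L N j‖ + ∑ j ∈ S, ‖Dj j‖ * ‖kern R L N j‖ :=
    (sum_filter_add_sum_filter_not _ _ _).symm
  have hSL : ∀ j ∈ S, j < L := fun j hj => mem_range.mp (mem_filter.mp hj).1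
  have hμS : ∀ j ∈ S, μ ≤ ((min j (L - j) : ℕ) : ℝ) := by
    intro j hj
    obtain ⟨hjr, hnot⟩ := mem_filter.mp hj
    exact min_ge_of_minor hL (mem_range.mp hjr).le hR1.le hη0.le hηR (not_le.mp hnot)
  have hKS : ∑ j ∈ S, ‖kern R L N j‖ ^ 2 ≤ A ^ 2 * (L : ℝ) ^ 2 / μ :=
    minor_kernel_sq_sum hL hR0 hR4 hR1 hμ1 S hSL hμS
  have hKS' : ∑ j ∈ S, ‖kern R L N j‖ ^ 2 ≤ 81 * ((L : ℝ) ^ 2 / μ) := by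
    refine hKS.trans ?_
    rw [mul_div_assoc]
    refine mul_le_mul_of_nonneg_right ?_ (by positivity)
    nlinarith only [hA9, hA0]
  -- (F9) Parseval and the mean square
  have hpars : ∑ j ∈ range L, ‖Dj j‖ ^ 2 =
      L * ∑ n ∈ range (M + 1), (Λ n - 1) ^ 2 * R ^ (2 * n) :=
    parseval_zpt (fun n => Λ n - 1) R hML
  have hms : ∑ n ∈ range (M + 1), (Λ n - 1) ^ 2 * R ^ (2 * n) ≤ Cms * N * Real.log N :=
    meanSquare_le hN3
  have hlog0 : 0 ≤ Real.log N := Real.log_nonneg hN1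
  have hDsum : ∑ j ∈ S, ‖Dj j‖ ^ 2 ≤ L * (Cms * N * Real.log N) := by
    calc ∑ j ∈ S, ‖Dj j‖ ^ 2 ≤ ∑ j ∈ range L, ‖Dj j‖ ^ 2 :=
          sum_le_sum_of_subset_of_nonneg (filter_subset _ _) fun j _ _ => by positivity
      _ = L * ∑ n ∈ range (M + 1), (Λ n - 1) ^ 2 * R ^ (2 * n) := hpars
      _ ≤ L * (Cms * N * Real.log N) := by gcongr
  -- (F10) Cauchy–Schwarz on the minor arc
  have hminor : ∑ j ∈ S, ‖Dj j‖ * ‖kern R L N j‖ ≤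
      L * (9 * Real.sqrt (40 * κ * Cms) * (N / v) * Real.sqrt (Real.log N)) := by
    have hCS := sum_mul_sq_le_sq_mul_sq S (fun j => ‖Dj j‖) (fun j => ‖kern R L N j‖)
    have hsq : (∑ j ∈ S, ‖Dj j‖ * ‖kern R L N j‖) ^ 2 ≤
        (L * (9 * Real.sqrt (40 * κ * Cms) * (N / v) * Real.sqrt (Real.log N))) ^ 2 := by
      calc (∑ j ∈ S, ‖Dj j‖ * ‖kern R L N j‖) ^ 2
          ≤ (∑ j ∈ S, ‖Dj j‖ ^ 2) * ∑ j ∈ S, ‖kern R L N j‖ ^ 2 := hCS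
        _ ≤ (L * (Cms * N * Real.log N)) * (81 * ((L : ℝ) ^ 2 / μ)) :=
            mul_le_mul hDsum hKS' (sum_nonneg fun j _ => by positivity)
              (mul_nonneg hLr.le (mul_nonneg (mul_nonneg Cms_pos.le hNpos.le) hlog0))
        _ = (L * (Cms * N * Real.log N)) * (81 * ((L : ℝ) ^ 2 / (v ^ 2 / (4 * κ * N) * L / 10))) := by
            rw [hμdef, hηdef]
        _ = (L * (9 * Real.sqrt (40 * κ * Cms) * (N / v) * Real.sqrt (Real.log N))) ^ 2 :=
            final_minor_sq hκpos hv hNpos hLr Cms_pos.le hlog0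
    exact le_of_pow_le_pow_left₀ two_ne_zero (by positivity) hsq
  -- (F11) combine
  have hlog1 : 1 ≤ Real.log N := by
    rw [Real.le_log_iff_exp_le hNpos]
    have h3 : (3 : ℝ) ≤ N := by exact_mod_cast hN3
    linarith only [h3, Real.exp_one_lt_d9]
  have hsqrt1 : 1 ≤ Real.sqrt (Real.log N) := Real.one_le_sqrt.mpr hlog1
  have hNv : 0 ≤ (N : ℝ) / v := by positivity
  have htotal : |ψ (N : ℝ) - N| * L ≤
      L * ((1 + 9 * Real.sqrt (40 * κ * Cms)) * (N / v) * Real.sqrt (Real.log N)) := by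
    have h1 : (N : ℝ) / v ≤ (N / v) * Real.sqrt (Real.log N) := by
      calc (N : ℝ) / v = (N / v) * 1 := (mul_one _).symm
        _ ≤ (N / v) * Real.sqrt (Real.log N) := by gcongr
    calc |ψ (N : ℝ) - N| * L ≤ ∑ j ∈ range L, ‖Dj j‖ * ‖kern R L N j‖ := hF2
      _ = ∑ j ∈ T, ‖Dj j‖ * ‖kern R L N j‖ + ∑ j ∈ S, ‖Dj j‖ * ‖kern R L N j‖ := hsplit
      _ ≤ L * (N / v) + L * (9 * Real.sqrt (40 * κ * Cms) * (N / v) * Real.sqrt (Real.log N)) :=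
          add_le_add hmajor' hminor
      _ ≤ L * ((N / v) * Real.sqrt (Real.log N)) +
            L * (9 * Real.sqrt (40 * κ * Cms) * (N / v) * Real.sqrt (Real.log N)) := by gcongr
      _ = L * ((1 + 9 * Real.sqrt (40 * κ * Cms)) * (N / v) * Real.sqrt (Real.log N)) := by ring
  rw [h16]
  have := le_of_mul_le_mul_right (htotal.trans_eq (mul_comm _ _)) hLr
  exact this


/-! ### From the explicit bound to the named fact -/

/-- A power saving along `atTop` gives a uniform constant for all `n ≥ 1`. [folklore] -/
theorem uniform_of_powerSaving {δ : ℝ} (hδ1 : δ ≤ 1) (h : PowerSavingGoldbachAverage δ) :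
    ∃ C : ℝ, 0 ≤ C ∧ ∀ n : ℕ, 1 ≤ n →
      |goldbachLambdaSum n - (n : ℝ) ^ 2 / 2| ≤ C * (n : ℝ) ^ (2 - δ) := by
  obtain ⟨c, hc⟩ := h.bound
  rw [Filter.eventually_atTop] at hc
  obtain ⟨n₀, hn₀⟩ := hc
  set C₁ : ℝ := ∑ k ∈ range n₀, |goldbachLambdaSum k - (k : ℝ) ^ 2 / 2| with hC₁
  have hC₁0 : 0 ≤ C₁ := sum_nonneg fun k _ => abs_nonneg _
  refine ⟨max c 0 + C₁, by positivity, fun n hn => ?_⟩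
  have hn1 : (1 : ℝ) ≤ n := by exact_mod_cast hn
  have hpow1 : (1 : ℝ) ≤ (n : ℝ) ^ (2 - δ) := Real.one_le_rpow hn1 (by linarith)
  have hpow0 : (0 : ℝ) ≤ (n : ℝ) ^ (2 - δ) := by positivity
  rcases le_or_gt n₀ n with h0 | h0
  · have hb := hn₀ n h0
    rw [Real.norm_eq_abs, Real.norm_of_nonneg hpow0] at hb
    calc |goldbachLambdaSum n - (n : ℝ) ^ 2 / 2| ≤ c * (n : ℝ) ^ (2 - δ) := hb
      _ ≤ (max c 0 + C₁) * (n : ℝ) ^ (2 - δ) := by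
          gcongr; linarith [le_max_left c 0]
  · have hle : |goldbachLambdaSum n - (n : ℝ) ^ 2 / 2| ≤ C₁ := by
      rw [hC₁]
      exact single_le_sum (f := fun k => |goldbachLambdaSum k - (k : ℝ) ^ 2 / 2|)
        (fun k _ => abs_nonneg _) (mem_range.mpr h0)
    calc |goldbachLambdaSum n - (n : ℝ) ^ 2 / 2| ≤ C₁ := hle
      _ = C₁ * 1 := (mul_one _).symm
      _ ≤ (max c 0 + C₁) * (n : ℝ) ^ (2 - δ) := by
          gcongr; linarith [le_max_right c 0]

end BhowmikRuzsa

/-- **The named fact `BhowmikRuzsa2018_psiBound`, PROVED** (the power-series/kernel step of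
Bhowmik–Ruzsa's proof of Theorem 2.1, discretised as described above): for `0 < δ ≤ 1`,
`S(x) = x²/2 + O(x^{2−δ})` implies `ψ(N) − N = O(N^{1−δ/6}(log N)^{1/2})`.
[cite: BhowmikRuzsa2018, proof of Theorem 2.1] -/
theorem BhowmikRuzsa2018_psiBound_holds : BhowmikRuzsa2018_psiBound := by
  intro δ hδ0 hδ1 hS
  obtain ⟨C, hC, hSC⟩ := BhowmikRuzsa.uniform_of_powerSaving hδ1 hS
  set κ : ℝ := BhowmikRuzsa.kappa C with hκ
  have hκ842 : 842 ≤ κ := BhowmikRuzsa.kappa_ge C hC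
  have hκ0 : 0 < κ := by linarith
  set t : ℝ := (6 * κ) ^ (3 / δ) with ht
  have ht0 : 0 ≤ t := by positivity
  set N₀ : ℕ := max 11 (max ⌈40 * κ⌉₊ ⌈t⌉₊) with hN₀
  refine IsBigO.of_bound (1 + 9 * Real.sqrt (40 * κ * BhowmikRuzsa.Cms)) ?_
  rw [Filter.eventually_atTop]
  refine ⟨N₀, fun N hN => ?_⟩
  have hN11 : 11 ≤ N := le_trans (le_max_left _ _) hN
  have hNr : (N₀ : ℝ) ≤ N := by exact_mod_cast hN
  have hN40 : 40 * κ ≤ N := by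
    calc 40 * κ ≤ ⌈40 * κ⌉₊ := Nat.le_ceil _
      _ ≤ (N₀ : ℝ) := by rw [hN₀]; exact_mod_cast (le_max_left _ _).trans (le_max_right _ _)
      _ ≤ N := hNr
  have hNt : t ≤ N := by
    calc t ≤ ⌈t⌉₊ := Nat.le_ceil _
      _ ≤ (N₀ : ℝ) := by rw [hN₀]; exact_mod_cast (le_max_right _ _).trans (le_max_right _ _)
      _ ≤ N := hNr
  have hNpow : 6 * κ ≤ (N : ℝ) ^ (δ / 3) := by
    calc 6 * κ = t ^ (δ / 3) := by
          rw [ht, ← Real.rpow_mul (by positivity)]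
          rw [show (3 / δ * (δ / 3) : ℝ) = 1 by field_simp, Real.rpow_one]
      _ ≤ (N : ℝ) ^ (δ / 3) := Real.rpow_le_rpow ht0 hNt (by positivity)
  have hmain := BhowmikRuzsa.abs_psi_sub_le hC hδ0 hδ1 hSC hN11 hN40 hNpow
  have hNpos : (0 : ℝ) < N := by exact_mod_cast (show 0 < N by omega)
  rw [Real.norm_eq_abs, Real.norm_of_nonneg (by positivity)]
  simpa [mul_assoc] using hmain

/-- **The record `GoldbachAverageZeros` (Bhowmik–Ruzsa 2018, Theorem 2.1), PROVED.**
[cite: BhowmikRuzsa2018, Theorem 2.1] [cite: MontgomeryVaughan2007, §15.1] -/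
theorem GoldbachAverageZeros_holds : GoldbachAverageZeros :=
  goldbachAverageZeros_of_psiBound BhowmikRuzsa2018_psiBound_holds

/-! ## The technique class is empty for `δ > 1` (barrier audit 2026-08-16, `scope_caveats` (a))

`PowerSavingGoldbachAverage δ` quantifies over all `δ > 0`, but along the integers it can only hold
for `δ ≤ 1`: at an odd `x` the only pairs `k + m = x` with `Λ(k)Λ(m) ≠ 0` contain a power of two,
so `G(x) ≤ 4 log³x + 2 log²x`, while `x²/2 − (x−1)²/2 = x − 1/2`; hence `S(x) − x²/2` jumps by
`x + O(log³x)` between `x − 1` and `x`, which two consecutive errors `O(x^{2−δ}) = o(x)` cannot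
absorb. So the record `GoldbachAverageZeros` carries content exactly on `0 < δ ≤ 1`, where its
hypothesis is the printed one (`scope_caveats` (e)); the live range is in fact `0 < δ ≤ 1/2`
(sibling entry `GoldbachAverageZerosNarrow`, file `GoldbachAverageZerosNarrow.lean`).
-/

namespace PowerSavingVacuity

/-- An even prime power is a power of two. [folklore] -/
theorem exists_eq_two_pow_of_even_of_isPrimePow {k : ℕ} (hk : Even k) (hp : IsPrimePow k) :
    ∃ a : ℕ, k = 2 ^ a := by
  obtain ⟨p, a, hprime, -, rfl⟩ := (isPrimePow_nat_iff _).1 hp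
  have h2 : 2 ∣ p := Nat.Prime.dvd_of_dvd_pow Nat.prime_two (even_iff_two_dvd.1 hk)
  have hp2 : p = 2 := ((Nat.prime_dvd_prime_iff_eq Nat.prime_two hprime).1 h2).symm
  exact ⟨a, by rw [hp2]⟩

/-- The powers of two up to `n` (with `2⁰ = 1` included). [folklore] -/
def powTwoUpTo (n : ℕ) : Finset ℕ := (range (Nat.log 2 n + 1)).image fun a ↦ 2 ^ a

/-- `#{2^a ≤ n} ≤ log₂ n + 1`. [folklore] -/
theorem card_powTwoUpTo_le (n : ℕ) : (powTwoUpTo n).card ≤ Nat.log 2 n + 1 :=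
  card_image_le.trans (by rw [card_range])

/-- An even `k ≤ n` with `Λ(k) ≠ 0` is one of the powers of two up to `n`. [folklore] -/
theorem mem_powTwoUpTo {n k : ℕ} (hkn : k ≤ n) (hk : Even k) (hΛ : Λ k ≠ 0) :
    k ∈ powTwoUpTo n := by
  obtain ⟨a, rfl⟩ := exists_eq_two_pow_of_even_of_isPrimePow hk
    (ArithmeticFunction.vonMangoldt_ne_zero_iff.1 hΛ)
  rw [powTwoUpTo, mem_image]
  exact ⟨a, mem_range.2 (Nat.lt_succ_of_le (Nat.le_log_of_pow_le one_lt_two hkn)), rfl⟩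

/-- Termwise bound on the antidiagonal of an odd `n`: `Λ(k)Λ(m) ≤ (log n)² (𝟙[k ∈ W] + 𝟙[m ∈ W])`
with `W` the powers of two up to `n` (one of `k`, `m` is even, hence a power of two if both are
prime powers). [folklore] -/
theorem term_le {n : ℕ} (hn : Odd n) {km : ℕ × ℕ} (hkm : km ∈ antidiagonal n) :
    Λ km.1 * Λ km.2 ≤ Real.log n ^ 2 *
      ((if km.1 ∈ powTwoUpTo n then 1 else 0) + (if km.2 ∈ powTwoUpTo n then 1 else 0)) := by
  rw [HasAntidiagonal.mem_antidiagonal] at hkm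
  by_cases h1 : Λ km.1 = 0
  · rw [h1, zero_mul]; positivity
  by_cases h2 : Λ km.2 = 0
  · rw [h2, mul_zero]; positivity
  have hk1 : km.1 ≤ n := by omega
  have hk2 : km.2 ≤ n := by omega
  have hone : (1 : ℝ) ≤
      (if km.1 ∈ powTwoUpTo n then 1 else 0) + (if km.2 ∈ powTwoUpTo n then 1 else 0) := by
    have hi1 : (0 : ℝ) ≤ (if km.1 ∈ powTwoUpTo n then 1 else 0) := by positivity
    have hi2 : (0 : ℝ) ≤ (if km.2 ∈ powTwoUpTo n then 1 else 0) := by positivity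
    rcases Nat.even_or_odd km.1 with he | ho
    · rw [if_pos (mem_powTwoUpTo hk1 he h1)]
      linarith
    · have hn' : Odd (km.1 + km.2) := by rw [hkm]; exact hn
      have he2 : Even km.2 := (Nat.odd_add.1 hn').1 ho
      rw [if_pos (mem_powTwoUpTo hk2 he2 h2)]
      linarith
  have hlogn : 0 ≤ Real.log n := Real.log_natCast_nonneg n
  have hpos1 : 0 < km.1 := Nat.pos_of_ne_zero fun h ↦ h1 (by rw [h]; simp)
  have hpos2 : 0 < km.2 := Nat.pos_of_ne_zero fun h ↦ h2 (by rw [h]; simp)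
  have hb1 : Λ km.1 ≤ Real.log n := ArithmeticFunction.vonMangoldt_le_log.trans
    (Real.log_le_log (by exact_mod_cast hpos1) (by exact_mod_cast hk1))
  have hb2 : Λ km.2 ≤ Real.log n := ArithmeticFunction.vonMangoldt_le_log.trans
    (Real.log_le_log (by exact_mod_cast hpos2) (by exact_mod_cast hk2))
  calc Λ km.1 * Λ km.2 ≤ Real.log n * Real.log n :=
        mul_le_mul hb1 hb2 ArithmeticFunction.vonMangoldt_nonneg hlogn
    _ = Real.log n ^ 2 * 1 := by ring
    _ ≤ _ := by gcongr

/-- **`G(n) ≤ 2(log₂ n + 1)(log n)²` for odd `n`** (the coordinate maps are injective on the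
antidiagonal, so each indicator sums to at most `#W ≤ log₂ n + 1`). [folklore] -/
theorem goldbachLambdaCount_le_of_odd {n : ℕ} (hn : Odd n) :
    Literature.NumberTheory.Sieve.goldbachLambdaCount n ≤
      2 * ((Nat.log 2 n : ℝ) + 1) * Real.log n ^ 2 := by
  unfold Literature.NumberTheory.Sieve.goldbachLambdaCount
  have hsum : ∑ km ∈ antidiagonal n, Λ km.1 * Λ km.2 ≤ ∑ km ∈ antidiagonal n, Real.log n ^ 2 *
      ((if km.1 ∈ powTwoUpTo n then (1 : ℝ) else 0) + (if km.2 ∈ powTwoUpTo n then 1 else 0)) :=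
    sum_le_sum fun km hkm ↦ term_le hn hkm
  refine hsum.trans ?_
  rw [← mul_sum, sum_add_distrib]
  have hfirst : ∑ km ∈ antidiagonal n, (if km.1 ∈ powTwoUpTo n then (1 : ℝ) else 0) ≤
      (Nat.log 2 n : ℝ) + 1 := by
    rw [← sum_filter, sum_const, nsmul_eq_mul, mul_one]
    have hcard : ((antidiagonal n).filter (fun km ↦ km.1 ∈ powTwoUpTo n)).card ≤
        (powTwoUpTo n).card := by
      refine card_le_card_of_injOn Prod.fst (fun km hkm ↦ (mem_filter.1 hkm).2) ?_
      intro a ha b hb hab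
      have ha' := HasAntidiagonal.mem_antidiagonal.1 (mem_filter.1 ha).1
      have hb' := HasAntidiagonal.mem_antidiagonal.1 (mem_filter.1 hb).1
      refine Prod.ext hab ?_
      change a.1 = b.1 at hab
      omega
    exact_mod_cast hcard.trans (card_powTwoUpTo_le n)
  have hsecond : ∑ km ∈ antidiagonal n, (if km.2 ∈ powTwoUpTo n then (1 : ℝ) else 0) ≤
      (Nat.log 2 n : ℝ) + 1 := by
    rw [← sum_filter, sum_const, nsmul_eq_mul, mul_one]
    have hcard : ((antidiagonal n).filter (fun km ↦ km.2 ∈ powTwoUpTo n)).card ≤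
        (powTwoUpTo n).card := by
      refine card_le_card_of_injOn Prod.snd (fun km hkm ↦ (mem_filter.1 hkm).2) ?_
      intro a ha b hb hab
      have ha' := HasAntidiagonal.mem_antidiagonal.1 (mem_filter.1 ha).1
      have hb' := HasAntidiagonal.mem_antidiagonal.1 (mem_filter.1 hb).1
      refine Prod.ext ?_ hab
      change a.2 = b.2 at hab
      omega
    exact_mod_cast hcard.trans (card_powTwoUpTo_le n)
  have hlog2 : 0 ≤ Real.log n ^ 2 := by positivity
  have := mul_le_mul_of_nonneg_left (add_le_add hfirst hsecond) hlog2
  linarith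

/-- **`G(n) ≤ 4 (log n)³ + 2 (log n)²` for odd `n`** (`log₂ n ≤ log n/log 2 ≤ 2 log n`; the
inequality `log₂ n ≤ 2 log n` is also the tree's
`Literature.NumberTheory.LFunctions.MRT2015.natLog_two_le_two_mul_log`, re-derived inline here to
keep this catalogue file's imports unchanged). [folklore] -/
theorem goldbachLambdaCount_le_of_odd' {n : ℕ} (hn : Odd n) :
    Literature.NumberTheory.Sieve.goldbachLambdaCount n ≤
      4 * Real.log n ^ 3 + 2 * Real.log n ^ 2 := by
  have h := goldbachLambdaCount_le_of_odd hn
  have hlogn : 0 ≤ Real.log n := Real.log_natCast_nonneg n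
  have hl : (Nat.log 2 n : ℝ) ≤ 2 * Real.log n := by
    have hb := Real.natLog_le_logb n 2
    have hlog2 : (1 : ℝ) / 2 < Real.log 2 := by
      have := Real.log_two_gt_d9; norm_num at this ⊢; linarith
    have hN : (0 : ℝ) ≤ Nat.log 2 n := Nat.cast_nonneg _
    rw [Real.logb, Nat.cast_ofNat, le_div_iff₀ (by linarith)] at hb
    nlinarith
  have hlog2 : 0 ≤ Real.log n ^ 2 := by positivity
  have hprod := mul_le_mul_of_nonneg_right hl hlog2
  nlinarith

/-- `S(m + 1) = S(m) + G(m + 1)`. [folklore] -/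
theorem goldbachLambdaSum_succ (m : ℕ) :
    goldbachLambdaSum (m + 1) = goldbachLambdaSum m +
      Literature.NumberTheory.Sieve.goldbachLambdaCount (m + 1) := by
  unfold goldbachLambdaSum
  rw [sum_range_succ]

end PowerSavingVacuity

open PowerSavingVacuity in
/-- **The technique class is empty for `δ > 1`.** `S(x) = x²/2 + O(x^{2−δ})` along the integers
fails for every `δ > 1`: at an odd `x`, `S(x) − S(x−1) = G(x) ≤ 4 log³x + 2 log²x` (only the
pairs containing a power of two contribute), whereas `x²/2 − (x−1)²/2 = x − 1/2`; two consecutive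
errors of size `O(x^{2−δ}) = o(x)` cannot absorb the jump. So `GoldbachAverageZeros` carries
content only for `δ ≤ 1`, where its hypothesis is the printed one. [folklore] -/
theorem not_powerSavingGoldbachAverage_of_one_lt {δ : ℝ} (hδ : 1 < δ) :
    ¬ PowerSavingGoldbachAverage δ := by
  intro h
  -- reduce to an exponent `δ₁ ∈ (1, 3/2]`
  set δ₁ : ℝ := min δ (3 / 2) with hδ₁
  have h₁ : PowerSavingGoldbachAverage δ₁ := h.mono (min_le_left _ _)
  have hδ₁1 : 1 < δ₁ := lt_min hδ (by norm_num)
  have hδ₁2 : δ₁ ≤ 3 / 2 := min_le_right _ _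
  obtain ⟨C, hC0, hCw⟩ := h₁.exists_pos
  rw [IsBigOWith_def, eventually_atTop] at hCw
  obtain ⟨N₀, hN₀⟩ := hCw
  -- eventual smallness of the polylog and of `x^{2-δ₁}` against `x`, along `m ↦ m + 1`
  have hlog3 : ∀ᶠ x : ℝ in atTop, ‖Real.log x ^ 3‖ ≤ 1 / 32 * ‖x‖ :=
    (Real.isLittleO_pow_log_id_atTop (n := 3)).bound (by norm_num)
  have hlog2 : ∀ᶠ x : ℝ in atTop, ‖Real.log x ^ 2‖ ≤ 1 / 16 * ‖x‖ :=
    (Real.isLittleO_pow_log_id_atTop (n := 2)).bound (by norm_num)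
  have hrpow : ∀ᶠ x : ℝ in atTop, x ^ (-(δ₁ - 1)) < 1 / (8 * C) :=
    (tendsto_order.1 (tendsto_rpow_neg_atTop (by linarith : 0 < δ₁ - 1))).2 _ (by positivity)
  have hT : Tendsto (fun m : ℕ ↦ ((m + 1 : ℕ) : ℝ)) atTop atTop :=
    tendsto_natCast_atTop_atTop.comp (tendsto_add_atTop_nat 1)
  obtain ⟨N₁, hN₁⟩ := eventually_atTop.1
    (hT.eventually ((hlog3.and hlog2).and (hrpow.and (eventually_ge_atTop 1))))
  -- an even `m ≥ 2` beyond both thresholds; `x = m + 1` is odd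
  have hN₁le : N₁ ≤ 2 * (max N₀ N₁ + 1) := (le_max_right N₀ N₁).trans (by omega)
  have hN₀le : N₀ ≤ 2 * (max N₀ N₁ + 1) := (le_max_left N₀ N₁).trans (by omega)
  have hN₀le' : N₀ ≤ 2 * (max N₀ N₁ + 1) + 1 := hN₀le.trans (by omega)
  obtain ⟨⟨h3, h2⟩, hr, hx1⟩ := hN₁ (2 * (max N₀ N₁ + 1)) hN₁le
  have hE1 := hN₀ (2 * (max N₀ N₁ + 1) + 1) hN₀le'
  have hE0 := hN₀ (2 * (max N₀ N₁ + 1)) hN₀le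
  have hodd : Odd (2 * (max N₀ N₁ + 1) + 1) := odd_two_mul_add_one _
  have hG := goldbachLambdaCount_le_of_odd' hodd
  have hS := goldbachLambdaSum_succ (2 * (max N₀ N₁ + 1))
  have hm2 : 2 ≤ 2 * (max N₀ N₁ + 1) := by omega
  generalize 2 * (max N₀ N₁ + 1) = m at *
  have hm2' : (2 : ℝ) ≤ m := by exact_mod_cast hm2
  set X : ℝ := ((m + 1 : ℕ) : ℝ) with hX
  have hXm : X = (m : ℝ) + 1 := by rw [hX]; push_cast; ring
  have hX0 : 0 < X := by linarith
  -- unpack the norms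
  rw [Real.norm_eq_abs, Real.norm_eq_abs, abs_of_nonneg (Real.rpow_nonneg hX0.le _)] at hE1
  rw [Real.norm_eq_abs, Real.norm_eq_abs, abs_of_nonneg (Real.rpow_nonneg (Nat.cast_nonneg m) _)]
    at hE0
  rw [Real.norm_eq_abs, Real.norm_eq_abs, abs_of_pos hX0] at h3 h2
  have h3' : Real.log X ^ 3 ≤ 1 / 32 * X := (le_abs_self _).trans h3
  have h2' : Real.log X ^ 2 ≤ 1 / 16 * X := (le_abs_self _).trans h2
  -- `m^{2-δ₁} ≤ X^{2-δ₁} ≤ X/(8C)`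
  have hexp0 : 0 ≤ 2 - δ₁ := by linarith
  have hmX : ((m : ℕ) : ℝ) ^ (2 - δ₁) ≤ X ^ (2 - δ₁) :=
    Real.rpow_le_rpow (Nat.cast_nonneg _) (by linarith) hexp0
  have hXpow : X ^ (2 - δ₁) ≤ X * (1 / (8 * C)) := by
    have hsplit : X ^ (2 - δ₁) = X * X ^ (-(δ₁ - 1)) := by
      rw [show (2 - δ₁) = 1 + (-(δ₁ - 1)) by ring, Real.rpow_add hX0, Real.rpow_one]
    rw [hsplit]
    exact mul_le_mul_of_nonneg_left hr.le hX0.le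
  have hCX : C * X ^ (2 - δ₁) ≤ X / 8 := by
    calc C * X ^ (2 - δ₁) ≤ C * (X * (1 / (8 * C))) := mul_le_mul_of_nonneg_left hXpow hC0.le
      _ = X / 8 := by field_simp
  have hCm : C * ((m : ℕ) : ℝ) ^ (2 - δ₁) ≤ C * X ^ (2 - δ₁) := mul_le_mul_of_nonneg_left hmX hC0.le
  -- the jump identity `e₁ - e₀ = G(x) - (x - 1/2)`
  have hid : (goldbachLambdaSum (m + 1) - X ^ 2 / 2) - (goldbachLambdaSum m - ((m : ℕ) : ℝ) ^ 2 / 2)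
      = Literature.NumberTheory.Sieve.goldbachLambdaCount (m + 1) - (X - 1 / 2) := by
    rw [hS, hXm]; ring
  have ha := (abs_le.1 hE1).1
  have hb := (abs_le.1 hE0).2
  linarith

end Literature.Barriers.Parity

end
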